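import Summits.QuantumFields.YangMills.Theorems.BalabanUVNodesN15CurvedGluingSmoothCutDressedGluedAdjointRightInverseDefectFlatCut
import Summits.QuantumFields.YangMills.Theorems.BalabanUVNodesN15TwoSpacingGluingCurvedCoverRightEntriesDefect
import Summits.QuantumFields.YangMills.Theorems.BalabanUVNodesN15TwoSpacingGluingCurvedCoverShiftFits
import Summits.QuantumFields.YangMills.Theorems.BalabanUVNodesN15TwoSpacingGluingNeumannKnitEntryOne
import Summits.QuantumFields.YangMills.Theorems.BalabanUVNodesN15TwoSpacingGluingCurvedKnitAdjoint
import Summits.QuantumFields.YangMills.Theorems.BalabanUVNodesN15TwoSpacingGluingCurvedKnitGradientDefect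
import Summits.QuantumFields.YangMills.Theorems.BalabanUVNodesN15TwoSpacingGluingCurvedKnitAdjointDefectSmall
import Summits.QuantumFields.YangMills.Theorems.BalabanUVNodesN15CurvedGluingCubeDressedGeneralPerturbationLetters
import HarnessLib

/-!
# THE η-DEFECT OF ENTRY 2 (ADJOINT `G∘∇̂⁻_ν`) OF THE LIVE GLUED PROPAGATOR AT THE COVER, TWO GRIDS, GLOBAL GAUGE — n15-c∕174b ★★★ INSTANTIATED at the cover (FILE 138's pattern):
# cut flat cubes, the images cubes' sandwiched right entries and their two-grid defects (dag-n15-a (a)±∕(b)±∕(c)±), the TRUE right-locality defects (n15-c∕170–171) and their η-defect,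
# dag-n15-a's cube-cut defect rows (FILE 122b), the species of `U, U′` = ONE `TwoSidedLetters` hypothesis (dag-n15-w2's fifteen letters); every cover row discharged BY NAME
# (dag-n15-c g19, n15-c∕177; N15 = NE2, s1 road (c) — the two-grid half of entry 2 of [B9] (3.42) for the live family, adjoint arrangement)

Cell `pub-ymgap`, seat `pub-ymgap-dag-n15-c` (R134 (a); HUMAN RULING D-0062), generation 20 (draft g19).  `bears_on: R4∕N15 · K3⁸ SpineGivenEndpointR13SepCoPHV (stmt-QuantumFields-27366)`.
Filed `--kind proof --supports stmt-QuantumFields-27366 --as helper` — COUNT-NEUTRAL.  Theorems only; 0 `def`, 0 `sorry`.  Imports BY NAME n15-c∕174b, 177a, 177b, 177s, 175 (and through them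
167–174, 170–173, FILE 130∕120∕124), FILE 138 `…CurvedKnitGradientDefect` (for its import closure: FILES 121∕122∕122b, 77, 99, N-IIc∕e∕h families, `hasMaj_idef_gOp_pair_of_cubes`).

WHAT.  ★★★ `one_idef_bgrad_cvGlued`: `∃ δ w₀ R₀ D > 0, ∀ mv kk r ν (k ≥ 1, L^m ≥ w₀) e he U U′ (r_S ≤ R₀, θ ≥ 0)`, `TwoSidedLetters J ι π̂ τ τ′ η⁻¹ η′⁻¹ r_S θ (C′,A′) (C,A)` ⟹
`𝔇_π̂(cvGlued′…U′… ∘ ∇̂′⁻_ν, cvGlued…U… ∘ ∇̂⁻_ν) ≤ D·((L^k)^{−1∕16} + (L^k)^{−1∕(8(d+1))} + r_S θ)·e^{−(δ∕16)d}` from the coarse unit blocks to the fine grid read on them.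
The constant bookkeeping: every two-grid letter of 174b is bounded by `κ·S` and every window letter by its `W`-free value; n15-c∕177s `cvSmall177` (the monotone evaluation of 174b's
kernel constant, degree-one homogeneous in the two-grid letters) gives `≤ D·S`.

HONEST FRAMING ∕ LIMITS.  Bookkeeping over LANDED theorems on dag-n15-a's MODEL carriers; `U, U′` and their fifteen letters are DISPLAYED hypotheses; nothing of [B5]∕[B6]∕[B9] asserted
(Thm 3.14 pp.426–427 = difference TEMPLATE; Thm 3.1 (3.42) = SHAPE).  NE2 for non-abelian `G(U)` NOT proved (C-N15-1); N15 booked «discharged AS CONSUMED at the U-blind v7 pin» (№253) —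
road (c)'s bookkeeping, NO count; K3⁸ skeleton untouched; one finite 𝕋⁴ at fixed ε — NOT infinite volume, NOT OS, NOT a mass gap, NOT Clay.  Restate-immune (no Theses import).
-/

noncomputable section

open scoped BigOperators Matrix Matrix.Norms.Frobenius

namespace Summit.QuantumFields.YangMills.BalabanUVNodes.N15.Gluing

open Real
open Literature.MathematicalPhysics.QuantumFieldTheory.Balaban1983to89
open Literature.MathematicalPhysics.QuantumFieldTheory.Balaban1983to89.B5Prop11Plancherel (Tor fine unitVec)
open Literature.MathematicalPhysics.QuantumFieldTheory.Balaban1983to89.B11SectG (BlockNorm HasMaj RowSum hasMaj_zero)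
open Literature.MathematicalPhysics.QuantumFieldTheory.Balaban1983to89.B6RandomWalk (Triangle254)
open Literature.MathematicalPhysics.QuantumFieldTheory.Balaban1983to89.T4EtaRateDefect (idef idef_zero)
open Literature.MathematicalPhysics.QuantumFieldTheory.Balaban1983to89.T4EtaRateCoeffDefect (pull diagK diagK_nonneg diagK_same hasMaj_mulOp hasMaj_pull)
open Literature.MathematicalPhysics.QuantumFieldTheory.Balaban1983to89.B6Prop26Gluing (mulOp mulOp_apply ind ind_nonneg ind_le_one)
open Literature.MathematicalPhysics.QuantumFieldTheory.Balaban1983to89.B6UnitTorusCarrier (unitTorusGeo triangle254_unitTorusGeo rowSum_unitTorusGeo unitTorusGeo_dist_nonneg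
  unitTorusGeo_dist_symm unitTorusGeo_dist_self)
open Literature.MathematicalPhysics.QuantumFieldTheory.Balaban1983to89.B5SiteBridgeP12 (MP)
open Literature.MathematicalPhysics.QuantumFieldTheory.King1986.Torus (blockOf tdistT tdistT_nonneg tdistT_symm)
open Literature.Barriers.QuantumFields (traceForm)
open Summit.QuantumFields.YangMills.BalabanUVNodes.N15.BackgroundLayer (fgrad fgradAdj bgrad fgrad_apply fgradAdj_apply bgrad_apply stack projO projO_none_comp_stack bgPropV blkPair liftPair
  covLapM tCoefA tCoefC unstackM fgradMat hasMaj_unstackM hasMaj_idef_unstackM tensorId_comp_tensorId TwoSidedLetters)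
open Summit.QuantumFields.YangMills.BalabanUVNodes.N15.VectorPiece (bshiftEquiv bshiftEquiv_apply kingPrV tensorId hasMaj_tensorId tdistT_blockOf_sub_unitVec_le)
open Summit.QuantumFields.YangMills.BalabanUVNodes.N15.MatrixSpecies (mmulOp coordMat liftBlk liftMap liftEquiv liftEquiv_apply liftEquiv_symm_apply)
open Summit.QuantumFields.YangMills.BalabanUVNodes.N15.TwoGrid (paramsOf symbOp sD sTinv symOp landauRe qvRe qvAdjRe gOp neumannCubeG chiCube cubeBlocks ineq110_114_pair hasMaj_gOp_of_ineq
  hasMaj_grad_of_ineq hasMaj_gGrad_of_ineq hasMaj_chiCube_symOp_gGrad_of hasMaj_chiCube_symOp_gDivAdj_of_ineq hasMaj_landauRe chiCube_of_not_mem abs_chiCube_le_one tensorId_mulOp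
  mulOp_fst_comp_tensorId tensorId_comp_mulOp_fst chiCube_kingPrV hasMaj_idef_rightGrad hasMaj_idef_rightBgrad hasMaj_idef_chiCube_neumannCubeG
  hasMaj_idef_chiCube_grad_neumannCubeG hasMaj_idef_chiCube_divAdjOut_neumannCubeG)
open Summit.QuantumFields.YangMills.BalabanUVNodes.N15.CurvedSpecies (gaugePair uN_localOp_species_form)

variable {d : ℕ}

section Knit

variable {L : ℕ} [NeZero L]

set_option maxHeartbeats 16000000 in
set_option maxRecDepth 4096 in
/-- ★★★ **THE η-DEFECT OF ENTRY 2 `cvGlued∘∇̂⁻_ν` OF THE LIVE GLUED PROPAGATOR AT THE COVER, TWO GRIDS, GLOBAL GAUGE** — n15-c∕174b instantiated; displayed: `U, U′` and their fifteen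
`TwoSidedLetters` (dag-n15-w2).  Rate `(L^k)^{−1∕16} + (L^k)^{−1∕(8(d+1))} + r_Sθ`. [cite: Balaban1985BackgroundPropagators, Thm 3.14 pp.426–427 (η-rate: difference template), Thm 3.1
p.397 ((3.42) entry `G∇*`: shape), (3.62)–(3.65) pp.402–403; Balaban1984PropagatorsII, (2.133)–(2.136) p.247; King1986, p.664 (pairing)] -/
theorem one_idef_bgrad_cvGlued (hL : Odd L ∧ 1 < L) (hL7 : 7 ≤ L) {a : ℝ} (ha : 0 < a) (ι : Type) [Fintype ι] [DecidableEq ι] :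
    ∃ δ w₀ R₀ D : ℝ, 0 < δ ∧ 0 < R₀ ∧ 0 < D ∧
      ∀ (mv kk r : ℕ) (ν : Fin (d + 1)), 1 ≤ kk → w₀ ≤ ((L ^ mv : ℕ) : ℝ) →
      ∀ {mm : Type} [Fintype mm] [DecidableEq mm] (e : Matrix mm mm ℂ ≃L[ℝ] (ι → ℝ)), (∀ A B : Matrix mm mm ℂ, traceForm A B = e A ⬝ᵥ e B) →
      ∀ (U : Fin (d + 1) → CvX d L mv kk hL → Matrix mm mm ℂ) (U' : Fin (d + 1) → CvX' d L mv kk r hL → Matrix mm mm ℂ) (rS θ : ℝ), 0 ≤ rS → 0 ≤ θ → rS ≤ R₀ →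
        TwoSidedLetters (Fin (d + 1)) ι (kingPrV L kk r (cvM d L mv kk hL)) (bshiftEquiv (cvM d L mv kk hL) (L ^ kk)) (bshiftEquiv (cvM d L mv kk hL) (L ^ r * L ^ kk)) ((((L ^ kk : ℕ) : ℝ))⁻¹)⁻¹ ((((L ^ r * L ^ kk : ℕ) : ℝ))⁻¹)⁻¹ rS θ ((tCoefC ((((L ^ r * L ^ kk : ℕ) : ℝ))⁻¹) (gaugePair (bshiftEquiv (cvM d L mv kk hL) (L ^ r * L ^ kk)) fun μ x => coordMat e (ContinuousLinearMap.mulLeftRight ℝ (Matrix mm mm ℂ) ((1 : Matrix mm mm ℂ) * U' μ x * (1 : Matrix mm mm ℂ)ᴴ) ((1 : Matrix mm mm ℂ) * U' μ x * (1 : Matrix mm mm ℂ)ᴴ)ᴴ))), (tCoefA ((((L ^ r * L ^ kk : ℕ) : ℝ))⁻¹) (gaugePair (bshiftEquiv (cvM d L mv kk hL) (L ^ r * L ^ kk)) fun μ x => coordMat e (ContinuousLinearMap.mulLeftRight ℝ (Matrix mm mm ℂ) ((1 : Matrix mm mm ℂ) * U' μ x * (1 : Matrix mm mm ℂ)ᴴ)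 ((1 : Matrix mm mm ℂ) * U' μ x * (1 : Matrix mm mm ℂ)ᴴ)ᴴ)))) ((tCoefC ((((L ^ kk : ℕ) : ℝ))⁻¹) (gaugePair (bshiftEquiv (cvM d L mv kk hL) (L ^ kk)) fun μ x => coordMat e (ContinuousLinearMap.mulLeftRight ℝ (Matrix mm mm ℂ) ((1 : Matrix mm mm ℂ) * U μ x * (1 : Matrix mm mm ℂ)ᴴ) ((1 : Matrix mm mm ℂ) * U μ x * (1 : Matrix mm mm ℂ)ᴴ)ᴴ))), (tCoefA ((((L ^ kk : ℕ) : ℝ))⁻¹) (gaugePair (bshiftEquiv (cvM d L mv kk hL) (L ^ kk)) fun μ x => coordMat e (ContinuousLinearMap.mulLeftRight ℝ (Matrix mm mm ℂ) ((1 : Matrix mm mm ℂ) * U μ x * (1 : Matrix mm mm ℂ)ᴴ) ((1 : Matrix mm mm ℂ) * U μ x * (1 : Matrix mm mm ℂ)ᴴ)ᴴ)))) →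
        HasMaj (CvNorm d L mv kk hL ι) (BlockNorm.ofBlocks (unitTorusGeo L kk (cvM d L mv kk hL)) (liftBlk (cvBlk d L mv kk hL ∘ (kingPrV L kk r (cvM d L mv kk hL))) ι))
          (idef (pull (liftMap (kingPrV L kk r (cvM d L mv kk hL)) ι)) (pull (liftMap (kingPrV L kk r (cvM d L mv kk hL)) ι)) ((cvGlued' d L mv kk r hL a ((((L ^ r * L ^ kk : ℕ) : ℝ))⁻¹) ι e (fun _ _ => (1 : Matrix mm mm ℂ)) U' (cvNL' d L mv kk r hL a ι) (fun _ => 0)) ∘ₗ bgrad ((((L ^ r * L ^ kk : ℕ) : ℝ))⁻¹)⁻¹ (liftEquiv ((bshiftEquiv (cvM d L mv kk hL) (L ^ r * L ^ kk)) ν) ι)) ((cvGlued d L mv kk hL a ((((L ^ kk : ℕ) : ℝ))⁻¹) ι e (fun _ _ => (1 : Matrix mm mm ℂ)) U (cvNL d L mv kk hL a ι) (fun _ => 0)) ∘ₗ bgrad ((((L ^ kk : ℕ) : ℝ))⁻¹)⁻¹ (liftEquiv ((bshiftEquiv (cvM d L mv kk hL) (L ^ kk)) ν) ι)))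
          (fun y y' => D * (((L ^ kk : ℕ) : ℝ) ^ (-(1 / 16 : ℝ)) + ((L ^ kk : ℕ) : ℝ) ^ (-(1 / (8 * ((d : ℝ) + 1)))) + rS * θ) * Real.exp (-(δ / 16 * (unitTorusGeo L kk (cvM d L mv kk hL)).dist y y'))) := by
  have hLodd : Odd L := hL.1; have hL3 : 3 ≤ L := by omega
  have hL2 : 2 ≤ L := by omega
  have hLpos : 0 < L := by omega
  obtain ⟨δ₀, C, Cα, Cε, Cαε, hδ₀, hC, H⟩ := ineq110_114_pair (d := d) hL ha; obtain ⟨δ₁, C₁, hδ₁, hC₁, HL⟩ := hasMaj_landauRe (d := d) (L := L); obtain ⟨δ', w₀', R₀', θ₀', B', hδ', hR₀', hθ₀', hB', H120⟩ := uN_cvGlued_spec (d := d) hL hL7 ha ι; obtain ⟨δ'', w₀'', R₀'', θ₀'', B'', hδ'', hR₀'', hθ₀'', hB'', H124⟩ := uN_cvGlued'_spec (d := d) hL hL7 ha ι; obtain ⟨δc, mc, hδc, hmc, HC⟩ := hasMaj_idef_chiCube_neumannCubeG (d := d) hLodd hL2 ha (γ := 1 / 8) (by norm_num) (by norm_num);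 obtain ⟨δe, me, hδe, hme, HE⟩ := hasMaj_idef_chiCube_grad_neumannCubeG (d := d) hLodd hL2 ha; obtain ⟨δh, mh, hδh, hmh, HH⟩ := hasMaj_idef_chiCube_divAdjOut_neumannCubeG (d := d) hLodd hL2 ha; obtain ⟨δv, rr, hδv, hrr, HV⟩ := hasMaj_idef_nonlocal_family (d := d) hLodd hL2 ha (γ := 1 / 8) (by norm_num) (by norm_num); obtain ⟨δp, w₀p, Dp, hδp, hDp, HP0⟩ := hasMaj_idef_gOp_pair_of_cubes (d := d) hL ha; obtain ⟨δf, mf, hδf, hmf, HRF⟩ := hasMaj_idef_rightGrad (d := d) hLodd hL2 ha; obtain ⟨δb, mb, hδb, hmb, HRB⟩ := hasMaj_idef_rightBgrad (d := d) hLodd hL2 ha; obtain ⟨δm, hδm⟩ : ∃ δm : ℝ, δm = min (min (min δ₀ δ₁) (min δc δe)) (min (min δh δv) (min δp (min δf δb))) := ⟨_, rfl⟩; have hδm0 : 0 < δm := by rw [hδm]; exact lt_min (lt_min (lt_min hδ₀ hδ₁) (lt_min hδc hδe)) (lt_min (lt_min hδh hδv) (lt_min hδp (lt_min hδf hδb)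))
  have hδmδ₀ : δm ≤ δ₀ := by rw [hδm]; exact (min_le_left _ _).trans ((min_le_left _ _).trans (min_le_left _ _))
  have hδmδ₁ : δm ≤ δ₁ := by rw [hδm]; exact (min_le_left _ _).trans ((min_le_left _ _).trans (min_le_right _ _))
  have hδmδc : δm ≤ δc := by rw [hδm]; exact (min_le_left _ _).trans ((min_le_right _ _).trans (min_le_left _ _))
  have hδmδe : δm ≤ δe := by rw [hδm]; exact (min_le_left _ _).trans ((min_le_right _ _).trans (min_le_right _ _))
  have hδmδh : δm ≤ δh := by rw [hδm]; exact (min_le_right _ _).trans ((min_le_left _ _).trans (min_le_left _ _))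
  have hδmδv : δm ≤ δv := by rw [hδm]; exact (min_le_right _ _).trans ((min_le_left _ _).trans (min_le_right _ _))
  have hδmδp : δm ≤ δp := by rw [hδm]; exact (min_le_right _ _).trans ((min_le_right _ _).trans (min_le_left _ _))
  have hδmδf : δm ≤ δf := by rw [hδm]; exact (min_le_right _ _).trans ((min_le_right _ _).trans ((min_le_right _ _).trans (min_le_left _ _)))
  have hδmδb : δm ≤ δb := by rw [hδm]; exact (min_le_right _ _).trans ((min_le_right _ _).trans ((min_le_right _ _).trans (min_le_right _ _)))
  have hmax : 0 ≤ max me mh := hme.le.trans (le_max_left _ _); let cr : ℝ := B4Sect5Proof.latticeConst (d + 1) (δm / 32); have hcr_def : cr = B4Sect5Proof.latticeConst (d + 1) (δm / 32) := rfl; have hcr0 : 0 ≤ cr := B4Sect5Proof.latticeConst_nonneg (d + 1) (show (0 : ℝ) ≤ δm / 32 from div_nonneg hδm0.le (by norm_num)); let β : ℝ := 2 ^ (d + 1) * (C * Real.exp δ₀); have hβdef : β = 2 ^ (d + 1) * (C * Real.exp δ₀) := rfl; let β₁ : ℝ := 2 ^ (d + 1) * (C * Real.exp δ₀ * Real.exp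 δ₀); have hβ₁def : β₁ = 2 ^ (d + 1) * (C * Real.exp δ₀ * Real.exp δ₀) := rfl; let βQ : ℝ := 2 ^ (d + 1) * (2 * (C * Real.exp δ₀) * Real.exp δ₀); have hβQdef : βQ = 2 ^ (d + 1) * (2 * (C * Real.exp δ₀) * Real.exp δ₀) := rfl; let cN₀ : ℝ := |a| * (Real.exp δm * Real.exp δm) + C₁; have hcN₀def : cN₀ = |a| * (Real.exp δm * Real.exp δm) + C₁ := rfl; let Nov : ℝ := (((2 * L) ^ (d + 1) : ℕ) : ℝ); have hNovdef : Nov = (((2 * L) ^ (d + 1) : ℕ) : ℝ) := rfl; let cJ : ℝ := (Fintype.card (Fin (d + 1)) : ℝ); have hcJdef : cJ = (Fintype.card (Fin (d + 1)) : ℝ) := rfl; let cJJ : ℝ := (1 : ℝ) + Fintype.card (Fin (d + 1) ⊕ Fin (d + 1)); have hcJJdef : cJJ = (1 : ℝ) + Fintype.card (Fin (d + 1) ⊕ Fin (d + 1)) := rfl; let πD : ℝ := π * (d + 1); have hπDdef : πD = π * (d + 1) := rfl; let E' : ℝ := (Real.exp 1 * (δm / 2))⁻¹; have hE'def : E' =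 (Real.exp 1 * (δm / 2))⁻¹ := rfl; let cNn : ℝ := (πD * E' + 2 * πD) * cN₀; have hcNndef : cNn = (πD * E' + 2 * πD) * cN₀ := rfl; let KRN : ℝ := (πD * E' + 2 * πD) * rr + 2 * πD * cN₀; have hKRNdef : KRN = (πD * E' + 2 * πD) * rr + 2 * πD * cN₀ := rfl; let κF : ℝ := 2 ^ (d + 1) * (1 * C * (cN₀ * (4 / δm))) * cr * Real.exp (δm / 2); have hκFdef : κF = 2 ^ (d + 1) * (1 * C * (cN₀ * (4 / δm))) * cr * Real.exp (δm / 2) := rfl; let κFl : ℝ := 2 ^ (d + 1) * Real.exp (δm / 2) * ((1 * C * (cN₀ * πD + rr) * cr + 1 * Dp * cN₀ * cr) + (d + 1) * (1 * C * cN₀ * cr)) + πD * (2 ^ (d + 1) * ((1 : ℝ) * C * cN₀ * cr * Real.exp (δm / 2))); have hκFldef : κFl = 2 ^ (d + 1) * Real.exp (δm / 2) * ((1 * C * (cN₀ * πD + rr) * cr + 1 * Dp * cN₀ * cr) + (d + 1) * (1 * C * cN₀ * cr)) + πD * (2 ^ (d + 1) * ((1 : ℝ) * C * cN₀ * cr *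 Real.exp (δm / 2))) := rfl; let meh : ℝ := max me mh; have hmehdef : meh = max me mh := rfl; let θ₁ : ℝ := β + cJ * (2 * (βQ + β)); have hθ₁def : θ₁ = β + cJ * (2 * (βQ + β)) := rfl; let R₀ : ℝ := min (min (R₀' / cJJ) (R₀'' / cJJ)) (1 / (cJJ * (2 * ((β + (β₁ + π * β)) * cr * cr)) + 2 * (θ₁ * cr) + 1)); have hR₀def : R₀ = min (min (R₀' / cJJ) (R₀'' / cJJ)) (1 / (cJJ * (2 * ((β + (β₁ + π * β)) * cr * cr)) + 2 * (θ₁ * cr) + 1)) := rfl; let Rsp : ℝ := R₀ * cJJ; have hRspdef : Rsp = R₀ * cJJ := rfl; let θA : ℝ := θ₁ * R₀; have hθAdef : θA = θ₁ * R₀ := rfl; let Ktot : ℝ := ((((((cJ * ((3 * (((β + (β₁ + (π * β))) * (1 - (((β + (β₁ + (π * β))) * (Rsp * cr)) * cr))⁻¹) * (32 * π ^ 2))) + (2 * ((((1 - (θA * cr))⁻¹ * βQ) * cr) * π)))) + 0) + ((((β + (β₁ + (π * β))) * (1 - (((β + (β₁ + (π * β))) * (Rsp * cr)) * cr))⁻¹)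 * cNn) * cr)) + ((cJ * ((2 * R₀) * ((π * ((β + (β₁ + (π * β))) * (1 - (((β + (β₁ + (π * β))) * (Rsp * cr)) * cr))⁻¹)) + (π * (((1 - (θA * cr))⁻¹ * βQ) * cr))))) + ((((β + (β₁ + (π * β))) * (1 - (((β + (β₁ + (π * β))) * (Rsp * cr)) * cr))⁻¹) * (((πD * ((Real.exp 1) * (δm / 2))⁻¹) + (2 * πD)) * 0)) * cr))) + 0) + (((1 - (θA * cr))⁻¹ * κF) * cr))
  have hKtotdef : Ktot = ((((((cJ * ((3 * (((β + (β₁ + (π * β))) * (1 - (((β + (β₁ + (π * β))) * (Rsp * cr)) * cr))⁻¹) * (32 * π ^ 2))) + (2 * ((((1 - (θA * cr))⁻¹ * βQ) * cr) * π)))) + 0) + ((((β + (β₁ + (π * β))) * (1 - (((β + (β₁ + (π * β))) * (Rsp * cr)) * cr))⁻¹) * cNn) * cr)) + ((cJ * ((2 * R₀) * ((π * ((β + (β₁ + (π * β))) * (1 - (((β + (β₁ + (π * β))) * (Rsp * cr)) * cr))⁻¹)) + (π * (((1 - (θA * cr))⁻¹ * βQ) * cr))))) + ((((β + (β₁ +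 (π * β))) * (1 - (((β + (β₁ + (π * β))) * (Rsp * cr)) * cr))⁻¹) * (((πD * ((Real.exp 1) * (δm / 2))⁻¹) + (2 * πD)) * 0)) * cr))) + 0) + (((1 - (θA * cr))⁻¹ * κF) * cr)) := rfl; let w₀ : ℝ := max (max w₀' w₀'') (max w₀p (2 * (Nov * Ktot * cr) + 3)); have hw₀def : w₀ = max (max w₀' w₀'') (max w₀p (2 * (Nov * Ktot * cr) + 3)) := rfl
  let Dinst : ℝ := (((2 * (Nov * (((((1 * ((2 * βQ) * cr)) * (πD + 2 * π)) + ((1 * ((1 * (((2 * ((1 * (mf + mb)) + (πD * βQ))) * cr) + ((2 * (((((((β * 1) + (mc * R₀)) + (cJ * (2 * (((βQ * 1) + ((mf + mb) * R₀)) + ((β * 1) + (mc * R₀)))))) + 0) + (πD * (((β * R₀) + (cJ * (2 * ((βQ * R₀) + (β * R₀))))) + 0))) * ((2 * βQ) * cr)) * cr)) * cr))) + 0)) * 1)) + ((πD * ((2 * βQ) * cr)) * 1)) + ((((1 * ((β + (β₁ + (π * β))) * 2)) * (64 * π ^ 2 + π ^ 2 * cJ)) + ((1 * ((((((mc + (πD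 * β)) + (((meh + ((2 * πD) * β₁)) + (π * mc)) + ((32 * π ^ 4 + π ^ 2 * (d + 1)) * β))) * cr) + ((1 * (((mc + (πD * β)) + (((meh + ((2 * πD) * β₁)) + (π * mc)) + ((32 * π ^ 4 + π ^ 2 * (d + 1)) * β))) * cr)) * ((Rsp * ((β + (β₁ + (π * β))) * 2)) * cr))) + (((((β + (β₁ + (π * β))) * cJJ) * cr) * ((β + (β₁ + (π * β))) * 2)) * cr)) * 2)) * π)) + ((πD * ((β + (β₁ + (π * β))) * 2)) * π))))) * cr) + ((2 * (((Nov * ((((((((cJ * ((3 * ((((β + (β₁ + (π * β))) * 2) * (144 * π ^ 3 + 32 * π ^ 3 * cJ)) + (((((((mc + (πD * β)) + (((meh + ((2 * πD) * β₁)) + (π * mc)) + ((32 * π ^ 4 + π ^ 2 * (d + 1)) * β))) * cr) + ((1 * (((mc + (πD * β)) + (((meh + ((2 * πD) * β₁)) + (π * mc)) + ((32 * π ^ 4 + π ^ 2 * (d + 1)) * β))) * cr)) * ((Rsp * ((β + (β₁ + (π * β))) * 2)) * cr))) + (((((β + (β₁ + (π * β))) * cJJ) * cr) * ((β + (β₁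 + (π * β))) * 2)) * cr)) * 2) * (32 * π ^ 2)))) + (2 * ((((2 * βQ) * cr) * (64 * π ^ 2 + π ^ 2 * cJ)) + ((((2 * ((1 * (mf + mb)) + (πD * βQ))) * cr) + ((2 * (((((((β * 1) + (mc * R₀)) + (cJ * (2 * (((βQ * 1) + ((mf + mb) * R₀)) + ((β * 1) + (mc * R₀)))))) + 0) + (πD * (((β * R₀) + (cJ * (2 * ((βQ * R₀) + (β * R₀))))) + 0))) * ((2 * βQ) * cr)) * cr)) * cr)) * π))))) + 0) + ((((β + (β₁ + (π * β))) * 2) * KRN) * cr)) + ((((((((mc + (πD * β)) + (((meh + ((2 * πD) * β₁)) + (π * mc)) + ((32 * π ^ 4 + π ^ 2 * (d + 1)) * β))) * cr) + ((1 * (((mc + (πD * β)) + (((meh + ((2 * πD) * β₁)) + (π * mc)) + ((32 * π ^ 4 + π ^ 2 * (d + 1)) * β))) * cr)) * ((Rsp * ((β + (β₁ + (π * β))) * 2)) * cr))) + (((((β + (β₁ + (π * β))) * cJJ) * cr) * ((β + (β₁ + (π * β))) * 2)) * cr)) * 2) * cNn) * cr)) + (((cJ * (2 * ((R₀ * ((((π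 * ((((((mc + (πD * β)) + (((meh + ((2 * πD) * β₁)) + (π * mc)) + ((32 * π ^ 4 + π ^ 2 * (d + 1)) * β))) * cr) + ((1 * (((mc + (πD * β)) + (((meh + ((2 * πD) * β₁)) + (π * mc)) + ((32 * π ^ 4 + π ^ 2 * (d + 1)) * β))) * cr)) * ((Rsp * ((β + (β₁ + (π * β))) * 2)) * cr))) + (((((β + (β₁ + (π * β))) * cJJ) * cr) * ((β + (β₁ + (π * β))) * 2)) * cr)) * 2)) + ((64 * π ^ 2 + π ^ 2 * cJ) * ((β + (β₁ + (π * β))) * 2))) + (π * (((2 * ((1 * (mf + mb)) + (πD * βQ))) * cr) + ((2 * (((((((β * 1) + (mc * R₀)) + (cJ * (2 * (((βQ * 1) + ((mf + mb) * R₀)) + ((β * 1) + (mc * R₀)))))) + 0) + (πD * (((β * R₀) + (cJ * (2 * ((βQ * R₀) + (β * R₀))))) + 0))) * ((2 * βQ) * cr)) * cr)) * cr)))) + ((2 * π) * ((2 * βQ) * cr)))) + (1 * ((π * ((β + (β₁ + (π * β))) * 2)) + (π * ((2 * βQ) * cr))))))) + 0) + 0)) + 0) + (πD * (((((cJ * ((3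 * (((β + (β₁ + (π * β))) * 2) * (32 * π ^ 2))) + (2 * (((2 * βQ) * cr) * π)))) + 0) + ((((β + (β₁ + (π * β))) * 2) * cNn) * cr)) + ((cJ * ((2 * R₀) * ((π * ((β + (β₁ + (π * β))) * 2)) + (π * ((2 * βQ) * cr))))) + 0)) + 0))) + ((1 * (((2 * κFl) * cr) + ((2 * (((((((β * 1) + (mc * R₀)) + (cJ * (2 * (((βQ * 1) + ((mf + mb) * R₀)) + ((β * 1) + (mc * R₀)))))) + 0) + (πD * (((β * R₀) + (cJ * (2 * ((βQ * R₀) + (β * R₀))))) + 0))) * ((2 * κF) * cr)) * cr)) * cr))) + (πD * ((2 * κF) * cr))))) * ((2 * (Nov * ((((2 * βQ) * cr) * 1) + (((β + (β₁ + (π * β))) * 2) * π)))) * cr)) * cr)) * cr))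
  have hDinst : Dinst = (((2 * (Nov * (((((1 * ((2 * βQ) * cr)) * (πD + 2 * π)) + ((1 * ((1 * (((2 * ((1 * (mf + mb)) + (πD * βQ))) * cr) + ((2 * (((((((β * 1) + (mc * R₀)) + (cJ * (2 * (((βQ * 1) + ((mf + mb) * R₀)) + ((β * 1) + (mc * R₀)))))) + 0) + (πD * (((β * R₀) + (cJ * (2 * ((βQ * R₀) + (β * R₀))))) + 0))) * ((2 * βQ) * cr)) * cr)) * cr))) + 0)) * 1)) + ((πD * ((2 * βQ) * cr)) * 1)) + ((((1 * ((β + (β₁ + (π * β))) * 2)) * (64 * π ^ 2 + π ^ 2 * cJ)) + ((1 * ((((((mc + (πD * β)) + (((meh + ((2 * πD) * β₁)) + (π * mc)) + ((32 * π ^ 4 + π ^ 2 * (d + 1)) * β))) * cr) + ((1 * (((mc + (πD * β)) + (((meh + ((2 * πD) * β₁)) + (π * mc)) + ((32 * π ^ 4 + π ^ 2 * (d + 1)) * β))) * cr)) * ((Rsp * ((β + (β₁ + (π * β))) * 2)) * cr))) + (((((β + (β₁ + (π * β))) * cJJ) * cr) * ((β + (β₁ + (π * β))) * 2)) * cr))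 * 2)) * π)) + ((πD * ((β + (β₁ + (π * β))) * 2)) * π))))) * cr) + ((2 * (((Nov * ((((((((cJ * ((3 * ((((β + (β₁ + (π * β))) * 2) * (144 * π ^ 3 + 32 * π ^ 3 * cJ)) + (((((((mc + (πD * β)) + (((meh + ((2 * πD) * β₁)) + (π * mc)) + ((32 * π ^ 4 + π ^ 2 * (d + 1)) * β))) * cr) + ((1 * (((mc + (πD * β)) + (((meh + ((2 * πD) * β₁)) + (π * mc)) + ((32 * π ^ 4 + π ^ 2 * (d + 1)) * β))) * cr)) * ((Rsp * ((β + (β₁ + (π * β))) * 2)) * cr))) + (((((β + (β₁ + (π * β))) * cJJ) * cr) * ((β + (β₁ + (π * β))) * 2)) * cr)) * 2) * (32 * π ^ 2)))) + (2 * ((((2 * βQ) * cr) * (64 * π ^ 2 + π ^ 2 * cJ)) + ((((2 * ((1 * (mf + mb)) + (πD * βQ))) * cr) + ((2 * (((((((β * 1) + (mc * R₀)) + (cJ * (2 * (((βQ * 1) + ((mf + mb) * R₀)) + ((β * 1) + (mc * R₀)))))) + 0) + (πD * (((β * R₀) + (cJ * (2 * ((βQ * R₀) + (β * R₀))))) +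 0))) * ((2 * βQ) * cr)) * cr)) * cr)) * π))))) + 0) + ((((β + (β₁ + (π * β))) * 2) * KRN) * cr)) + ((((((((mc + (πD * β)) + (((meh + ((2 * πD) * β₁)) + (π * mc)) + ((32 * π ^ 4 + π ^ 2 * (d + 1)) * β))) * cr) + ((1 * (((mc + (πD * β)) + (((meh + ((2 * πD) * β₁)) + (π * mc)) + ((32 * π ^ 4 + π ^ 2 * (d + 1)) * β))) * cr)) * ((Rsp * ((β + (β₁ + (π * β))) * 2)) * cr))) + (((((β + (β₁ + (π * β))) * cJJ) * cr) * ((β + (β₁ + (π * β))) * 2)) * cr)) * 2) * cNn) * cr)) + (((cJ * (2 * ((R₀ * ((((π * ((((((mc + (πD * β)) + (((meh + ((2 * πD) * β₁)) + (π * mc)) + ((32 * π ^ 4 + π ^ 2 * (d + 1)) * β))) * cr) + ((1 * (((mc + (πD * β)) + (((meh + ((2 * πD) * β₁)) + (π * mc)) + ((32 * π ^ 4 + π ^ 2 * (d + 1)) * β))) * cr)) * ((Rsp * ((β + (β₁ + (π * β))) * 2)) * cr))) + (((((β + (β₁ + (π * β))) * cJJ) * cr) * ((β + (β₁ + (π *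 β))) * 2)) * cr)) * 2)) + ((64 * π ^ 2 + π ^ 2 * cJ) * ((β + (β₁ + (π * β))) * 2))) + (π * (((2 * ((1 * (mf + mb)) + (πD * βQ))) * cr) + ((2 * (((((((β * 1) + (mc * R₀)) + (cJ * (2 * (((βQ * 1) + ((mf + mb) * R₀)) + ((β * 1) + (mc * R₀)))))) + 0) + (πD * (((β * R₀) + (cJ * (2 * ((βQ * R₀) + (β * R₀))))) + 0))) * ((2 * βQ) * cr)) * cr)) * cr)))) + ((2 * π) * ((2 * βQ) * cr)))) + (1 * ((π * ((β + (β₁ + (π * β))) * 2)) + (π * ((2 * βQ) * cr))))))) + 0) + 0)) + 0) + (πD * (((((cJ * ((3 * (((β + (β₁ + (π * β))) * 2) * (32 * π ^ 2))) + (2 * (((2 * βQ) * cr) * π)))) + 0) + ((((β + (β₁ + (π * β))) * 2) * cNn) * cr)) + ((cJ * ((2 * R₀) * ((π * ((β + (β₁ + (π * β))) * 2)) + (π * ((2 * βQ) * cr))))) + 0)) + 0))) + ((1 * (((2 * κFl) * cr) + ((2 * (((((((β * 1) + (mc * R₀)) + (cJ * (2 * (((βQ * 1) + ((mf + mb) *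 R₀)) + ((β * 1) + (mc * R₀)))))) + 0) + (πD * (((β * R₀) + (cJ * (2 * ((βQ * R₀) + (β * R₀))))) + 0))) * ((2 * κF) * cr)) * cr)) * cr))) + (πD * ((2 * κF) * cr))))) * ((2 * (Nov * ((((2 * βQ) * cr) * 1) + (((β + (β₁ + (π * β))) * 2) * π)))) * cr)) * cr)) * cr)) := rfl
  let Dout : ℝ := max Dinst 0 + 1; have hDdef : Dout = max Dinst 0 + 1 := rfl; have hβ0 : 0 ≤ β := by clear H HL H120 H124 HC HE HH HV HP0 HRF HRB; positivity
  have hβ₁0 : 0 ≤ β₁ := by clear H HL H120 H124 HC HE HH HV HP0 HRF HRB; positivity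
  have hβQ0 : 0 ≤ βQ := by clear H HL H120 H124 HC HE HH HV HP0 HRF HRB; positivity
  have hcN₀0 : 0 ≤ cN₀ := by clear H HL H120 H124 HC HE HH HV HP0 HRF HRB; positivity
  have hNov0 : 0 ≤ Nov := by clear H HL H120 H124 HC HE HH HV HP0 HRF HRB; positivity
  have hcJ0 : 0 ≤ cJ := by clear H HL H120 H124 HC HE HH HV HP0 HRF HRB; positivity
  have hE'0 : 0 ≤ E' := by clear H HL H120 H124 HC HE HH HV HP0 HRF HRB; positivity
  have hKRN0 : 0 ≤ KRN := by clear H HL H120 H124 HC HE HH HV HP0 HRF HRB; positivity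
  have hκFl0 : 0 ≤ κFl := by clear H HL H120 H124 HC HE HH HV HP0 HRF HRB; positivity
  have hmeh0 : 0 ≤ meh := hmax
  have hcJJ1 : 1 ≤ cJJ := by
    rw [hcJJdef]; have : (0 : ℝ) ≤ Fintype.card (Fin (d + 1) ⊕ Fin (d + 1)) := Nat.cast_nonneg _; linarith only [this]
  have hcJJ0 : 0 < cJJ := by linarith only [hcJJ1]
  have hθ₁0 : 0 ≤ θ₁ := by clear H HL H120 H124 HC HE HH HV HP0 HRF HRB; positivity
  have hden0 : 0 < cJJ * (2 * ((β + (β₁ + π * β)) * cr * cr)) + 2 * (θ₁ * cr) + 1 := by clear H HL H120 H124 HC HE HH HV HP0 HRF HRB; positivity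
  have hR₀0 : 0 < R₀ := by rw [hR₀def]; exact lt_min (lt_min (div_pos hR₀' hcJJ0) (div_pos hR₀'' hcJJ0)) (one_div_pos.mpr hden0)
  have hRsp0 : 0 ≤ Rsp := by clear H HL H120 H124 HC HE HH HV HP0 HRF HRB; positivity
  have hθA0 : 0 ≤ θA := by clear H HL H120 H124 HC HE HH HV HP0 HRF HRB; positivity
  have hR₀le : R₀ ≤ 1 / (cJJ * (2 * ((β + (β₁ + π * β)) * cr * cr)) + 2 * (θ₁ * cr) + 1) := by rw [hR₀def]; exact min_le_right _ _
  have hR₀le' : R₀ ≤ R₀' / cJJ := by rw [hR₀def]; exact (min_le_left _ _).trans (min_le_left _ _)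
  have hR₀le'' : R₀ ≤ R₀'' / cJJ := by rw [hR₀def]; exact (min_le_left _ _).trans (min_le_right _ _)
  have hq1 : R₀ * (cJJ * (2 * ((β + (β₁ + π * β)) * cr * cr)) + 2 * (θ₁ * cr) + 1) ≤ 1 := by have := mul_le_mul_of_nonneg_right hR₀le hden0.le; rwa [one_div, inv_mul_cancel₀ hden0.ne'] at this
  have hq₀ : (β + (β₁ + π * β)) * (Rsp * cr) * cr ≤ 1 / 2 := by
    have h2 : 0 ≤ R₀ * (2 * (θ₁ * cr) + 1) := mul_nonneg hR₀0.le (by clear H HL H120 H124 HC HE HH HV HP0 HRF HRB; positivity)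
    rw [show (β + (β₁ + π * β)) * (Rsp * cr) * cr = (R₀ * (cJJ * (2 * ((β + (β₁ + π * β)) * cr * cr)))) / 2 by rw [hRspdef]; ring]; linarith only [hq1, h2]
  have hqA₀ : θA * cr ≤ 1 / 2 := by
    have h2 : 0 ≤ R₀ * (cJJ * (2 * ((β + (β₁ + π * β)) * cr * cr)) + 1) := mul_nonneg hR₀0.le (by clear H HL H120 H124 HC HE HH HV HP0 HRF HRB; positivity)
    rw [show θA * cr = (R₀ * (2 * (θ₁ * cr))) / 2 by rw [hθAdef]; ring]; linarith only [hq1, h2]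
  have hq : (β + (β₁ + π * β)) * (Rsp * cr) * cr < 1 := hq₀.trans_lt (by norm_num); have hqA : θA * cr < 1 := hqA₀.trans_lt (by norm_num); have hIA0 : 0 ≤ (1 - θA * cr)⁻¹ := inv_nonneg.2 (by linarith only [hqA]); have hBB0 : 0 ≤ ((β + (β₁ + π * β)) * (1 - (β + (β₁ + π * β)) * (Rsp * cr) * cr)⁻¹) := mul_nonneg (by clear H HL H120 H124 HC HE HH HV HP0 HRF HRB; positivity) (inv_nonneg.2 (by linarith only [hq])); have hBBi0 : 0 ≤ (1 - (β + (β₁ + π * β)) * (Rsp * cr) * cr)⁻¹ := inv_nonneg.2 (by linarith only [hq]); have hBX0 : 0 ≤ ((1 - θA * cr)⁻¹ * βQ * cr) := by clear H HL H120 H124 HC HE HH HV HP0 HRF HRB; positivity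
  have hK0 : 0 ≤ Ktot := by
    clear H HL H120 H124 HC HE HH HV HP0 HRF HRB
    rw [hKtotdef]
    have h1 := hBBi0; have h3 := hIA0
    generalize (1 - (β + (β₁ + π * β)) * (Rsp * cr) * cr)⁻¹ = BBv at h1 ⊢
    generalize (1 - θA * cr)⁻¹ = IAv at h3 ⊢
    positivity
  have hD0 : 0 < Dout := by rw [hDdef]; exact add_pos_of_nonneg_of_pos (le_max_right _ _) one_pos
  have hcNn0 : 0 ≤ cNn := by clear H HL H120 H124 HC HE HH HV HP0 HRF HRB; positivity
  have hπD0 : 0 ≤ πD := by clear H HL H120 H124 HC HE HH HV HP0 HRF HRB; positivity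
  have hκF0 : 0 ≤ κF := by clear H HL H120 H124 HC HE HH HV HP0 HRF HRB; positivity
  refine ⟨δm, w₀, R₀, Dout, hδm0, hR₀0, hD0, fun mv kk r ν hk hw₀ => ?_⟩; intro mm _ _ e he U U' rS θ hrS hθ hrSle hTS
  -- the data of the cover at `(m, k, r)`
  let W : ℝ := ((L ^ mv : ℕ) : ℝ); have hWdef : W = ((L ^ mv : ℕ) : ℝ) := rfl; have hn : 1 ≤ L ^ kk := Nat.one_le_pow _ _ (by omega); have hn4 : 4 ≤ L ^ kk := le_trans (by omega : 4 ≤ L) (Nat.le_self_pow (by omega) L); have hn' : 1 ≤ L ^ r * L ^ kk := Nat.one_le_iff_ne_zero.mpr (Nat.mul_ne_zero (pow_ne_zero r (NeZero.ne L)) (pow_ne_zero kk (NeZero.ne L))); have hw₀' : w₀' ≤ ((L ^ mv : ℕ) : ℝ) := ((le_max_left _ _).trans (le_max_left _ _)).trans hw₀; have hw₀'' : w₀'' ≤ ((L ^ mv : ℕ) : ℝ) := ((le_max_right _ _).trans (le_max_left _ _)).trans hw₀; have hw₀p' : w₀p ≤ ((L ^ mv : ℕ) : ℝ) := ((le_max_left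 _ _).trans (le_max_right _ _)).trans hw₀; have hWK : 2 * (Nov * Ktot * cr) + 3 ≤ W := ((le_max_right _ _).trans (le_max_right _ _)).trans hw₀
  have hW3R : (3 : ℝ) ≤ W := by
    have : 0 ≤ 2 * (Nov * Ktot * cr) := mul_nonneg zero_le_two (mul_nonneg (mul_nonneg hNov0 hK0) hcr0); linarith only [hWK, this]
  have hW3 : 3 ≤ L ^ mv := by have h : (3 : ℝ) ≤ ((L ^ mv : ℕ) : ℝ) := hW3R; exact_mod_cast h
  have hW2 : 2 ≤ L ^ mv := by omega
  have hw : 0 < L ^ mv := by omega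
  have hW1 : (1 : ℝ) ≤ W := by linarith only [hW3R]
  have hWpos : (0 : ℝ) < W := by linarith only [hW3R]
  have hnR : (1 : ℝ) ≤ ((L ^ kk : ℕ) : ℝ) := by exact_mod_cast hn
  have hnR0 : (0 : ℝ) < ((L ^ kk : ℕ) : ℝ) := by linarith only [hnR]
  have hn'R0 : (0 : ℝ) < ((L ^ r * L ^ kk : ℕ) : ℝ) := Nat.cast_pos.mpr (Nat.mul_pos (pow_pos hLpos r) (pow_pos hLpos kk)); have hnn' : ((L ^ kk : ℕ) : ℝ) ≤ ((L ^ r * L ^ kk : ℕ) : ℝ) := by exact_mod_cast Nat.le_mul_of_pos_left _ (pow_pos hLpos r)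
  have hM : ∀ ν, cvM d L mv kk hL ν = 2 * L * L ^ mv := MP_succ_eq L mv kk hL; have hM' : ∀ ν, cvM d L mv kk hL ν = 2 * (L * L ^ mv) := fun ν => by rw [hM ν, mul_assoc]
  have hlo : (2 : ℝ) * ((L ^ mv : ℕ) : ℝ) ≤ ((2 * L ^ mv : ℕ) : ℝ) := by push_cast; exact le_rfl
  have hhi : ((2 * L ^ mv : ℕ) : ℝ) + ((L ^ mv : ℕ) : ℝ) + (2 + 1) * ((L ^ mv : ℕ) : ℝ) + 1 ≤ ((6 * L ^ mv + 1 : ℕ) : ℝ) := by push_cast; linarith only []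
  have hS6 : 6 * L ^ mv + 1 ≤ 2 * L * L ^ mv := by
    have h7 : 7 * L ^ mv ≤ L * L ^ mv := Nat.mul_le_mul_right _ hL7
    have e : 2 * L * L ^ mv = 2 * (L * L ^ mv) := by ring
    rw [e]; omega
  have hm₁ : 2 * L ^ mv ≤ coverMargin L mv := two_mul_le_coverMargin hL7 mv; have hmw : L ^ mv - 1 ≤ coverMargin L mv := by omega
  have hfitI : coverMargin L mv - 2 * L ^ mv + (6 * L ^ mv + 1) ≤ L * L ^ mv := coverMargin_inner_fit hL7 hW2; obtain ⟨hm₂, hfit₂⟩ := coverMargin_cut_margin hL7 hW3; have hfit0 := coverMargin_fit hL3 mv; have hfit : coverMargin L mv + 2 * L ^ mv + 1 ≤ L * L ^ mv := by omega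
  have hhi4 : coverMargin L mv + 4 * L ^ mv + 1 ≤ L * L ^ mv := by omega
  have hS0 : L * L ^ mv ≤ 2 * L * L ^ mv := by rw [mul_assoc]; omega
  have h3 : 3 ≤ L ^ kk * L ^ mv :=
    calc 3 ≤ L := hL3
      _ = L ^ 1 := (pow_one L).symm
      _ ≤ L ^ kk := Nat.pow_le_pow_right hLpos hk
      _ = L ^ kk * 1 := (mul_one _).symm
      _ ≤ L ^ kk * L ^ mv := Nat.mul_le_mul_left _ hw
  have hRq : (2 : ℝ) * 2 + 4 ≤ ((2 * L : ℕ) : ℝ) := by push_cast; linarith only [show (7 : ℝ) ≤ L by exact_mod_cast hL7]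
  let η : ℝ := ((((L ^ kk : ℕ) : ℝ))⁻¹); have hη : η = ((((L ^ kk : ℕ) : ℝ))⁻¹) := rfl; let η' : ℝ := ((((L ^ r * L ^ kk : ℕ) : ℝ))⁻¹); have hη' : η' = ((((L ^ r * L ^ kk : ℕ) : ℝ))⁻¹) := rfl; have hηinv : η⁻¹ = ((L ^ kk : ℕ) : ℝ) := by rw [hη, inv_inv]
  have hη'inv : η'⁻¹ = ((L ^ r * L ^ kk : ℕ) : ℝ) := by rw [hη', inv_inv]
  have hη1 : 1 ≤ η⁻¹ := by rw [hηinv]; exact_mod_cast hn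
  have hη'1 : 1 ≤ η'⁻¹ := by rw [hη'inv]; exact_mod_cast hn'
  have hη0 : 0 ≤ η := by rw [hη]; exact inv_nonneg.mpr hnR0.le
  have hη'0 : 0 ≤ η' := by rw [hη']; exact inv_nonneg.mpr hn'R0.le
  have hWinv0 : 0 ≤ W⁻¹ := inv_nonneg.2 hWpos.le; have hWinv1 : W⁻¹ ≤ 1 := inv_le_one_of_one_le₀ hW1; let εk : ℝ := ((L ^ kk : ℕ) : ℝ) ^ (-(1 / 16 : ℝ)); have hεkdef : εk = ((L ^ kk : ℕ) : ℝ) ^ (-(1 / 16 : ℝ)) := rfl; let εk8 : ℝ := ((L ^ kk : ℕ) : ℝ) ^ (-(1 / (8 * ((d : ℝ) + 1)))); have hεk8def : εk8 = ((L ^ kk : ℕ) : ℝ) ^ (-(1 / (8 * ((d : ℝ) + 1)))) := rfl; obtain ⟨hnε, hnwε, hw1, hεk0⟩ := rpow_sixteenth_facts hnR hW1; have hεk80 : 0 ≤ εk8 := Real.rpow_nonneg hnR0.le _; have hn'ε : (((L ^ r * L ^ kk : ℕ) : ℝ))⁻¹ ≤ εk := (inv_anti₀ hnR0 hnn').trans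 hnε; let Sx : ℝ := εk + εk8 + rS * θ; have hSxdef : Sx = εk + εk8 + rS * θ := rfl; have hrSθ0 : 0 ≤ rS * θ := mul_nonneg hrS hθ; have hSx0 : 0 ≤ Sx := add_nonneg (add_nonneg hεk0 hεk80) hrSθ0; have hεS : εk ≤ Sx := by rw [hSxdef]; linarith only [hεk80, hrSθ0]
  have hε8S : εk8 ≤ Sx := by rw [hSxdef]; linarith only [hεk0, hrSθ0]
  have hθS : rS * θ ≤ Sx := by rw [hSxdef]; linarith only [hεk0, hεk80]
  have hnS : (((L ^ kk : ℕ) : ℝ))⁻¹ ≤ Sx := hnε.trans hεS; have hnwS : (((L ^ kk : ℕ) : ℝ) * W)⁻¹ ≤ Sx := hnwε.trans hεS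
  -- THE SCALAR LETTERS (every `positivity` below sees only scalar hypotheses: the cover's eleven operator-valued hypotheses are cleared locally)
  -- nonnegativity of the displayed letters
  have hoχ0 : 0 ≤ (π * (d + 1) / (((L ^ kk : ℕ) : ℝ) * W)) := div_nonneg (by positivity) (mul_nonneg hnR0.le hWpos.le); have ho₀0 : 0 ≤ (π / W / ((L ^ r * L ^ kk : ℕ) : ℝ) + π / W / ((L ^ kk : ℕ) : ℝ)) := add_nonneg (div_nonneg (div_nonneg pi_pos.le hWpos.le) hn'R0.le) (div_nonneg (div_nonneg pi_pos.le hWpos.le) hnR0.le); have hos0 : 0 ≤ ((π * (d + 1) / (((L ^ kk : ℕ) : ℝ) * W)) + π / W / ((L ^ r * L ^ kk : ℕ) : ℝ) + π / W / ((L ^ kk : ℕ) : ℝ)) := add_nonneg (add_nonneg hoχ0 (div_nonneg (div_nonneg pi_pos.le hWpos.le) hn'R0.le)) (div_nonneg (div_nonneg pi_pos.le hWpos.le) hnR0.le); have hmT0 : 0 ≤ ((1 * ((mf + mb) * εk8) + 0 * βQ)) := add_nonneg (mul_nonneg zero_le_one (mul_nonneg (add_nonneg hmf.le hmb.le) hεk80))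 (mul_nonneg le_rfl hβQ0); have hoχ₂0 : 0 ≤ ((W)⁻¹ * (((L ^ kk : ℕ) : ℝ) * W)⁻¹ * (32 * π ^ 4 + π ^ 2 * (d + 1))) := mul_nonneg (mul_nonneg (inv_nonneg.mpr hWpos.le) (inv_nonneg.mpr (mul_nonneg hnR0.le hWpos.le))) (by positivity); have ho₁0 : 0 ≤ (|W⁻¹| * (((L ^ kk : ℕ) : ℝ) * W)⁻¹ * (64 * π ^ 2 + π ^ 2 * Fintype.card (Fin (d + 1)))) := mul_nonneg (mul_nonneg (abs_nonneg _) (inv_nonneg.mpr (mul_nonneg hnR0.le hWpos.le))) (by positivity); have ho₂0 : 0 ≤ (W⁻¹ ^ 2 * (((L ^ kk : ℕ) : ℝ) * W)⁻¹ * (144 * π ^ 3 + 32 * π ^ 3 * Fintype.card (Fin (d + 1)))) := mul_nonneg (mul_nonneg (pow_nonneg (inv_nonneg.mpr hWpos.le) 2) (inv_nonneg.mpr (mul_nonneg hnR0.le hWpos.le))) (by positivity); have hRNK0 : 0 ≤ ((π * (d + 1) / W * (Real.exp 1 * (δm / 2))⁻¹ + 2 * (π * (d + 1) / W)) * (rr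 * εk) + 2 * (π * (d + 1) / (((L ^ kk : ℕ) : ℝ) * W)) * cN₀) := add_nonneg (mul_nonneg (add_nonneg (mul_nonneg (div_nonneg hπD0 hWpos.le) hE'0) (mul_nonneg zero_le_two (div_nonneg hπD0 hWpos.le))) (mul_nonneg hrr.le hεk0)) (mul_nonneg (mul_nonneg zero_le_two (div_nonneg hπD0 (mul_nonneg hnR0.le hWpos.le))) hcN₀0); have hX0 : 0 ≤ Real.exp (-((δm - 3 * δm / 4) * (((coverMargin L mv : ℕ) : ℝ) + 1))) := Real.exp_nonneg _; have hX1 : Real.exp (-((δm - 3 * δm / 4) * (((coverMargin L mv : ℕ) : ℝ) + 1))) ≤ 1 := Real.exp_le_one_iff.mpr (neg_nonpos.mpr (mul_nonneg (by linarith only [hδm0]) (by positivity))); have hF0 : 0 ≤ 2 ^ (d + 1) * ((1 : ℝ) * C * ((|a| * (Real.exp δm * Real.exp δm) + C₁) * Real.exp (-((δm - 3 * δm / 4) * (((coverMargin L mv : ℕ) : ℝ) + 1)))) * cr * Real.exp (δm / 2)) := mul_nonneg (pow_nonneg zero_le_two _) (mul_nonneg (mul_nonneg (mul_nonneg (mul_nonneg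 zero_le_one hC.le) (mul_nonneg hcN₀0 (Real.exp_nonneg _))) hcr0) (Real.exp_nonneg _))
  have hK1710 : 0 ≤ ((2 ^ (d + 1) * Real.exp (δm / 2) * ((1 * C * (((|a| * (Real.exp δm * Real.exp δm) + C₁) * (π * (d + 1) / (((L ^ kk : ℕ) : ℝ) * W)) + rr * εk + 0 * (|a| * (Real.exp δm * Real.exp δm) + C₁)) * Real.exp (-((δm - 3 * δm / 4) * (((coverMargin L mv : ℕ) : ℝ) + 1)))) * cr + 1 * (Dp * εk) * ((|a| * (Real.exp δm * Real.exp δm) + C₁) * Real.exp (-((δm - 3 * δm / 4) * (((coverMargin L mv : ℕ) : ℝ) + 1)))) * cr) + (d + 1) * (1 * (|(((L ^ kk : ℕ) : ℝ))⁻¹| * C) * ((|a| * (Real.exp δm * Real.exp δm) + C₁) * Real.exp (-((δm - 3 * δm / 4) * (((coverMargin L mv : ℕ) : ℝ) + 1)))) * cr)) + (π * (d + 1) / (((L ^ kk : ℕ) : ℝ) * W)) * (2 ^ (d + 1) * ((1 : ℝ) * C * ((|a| * (Real.exp δm * Real.exp δm) + C₁) * Real.exp (-((δm - 3 * δm / 4)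 * (((coverMargin L mv : ℕ) : ℝ) + 1)))) * cr * Real.exp (δm / 2))))) := add_nonneg (mul_nonneg (mul_nonneg (pow_nonneg zero_le_two _) (Real.exp_nonneg _)) (add_nonneg (add_nonneg (mul_nonneg (mul_nonneg (mul_nonneg zero_le_one hC.le) (mul_nonneg (add_nonneg (add_nonneg (mul_nonneg hcN₀0 hoχ0) (mul_nonneg hrr.le hεk0)) (mul_nonneg le_rfl hcN₀0)) hX0)) hcr0) (mul_nonneg (mul_nonneg (mul_nonneg zero_le_one (mul_nonneg hDp.le hεk0)) (mul_nonneg hcN₀0 hX0)) hcr0)) (mul_nonneg (by positivity) (mul_nonneg (mul_nonneg (mul_nonneg zero_le_one (mul_nonneg (abs_nonneg _) hC.le)) (mul_nonneg hcN₀0 hX0)) hcr0)))) (mul_nonneg hoχ0 (mul_nonneg (pow_nonneg zero_le_two _) (mul_nonneg (mul_nonneg (mul_nonneg (mul_nonneg zero_le_one hC.le) (mul_nonneg hcN₀0 hX0)) hcr0) (Real.exp_nonneg _)))); have hK1510 : 0 ≤ (((β * (rS * θ) + (mc * εk) * R₀) + cJ * (2 * ((βQ * (rS * θ) + ((1 *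 ((mf + mb) * εk8) + 0 * βQ)) * R₀) + (β * (rS * θ) + (mc * εk) * R₀))) + (β * 0 + (mc * εk) * 0) * cr) + (π * (d + 1) / (((L ^ kk : ℕ) : ℝ) * W)) * (β * R₀ + cJ * (2 * (βQ * R₀ + β * R₀)) + β * 0 * cr)) := add_nonneg (add_nonneg (add_nonneg (add_nonneg (mul_nonneg hβ0 hrSθ0) (mul_nonneg (mul_nonneg hmc.le hεk0) hR₀0.le)) (mul_nonneg hcJ0 (mul_nonneg zero_le_two (add_nonneg (add_nonneg (mul_nonneg hβQ0 hrSθ0) (mul_nonneg hmT0 hR₀0.le)) (add_nonneg (mul_nonneg hβ0 hrSθ0) (mul_nonneg (mul_nonneg hmc.le hεk0) hR₀0.le)))))) (mul_nonneg (add_nonneg (mul_nonneg hβ0 le_rfl) (mul_nonneg (mul_nonneg hmc.le hεk0) le_rfl)) hcr0)) (mul_nonneg hoχ0 (add_nonneg (add_nonneg (mul_nonneg hβ0 hR₀0.le) (mul_nonneg hcJ0 (mul_nonneg zero_le_two (add_nonneg (mul_nonneg hβQ0 hR₀0.le) (mul_nonneg hβ0 hR₀0.le))))) (mul_nonneg (mul_nonneg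 hβ0 le_rfl) hcr0)))
  have hRFE0 : 0 ≤ ((1 - θA * cr)⁻¹ * ((2 ^ (d + 1) * Real.exp (δm / 2) * ((1 * C * (((|a| * (Real.exp δm * Real.exp δm) + C₁) * (π * (d + 1) / (((L ^ kk : ℕ) : ℝ) * W)) + rr * εk + 0 * (|a| * (Real.exp δm * Real.exp δm) + C₁)) * Real.exp (-((δm - 3 * δm / 4) * (((coverMargin L mv : ℕ) : ℝ) + 1)))) * cr + 1 * (Dp * εk) * ((|a| * (Real.exp δm * Real.exp δm) + C₁) * Real.exp (-((δm - 3 * δm / 4) * (((coverMargin L mv : ℕ) : ℝ) + 1)))) * cr) + (d + 1) * (1 * (|(((L ^ kk : ℕ) : ℝ))⁻¹| * C) * ((|a| * (Real.exp δm * Real.exp δm) + C₁) * Real.exp (-((δm - 3 * δm / 4) * (((coverMargin L mv : ℕ) : ℝ) + 1)))) * cr)) + (π * (d + 1) / (((L ^ kk : ℕ) : ℝ) * W)) * (2 ^ (d + 1) * ((1 : ℝ) * C * ((|a| * (Real.exp δm * Real.exp δm) + C₁) * Real.exp (-((δm - 3 * δm / 4) * (((coverMargin L mv : ℕ) : ℝ)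 + 1)))) * cr * Real.exp (δm / 2))))) * cr + (1 - θA * cr)⁻¹ * ((((β * (rS * θ) + (mc * εk) * R₀) + cJ * (2 * ((βQ * (rS * θ) + ((1 * ((mf + mb) * εk8) + 0 * βQ)) * R₀) + (β * (rS * θ) + (mc * εk) * R₀))) + (β * 0 + (mc * εk) * 0) * cr) + (π * (d + 1) / (((L ^ kk : ℕ) : ℝ) * W)) * (β * R₀ + cJ * (2 * (βQ * R₀ + β * R₀)) + β * 0 * cr)) * ((1 - θA * cr)⁻¹ * (κF * W⁻¹) * cr) * cr) * cr) := add_nonneg (mul_nonneg (mul_nonneg hIA0 hK1710) hcr0) (mul_nonneg (mul_nonneg hIA0 (mul_nonneg (mul_nonneg hK1510 (mul_nonneg (mul_nonneg hIA0 (mul_nonneg hκF0 hWinv0)) hcr0)) hcr0)) hcr0)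
  -- the two-grid fits of the SHIFTED quotients (177b's case split is inside FILE 122's lemmas for the unshifted ones; the shifted ones are read at the shifted point)
  have hfDπ : ∀ (k : Fin (d + 1) → ZMod (2 * L)) (μ : Fin (d + 1)) (p' : CvX' d L mv kk r hL × ι),
      |(fgrad η'⁻¹ (liftEquiv ((bshiftEquiv (cvM d L mv kk hL) (L ^ r * L ^ kk)) μ) ι) (fun p : CvX' d L mv kk r hL × ι => (knitH d L mv kk (L ^ r * L ^ kk) hL k) p.1) ∘ ⇑(liftEquiv ((bshiftEquiv (cvM d L mv kk hL) (L ^ r * L ^ kk)) μ) ι).symm) p' -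
        (fgrad η⁻¹ (liftEquiv ((bshiftEquiv (cvM d L mv kk hL) (L ^ kk)) μ) ι) (fun p : CvX d L mv kk hL × ι => (knitH d L mv kk (L ^ kk) hL k) p.1) ∘ ⇑(liftEquiv ((bshiftEquiv (cvM d L mv kk hL) (L ^ kk)) μ) ι).symm) (liftMap (kingPrV L kk r (cvM d L mv kk hL)) ι p')| ≤ (|W⁻¹| * (((L ^ kk : ℕ) : ℝ) * W)⁻¹ * (64 * π ^ 2 + π ^ 2 * Fintype.card (Fin (d + 1)))) := fun k μ p' => by
    rw [fgrad_comp_symm_eq_bgrad, fgrad_comp_symm_eq_bgrad, hηinv, hη'inv]; exact abs_bgrad_coverH_lift_two_grid_le ι hM hw h3 k μ p'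
  have hfBπ : ∀ (k : Fin (d + 1) → ZMod (2 * L)) (μ : Fin (d + 1)) (p' : CvX' d L mv kk r hL × ι),
      |(bgrad η'⁻¹ (liftEquiv ((bshiftEquiv (cvM d L mv kk hL) (L ^ r * L ^ kk)) μ) ι) (fun p : CvX' d L mv kk r hL × ι => (knitH d L mv kk (L ^ r * L ^ kk) hL k) p.1) ∘ ⇑(liftEquiv ((bshiftEquiv (cvM d L mv kk hL) (L ^ r * L ^ kk)) μ) ι)) p' -
        (bgrad η⁻¹ (liftEquiv ((bshiftEquiv (cvM d L mv kk hL) (L ^ kk)) μ) ι) (fun p : CvX d L mv kk hL × ι => (knitH d L mv kk (L ^ kk) hL k) p.1) ∘ ⇑(liftEquiv ((bshiftEquiv (cvM d L mv kk hL) (L ^ kk)) μ) ι)) (liftMap (kingPrV L kk r (cvM d L mv kk hL)) ι p')| ≤ (|W⁻¹| * (((L ^ kk : ℕ) : ℝ) * W)⁻¹ * (64 * π ^ 2 + π ^ 2 * Fintype.card (Fin (d + 1)))) := fun k μ p' => by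
    rw [bgrad_comp_eq_fgrad, bgrad_comp_eq_fgrad, hηinv, hη'inv]; exact abs_fgrad_coverH_lift_two_grid_le ι hM hw h3 k μ p'
  have hf2fπ : ∀ (k : Fin (d + 1) → ZMod (2 * L)) (μ : Fin (d + 1)) (p' : CvX' d L mv kk r hL × ι),
      |(fgrad η'⁻¹ (liftEquiv ((bshiftEquiv (cvM d L mv kk hL) (L ^ r * L ^ kk)) μ) ι) (fgrad η'⁻¹ (liftEquiv ((bshiftEquiv (cvM d L mv kk hL) (L ^ r * L ^ kk)) μ) ι) (fun p : CvX' d L mv kk r hL × ι => (knitH d L mv kk (L ^ r * L ^ kk) hL k) p.1)) ∘ ⇑(liftEquiv ((bshiftEquiv (cvM d L mv kk hL) (L ^ r * L ^ kk)) μ) ι).symm) p' -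
        (fgrad η⁻¹ (liftEquiv ((bshiftEquiv (cvM d L mv kk hL) (L ^ kk)) μ) ι) (fgrad η⁻¹ (liftEquiv ((bshiftEquiv (cvM d L mv kk hL) (L ^ kk)) μ) ι) (fun p : CvX d L mv kk hL × ι => (knitH d L mv kk (L ^ kk) hL k) p.1)) ∘ ⇑(liftEquiv ((bshiftEquiv (cvM d L mv kk hL) (L ^ kk)) μ) ι).symm) (liftMap (kingPrV L kk r (cvM d L mv kk hL)) ι p')| ≤ (W⁻¹ ^ 2 * (((L ^ kk : ℕ) : ℝ) * W)⁻¹ * (144 * π ^ 3 + 32 * π ^ 3 * Fintype.card (Fin (d + 1)))) := fun k μ p' => by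
    rw [Function.comp_apply, Function.comp_apply, fgrad_fgrad_apply_eq, fgrad_fgrad_apply_eq, Equiv.apply_symm_apply, Equiv.apply_symm_apply, neg_sub_neg, abs_sub_comm, hηinv, hη'inv]
    exact abs_fgradAdj_fgrad_coverH_lift_two_grid_le ι hM hw h3 k μ p'
  have hf2bπ : ∀ (k : Fin (d + 1) → ZMod (2 * L)) (μ : Fin (d + 1)) (p' : CvX' d L mv kk r hL × ι),
      |bgrad η'⁻¹ (liftEquiv ((bshiftEquiv (cvM d L mv kk hL) (L ^ r * L ^ kk)) μ) ι) (bgrad η'⁻¹ (liftEquiv ((bshiftEquiv (cvM d L mv kk hL) (L ^ r * L ^ kk)) μ) ι) (fun p : CvX' d L mv kk r hL × ι => (knitH d L mv kk (L ^ r * L ^ kk) hL k) p.1) ∘ ⇑(liftEquiv ((bshiftEquiv (cvM d L mv kk hL) (L ^ r * L ^ kk)) μ) ι)) p' -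
        bgrad η⁻¹ (liftEquiv ((bshiftEquiv (cvM d L mv kk hL) (L ^ kk)) μ) ι) (bgrad η⁻¹ (liftEquiv ((bshiftEquiv (cvM d L mv kk hL) (L ^ kk)) μ) ι) (fun p : CvX d L mv kk hL × ι => (knitH d L mv kk (L ^ kk) hL k) p.1) ∘ ⇑(liftEquiv ((bshiftEquiv (cvM d L mv kk hL) (L ^ kk)) μ) ι)) (liftMap (kingPrV L kk r (cvM d L mv kk hL)) ι p')| ≤ (W⁻¹ ^ 2 * (((L ^ kk : ℕ) : ℝ) * W)⁻¹ * (144 * π ^ 3 + 32 * π ^ 3 * Fintype.card (Fin (d + 1)))) := fun k μ p' => by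
    rw [bgrad_comp_eq_fgrad, bgrad_comp_eq_fgrad, bgrad_fgrad_apply_eq, bgrad_fgrad_apply_eq, neg_sub_neg, abs_sub_comm, hηinv, hη'inv]
    exact abs_fgradAdj_fgrad_coverH_lift_two_grid_le ι hM hw h3 k μ p'
  have hββQ : 2 ^ (d + 1) * (C * Real.exp δ₀) ≤ βQ := by
    rw [hβQdef]
    have h1 : (1 : ℝ) ≤ Real.exp δ₀ := Real.one_le_exp hδ₀.le
    have h2 : C * Real.exp δ₀ * 1 ≤ C * Real.exp δ₀ * (2 * Real.exp δ₀) := mul_le_mul_of_nonneg_left (by linarith only [h1]) (mul_nonneg hC.le (Real.exp_nonneg _))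
    have h3 : C * Real.exp δ₀ ≤ 2 * (C * Real.exp δ₀) * Real.exp δ₀ := by linarith only [h2]
    exact mul_le_mul_of_nonneg_left h3 (by positivity)
  have hc₂w : 32 * π ^ 2 / (((L ^ mv : ℕ) : ℝ)) ^ 2 ≤ 32 * π ^ 2 * W⁻¹ := by
    rw [← hWdef, div_eq_mul_inv]
    refine mul_le_mul_of_nonneg_left ?_ (by positivity)
    exact inv_anti₀ hWpos (by rw [sq]; exact le_mul_of_one_le_right hWpos.le hW1)
  have hεF : 2 ^ (d + 1) * ((1 : ℝ) * C * ((|a| * (Real.exp δm * Real.exp δm) + C₁) * Real.exp (-((δm - 3 * δm / 4) * (((coverMargin L mv : ℕ) : ℝ) + 1)))) * cr * Real.exp (δm / 2)) ≤ κF * W⁻¹ := by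
    have hm0 : W ≤ ((coverMargin L mv : ℕ) : ℝ) + 1 := by
      have h2 : (2 : ℝ) * W ≤ ((coverMargin L mv : ℕ) : ℝ) := by rw [hWdef]; exact_mod_cast hm₁
      linarith only [h2]
    have hx : 0 < δm / 4 * (((coverMargin L mv : ℕ) : ℝ) + 1) := mul_pos (div_pos hδm0 (by norm_num)) (by positivity)
    have hexp : Real.exp (-((δm - 3 * δm / 4) * (((coverMargin L mv : ℕ) : ℝ) + 1))) ≤ (4 / δm) * W⁻¹ := by
      rw [show (δm - 3 * δm / 4) * (((coverMargin L mv : ℕ) : ℝ) + 1) = δm / 4 * (((coverMargin L mv : ℕ) : ℝ) + 1) by ring, Real.exp_neg]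
      calc (Real.exp (δm / 4 * (((coverMargin L mv : ℕ) : ℝ) + 1)))⁻¹ ≤ (δm / 4 * (((coverMargin L mv : ℕ) : ℝ) + 1))⁻¹ :=
            inv_anti₀ hx (by linarith only [Real.add_one_le_exp (δm / 4 * (((coverMargin L mv : ℕ) : ℝ) + 1))])
        _ = (4 / δm) * ((((coverMargin L mv : ℕ) : ℝ) + 1))⁻¹ := by rw [mul_inv, inv_div]
        _ ≤ (4 / δm) * W⁻¹ := mul_le_mul_of_nonneg_left (inv_anti₀ hWpos hm0) (div_nonneg (by norm_num) hδm0.le)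
    rw [hκFdef, hcN₀def]
    calc 2 ^ (d + 1) * ((1 : ℝ) * C * ((|a| * (Real.exp δm * Real.exp δm) + C₁) * Real.exp (-((δm - 3 * δm / 4) * (((coverMargin L mv : ℕ) : ℝ) + 1)))) * cr * Real.exp (δm / 2))
        = (2 ^ (d + 1) * (1 * C * (|a| * (Real.exp δm * Real.exp δm) + C₁)) * cr * Real.exp (δm / 2)) * Real.exp (-((δm - 3 * δm / 4) * (((coverMargin L mv : ℕ) : ℝ) + 1))) := by ring
      _ ≤ (2 ^ (d + 1) * (1 * C * (|a| * (Real.exp δm * Real.exp δm) + C₁)) * cr * Real.exp (δm / 2)) * ((4 / δm) * W⁻¹) := mul_le_mul_of_nonneg_left hexp (mul_nonneg (mul_nonneg (mul_nonneg (pow_nonneg zero_le_two _) (mul_nonneg (mul_nonneg zero_le_one hC.le) hcN₀0)) hcr0) (Real.exp_nonneg _))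
      _ = 2 ^ (d + 1) * (1 * C * ((|a| * (Real.exp δm * Real.exp δm) + C₁) * (4 / δm))) * cr * Real.exp (δm / 2) * W⁻¹ := by ring
  -- the one smallness of n15-c∕174b: `N_ov(Θ + ε_E)c_r = N_ov·K·c_r∕W < 1`
  have hΘ : ((((((cJ * ((3 * (((β + (β₁ + (π * β))) * (1 - (((β + (β₁ + (π * β))) * (Rsp * cr)) * cr))⁻¹) * (32 * π ^ 2 * W⁻¹))) + (2 * ((((1 - (θA * cr))⁻¹ * βQ) * cr) * (π * W⁻¹))))) + 0) + ((((β + (β₁ + (π * β))) * (1 - (((β + (β₁ + (π * β))) * (Rsp * cr)) * cr))⁻¹) * (cNn * W⁻¹)) * cr)) + ((cJ * ((2 * R₀) * (((π * W⁻¹) * ((β + (β₁ + (π * β))) * (1 - (((β + (β₁ + (π * β))) * (Rsp * cr)) * cr))⁻¹)) + ((π * W⁻¹) * (((1 - (θA * cr))⁻¹ * βQ) * cr))))) + ((((β + (β₁ + (π * β))) * (1 - (((β + (β₁ + (π * β))) * (Rsp * cr)) * cr))⁻¹) * ((((πD * W⁻¹) * ((Real.exp 1) * (δm / 2))⁻¹)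 + (2 * (πD * W⁻¹))) * 0)) * cr))) + 0) + (((1 - (θA * cr))⁻¹ * (κF * W⁻¹)) * cr)) = Ktot * W⁻¹ := by rw [hKtotdef]; ring
  have hqL : Nov * ((((((cJ * ((3 * (((β + (β₁ + (π * β))) * (1 - (((β + (β₁ + (π * β))) * (Rsp * cr)) * cr))⁻¹) * (32 * π ^ 2 * W⁻¹))) + (2 * ((((1 - (θA * cr))⁻¹ * βQ) * cr) * (π * W⁻¹))))) + 0) + ((((β + (β₁ + (π * β))) * (1 - (((β + (β₁ + (π * β))) * (Rsp * cr)) * cr))⁻¹) * (cNn * W⁻¹)) * cr)) + ((cJ * ((2 * R₀) * (((π * W⁻¹) * ((β + (β₁ + (π * β))) * (1 - (((β + (β₁ + (π * β))) * (Rsp * cr)) * cr))⁻¹)) + ((π * W⁻¹) * (((1 - (θA * cr))⁻¹ * βQ) * cr))))) + ((((β + (β₁ + (π * β))) * (1 - (((β + (β₁ + (π * β))) * (Rsp * cr)) * cr))⁻¹) * ((((πD * W⁻¹) * ((Real.exp 1) * (δm / 2))⁻¹) + (2 * (πD * W⁻¹))) * 0)) * cr))) + 0) + (((1 - (θA * cr))⁻¹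 * (κF * W⁻¹)) * cr)) * cr < 1 := by
    rw [hΘ, show Nov * (Ktot * W⁻¹) * cr = (Nov * Ktot * cr) * W⁻¹ by ring]
    have h1 : (Nov * Ktot * cr) * W⁻¹ ≤ (W / 2) * W⁻¹ := mul_le_mul_of_nonneg_right (by linarith only [hWK]) hWinv0
    rw [show (W / 2) * W⁻¹ = 1 / 2 by rw [div_eq_mul_inv, mul_right_comm, mul_inv_cancel₀ hWpos.ne', one_mul, one_div]] at h1
    linarith only [h1]
  have hIQ0 : 0 ≤ (1 - Nov * ((((((cJ * ((3 * (((β + (β₁ + (π * β))) * (1 - (((β + (β₁ + (π * β))) * (Rsp * cr)) * cr))⁻¹) * (32 * π ^ 2 * W⁻¹))) + (2 * ((((1 - (θA * cr))⁻¹ * βQ) * cr) * (π * W⁻¹))))) + 0) + ((((β + (β₁ + (π * β))) * (1 - (((β + (β₁ + (π * β))) * (Rsp * cr)) * cr))⁻¹) * (cNn * W⁻¹)) * cr)) + ((cJ * ((2 * R₀) * (((π * W⁻¹) * ((β + (β₁ + (π * β))) * (1 - (((β + (β₁ + (π * β))) * (Rsp * cr)) * cr))⁻¹)) + ((π * W⁻¹)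 * (((1 - (θA * cr))⁻¹ * βQ) * cr))))) + ((((β + (β₁ + (π * β))) * (1 - (((β + (β₁ + (π * β))) * (Rsp * cr)) * cr))⁻¹) * ((((πD * W⁻¹) * ((Real.exp 1) * (δm / 2))⁻¹) + (2 * (πD * W⁻¹))) * 0)) * cr))) + 0) + (((1 - (θA * cr))⁻¹ * (κF * W⁻¹)) * cr)) * cr)⁻¹ := inv_nonneg.mpr (by linarith only [hqL])
  have hIQ2 : (1 - Nov * ((((((cJ * ((3 * (((β + (β₁ + (π * β))) * (1 - (((β + (β₁ + (π * β))) * (Rsp * cr)) * cr))⁻¹) * (32 * π ^ 2 * W⁻¹))) + (2 * ((((1 - (θA * cr))⁻¹ * βQ) * cr) * (π * W⁻¹))))) + 0) + ((((β + (β₁ + (π * β))) * (1 - (((β + (β₁ + (π * β))) * (Rsp * cr)) * cr))⁻¹) * (cNn * W⁻¹)) * cr)) + ((cJ * ((2 * R₀) * (((π * W⁻¹) * ((β + (β₁ + (π * β))) * (1 - (((β + (β₁ + (π * β))) * (Rsp * cr)) * cr))⁻¹)) + ((π * W⁻¹) * (((1 - (θA * cr))⁻¹ * βQ) * cr)))))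 + ((((β + (β₁ + (π * β))) * (1 - (((β + (β₁ + (π * β))) * (Rsp * cr)) * cr))⁻¹) * ((((πD * W⁻¹) * ((Real.exp 1) * (δm / 2))⁻¹) + (2 * (πD * W⁻¹))) * 0)) * cr))) + 0) + (((1 - (θA * cr))⁻¹ * (κF * W⁻¹)) * cr)) * cr)⁻¹ ≤ 2 := by
    have hle : Nov * ((((((cJ * ((3 * (((β + (β₁ + (π * β))) * (1 - (((β + (β₁ + (π * β))) * (Rsp * cr)) * cr))⁻¹) * (32 * π ^ 2 * W⁻¹))) + (2 * ((((1 - (θA * cr))⁻¹ * βQ) * cr) * (π * W⁻¹))))) + 0) + ((((β + (β₁ + (π * β))) * (1 - (((β + (β₁ + (π * β))) * (Rsp * cr)) * cr))⁻¹) * (cNn * W⁻¹)) * cr)) + ((cJ * ((2 * R₀) * (((π * W⁻¹) * ((β + (β₁ + (π * β))) * (1 - (((β + (β₁ + (π * β))) * (Rsp * cr)) * cr))⁻¹)) + ((π * W⁻¹) * (((1 - (θA * cr))⁻¹ * βQ) * cr))))) + ((((β + (β₁ + (π * β))) * (1 - (((β + (β₁ + (π * β))) * (Rsp * cr)) * cr))⁻¹)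 * ((((πD * W⁻¹) * ((Real.exp 1) * (δm / 2))⁻¹) + (2 * (πD * W⁻¹))) * 0)) * cr))) + 0) + (((1 - (θA * cr))⁻¹ * (κF * W⁻¹)) * cr)) * cr ≤ 1 / 2 := by
      rw [hΘ, show Nov * (Ktot * W⁻¹) * cr = (Nov * Ktot * cr) * W⁻¹ by ring]
      have h1 : (Nov * Ktot * cr) * W⁻¹ ≤ (W / 2) * W⁻¹ := mul_le_mul_of_nonneg_right (by linarith only [hWK]) hWinv0
      rwa [show (W / 2) * W⁻¹ = 1 / 2 by rw [div_eq_mul_inv, mul_right_comm, mul_inv_cancel₀ hWpos.ne', one_mul, one_div]] at h1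
    rw [inv_le_comm₀ (by linarith only [hle]) (by norm_num)]; linarith only [hle]
  -- every two-grid letter `≤ κ·S`, every window letter `≤` its `W`-free value
  have hwabs : |W⁻¹| ≤ 1 := by rw [abs_of_nonneg (inv_nonneg.mpr hWpos.le)]; exact hw1
  have hnabs : |(((L ^ kk : ℕ) : ℝ))⁻¹| ≤ Sx := by rw [abs_of_nonneg (inv_nonneg.mpr hnR0.le)]; exact hnS
  have hbfit : (π * (d + 1) / (((L ^ kk : ℕ) : ℝ) * W)) ≤ πD * Sx := by rw [hπDdef, div_eq_mul_inv]; exact mul_le_mul_of_nonneg_left hnwS (by positivity)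
  let LfS : ℝ := πD * Sx; have hLfS : LfS = πD * Sx := rfl; have hLfS0 : 0 ≤ LfS := by rw [hLfS]; exact mul_nonneg hπD0 hSx0
  have hsm₁ : max me mh * εk ≤ meh * Sx := by rw [← hmehdef]; exact mul_le_mul_of_nonneg_left hεS hmeh0
  have hsmT : ((1 * ((mf + mb) * εk8) + 0 * βQ)) ≤ (mf + mb) * Sx := by rw [one_mul, zero_mul, add_zero]; exact mul_le_mul_of_nonneg_left hε8S (add_nonneg hmf.le hmb.le)
  have hsoA : rS * θ ≤ 1 * Sx := by rw [one_mul]; exact hθS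
  have hsoV : rS * θ * cJJ ≤ cJJ * Sx := by rw [mul_comm]; exact mul_le_mul_of_nonneg_left hθS hcJJ0.le
  have hsoχ₁ : 2 * (π * (d + 1) / (((L ^ kk : ℕ) : ℝ) * W)) ≤ (2 * πD) * Sx := by rw [mul_assoc]; exact mul_le_mul_of_nonneg_left hbfit zero_le_two
  have hso₀ : (π / W / ((L ^ r * L ^ kk : ℕ) : ℝ) + π / W / ((L ^ kk : ℕ) : ℝ)) ≤ (2 * π) * Sx := by
    have h1 : π / W / ((L ^ r * L ^ kk : ℕ) : ℝ) ≤ π * Sx := by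
      rw [div_div, div_eq_mul_inv]; refine mul_le_mul_of_nonneg_left ?_ pi_pos.le
      calc (W * ((L ^ r * L ^ kk : ℕ) : ℝ))⁻¹ ≤ (((L ^ r * L ^ kk : ℕ) : ℝ))⁻¹ := inv_anti₀ hn'R0 (le_mul_of_one_le_left hn'R0.le hW1)
        _ ≤ Sx := hn'ε.trans hεS
    have h2 : π / W / ((L ^ kk : ℕ) : ℝ) ≤ π * Sx := by
      rw [div_div, div_eq_mul_inv]; refine mul_le_mul_of_nonneg_left ?_ pi_pos.le
      calc (W * ((L ^ kk : ℕ) : ℝ))⁻¹ ≤ (((L ^ kk : ℕ) : ℝ))⁻¹ := inv_anti₀ hnR0 (le_mul_of_one_le_left hnR0.le hW1)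
        _ ≤ Sx := hnS
    linarith only [h1, h2]
  have hsos : ((π * (d + 1) / (((L ^ kk : ℕ) : ℝ) * W)) + π / W / ((L ^ r * L ^ kk : ℕ) : ℝ) + π / W / ((L ^ kk : ℕ) : ℝ)) ≤ (πD + 2 * π) * Sx := by
    have h3 : π / W / ((L ^ r * L ^ kk : ℕ) : ℝ) ≤ π * Sx := by
      rw [div_div, div_eq_mul_inv]; refine mul_le_mul_of_nonneg_left ?_ pi_pos.le
      calc (W * ((L ^ r * L ^ kk : ℕ) : ℝ))⁻¹ ≤ (((L ^ r * L ^ kk : ℕ) : ℝ))⁻¹ := inv_anti₀ hn'R0 (le_mul_of_one_le_left hn'R0.le hW1)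
        _ ≤ Sx := hn'ε.trans hεS
    have h2 : π / W / ((L ^ kk : ℕ) : ℝ) ≤ π * Sx := by
      rw [div_div, div_eq_mul_inv]; refine mul_le_mul_of_nonneg_left ?_ pi_pos.le
      calc (W * ((L ^ kk : ℕ) : ℝ))⁻¹ ≤ (((L ^ kk : ℕ) : ℝ))⁻¹ := inv_anti₀ hnR0 (le_mul_of_one_le_left hnR0.le hW1)
        _ ≤ Sx := hnS
    linarith only [hbfit, h3, h2]
  have hso₁ : (|W⁻¹| * (((L ^ kk : ℕ) : ℝ) * W)⁻¹ * (64 * π ^ 2 + π ^ 2 * Fintype.card (Fin (d + 1)))) ≤ (64 * π ^ 2 + π ^ 2 * cJ) * Sx := by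
    rw [hcJdef]
    calc (|W⁻¹| * (((L ^ kk : ℕ) : ℝ) * W)⁻¹ * (64 * π ^ 2 + π ^ 2 * Fintype.card (Fin (d + 1)))) ≤ 1 * Sx * (64 * π ^ 2 + π ^ 2 * Fintype.card (Fin (d + 1))) := mul_le_mul_of_nonneg_right (mul_le_mul hwabs hnwS (inv_nonneg.mpr (mul_nonneg hnR0.le hWpos.le)) zero_le_one) (by positivity)
      _ = (64 * π ^ 2 + π ^ 2 * Fintype.card (Fin (d + 1))) * Sx := by ring
  have hso₂ : (W⁻¹ ^ 2 * (((L ^ kk : ℕ) : ℝ) * W)⁻¹ * (144 * π ^ 3 + 32 * π ^ 3 * Fintype.card (Fin (d + 1)))) ≤ (144 * π ^ 3 + 32 * π ^ 3 * cJ) * Sx := by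
    rw [hcJdef]
    calc (W⁻¹ ^ 2 * (((L ^ kk : ℕ) : ℝ) * W)⁻¹ * (144 * π ^ 3 + 32 * π ^ 3 * Fintype.card (Fin (d + 1)))) ≤ 1 * Sx * (144 * π ^ 3 + 32 * π ^ 3 * Fintype.card (Fin (d + 1))) := mul_le_mul_of_nonneg_right (mul_le_mul (pow_le_one₀ (inv_nonneg.mpr hWpos.le) hw1) hnwS (inv_nonneg.mpr (mul_nonneg hnR0.le hWpos.le)) zero_le_one) (by positivity)
      _ = (144 * π ^ 3 + 32 * π ^ 3 * Fintype.card (Fin (d + 1))) * Sx := by ring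
  have hsoχ₂ : ((W)⁻¹ * (((L ^ kk : ℕ) : ℝ) * W)⁻¹ * (32 * π ^ 4 + π ^ 2 * (d + 1))) ≤ (32 * π ^ 4 + π ^ 2 * (d + 1)) * Sx := by
    calc ((W)⁻¹ * (((L ^ kk : ℕ) : ℝ) * W)⁻¹ * (32 * π ^ 4 + π ^ 2 * (d + 1))) ≤ 1 * Sx * (32 * π ^ 4 + π ^ 2 * (d + 1)) := mul_le_mul_of_nonneg_right (mul_le_mul hw1 hnwS (inv_nonneg.mpr (mul_nonneg hnR0.le hWpos.le)) zero_le_one) (by positivity)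
      _ = (32 * π ^ 4 + π ^ 2 * (d + 1)) * Sx := by ring
  have hsrN : ((π * (d + 1) / W * (Real.exp 1 * (δm / 2))⁻¹ + 2 * (π * (d + 1) / W)) * (rr * εk) + 2 * (π * (d + 1) / (((L ^ kk : ℕ) : ℝ) * W)) * cN₀) ≤ KRN * Sx := by
    rw [hKRNdef, hπDdef, hE'def]
    exact cv_rN_le (by positivity) hE'0 hrr.le hcN₀0 hεk0 hεS hW1 hnwε
  have hsrFl : ((2 ^ (d + 1) * Real.exp (δm / 2) * ((1 * C * (((|a| * (Real.exp δm * Real.exp δm) + C₁) * (π * (d + 1) / (((L ^ kk : ℕ) : ℝ) * W)) + rr * εk + 0 * (|a| * (Real.exp δm * Real.exp δm) + C₁)) * Real.exp (-((δm - 3 * δm / 4) * (((coverMargin L mv : ℕ) : ℝ) + 1)))) * cr + 1 * (Dp * εk) * ((|a| * (Real.exp δm * Real.exp δm) + C₁) * Real.exp (-((δm - 3 * δm / 4) * (((coverMargin L mv : ℕ) : ℝ) + 1)))) * cr) + (d + 1) * (1 * (|(((L ^ kk : ℕ) : ℝ))⁻¹| * C) * ((|a| * (Real.exp δm * Real.exp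 δm) + C₁) * Real.exp (-((δm - 3 * δm / 4) * (((coverMargin L mv : ℕ) : ℝ) + 1)))) * cr)) + (π * (d + 1) / (((L ^ kk : ℕ) : ℝ) * W)) * (2 ^ (d + 1) * ((1 : ℝ) * C * ((|a| * (Real.exp δm * Real.exp δm) + C₁) * Real.exp (-((δm - 3 * δm / 4) * (((coverMargin L mv : ℕ) : ℝ) + 1)))) * cr * Real.exp (δm / 2))))) ≤ κFl * Sx := by
    clear hTS H HL H120 H124 HC HE HH HV HP0 HRF HRB
    have hrrS : rr * εk ≤ rr * Sx := mul_le_mul_of_nonneg_left hεS hrr.le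
    have hDpS : Dp * εk ≤ Dp * Sx := mul_le_mul_of_nonneg_left hεS hDp.le
    have hbfit' : (π * (d + 1) / (((L ^ kk : ℕ) : ℝ) * W)) ≤ LfS := by rw [hLfS]; exact hbfit
    have hA1 : (1 * C * ((((|a| * (Real.exp δm * Real.exp δm) + C₁) * (π * (d + 1) / (((L ^ kk : ℕ) : ℝ) * W)) + rr * εk + 0 * (|a| * (Real.exp δm * Real.exp δm) + C₁)) * Real.exp (-((δm - 3 * δm / 4) * (((coverMargin L mv : ℕ) : ℝ) + 1))))) * cr + 1 * (Dp * εk) * ((|a| * (Real.exp δm * Real.exp δm) + C₁) * Real.exp (-((δm - 3 * δm / 4) * (((coverMargin L mv : ℕ) : ℝ) + 1)))) * cr) ≤ (1 * C * ((((|a| * (Real.exp δm * Real.exp δm) + C₁) * LfS + rr * Sx + 0 * (|a| * (Real.exp δm * Real.exp δm) + C₁)) * 1)) * cr + 1 * (Dp * Sx) * ((|a| * (Real.exp δm * Real.exp δm) + C₁) * 1) * cr) :=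
      add_le_add (mul_le_mul_of_nonneg_right (mul_le_mul_of_nonneg_left (mul_le_mul (add_le_add (add_le_add (mul_le_mul_of_nonneg_left hbfit' hcN₀0) hrrS) le_rfl) hX1 hX0 (add_nonneg (add_nonneg (mul_nonneg hcN₀0 hLfS0) (mul_nonneg hrr.le hSx0)) (mul_nonneg le_rfl hcN₀0))) (mul_nonneg zero_le_one hC.le)) hcr0)
        (mul_le_mul_of_nonneg_right (mul_le_mul (mul_le_mul_of_nonneg_left hDpS zero_le_one) (mul_le_mul_of_nonneg_left hX1 hcN₀0) (mul_nonneg hcN₀0 hX0) (mul_nonneg zero_le_one (mul_nonneg hDp.le hSx0))) hcr0)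
    have hB1 : (d + 1) * (1 * (|(((L ^ kk : ℕ) : ℝ))⁻¹| * C) * ((|a| * (Real.exp δm * Real.exp δm) + C₁) * Real.exp (-((δm - 3 * δm / 4) * (((coverMargin L mv : ℕ) : ℝ) + 1)))) * cr) ≤ (d + 1) * (1 * (Sx * C) * ((|a| * (Real.exp δm * Real.exp δm) + C₁) * 1) * cr) :=
      mul_le_mul_of_nonneg_left (mul_le_mul_of_nonneg_right (mul_le_mul (mul_le_mul_of_nonneg_left (mul_le_mul_of_nonneg_right hnabs hC.le) zero_le_one) (mul_le_mul_of_nonneg_left hX1 hcN₀0) (mul_nonneg hcN₀0 hX0) (mul_nonneg zero_le_one (mul_nonneg hSx0 hC.le))) hcr0) (by positivity)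
    have hT2 : (π * (d + 1) / (((L ^ kk : ℕ) : ℝ) * W)) * (2 ^ (d + 1) * ((1 : ℝ) * C * ((|a| * (Real.exp δm * Real.exp δm) + C₁) * Real.exp (-((δm - 3 * δm / 4) * (((coverMargin L mv : ℕ) : ℝ) + 1)))) * cr * Real.exp (δm / 2))) ≤ LfS * (2 ^ (d + 1) * ((1 : ℝ) * C * ((|a| * (Real.exp δm * Real.exp δm) + C₁) * 1) * cr * Real.exp (δm / 2))) :=
      mul_le_mul hbfit' (mul_le_mul_of_nonneg_left (mul_le_mul_of_nonneg_right (mul_le_mul_of_nonneg_right (mul_le_mul_of_nonneg_left (mul_le_mul_of_nonneg_left hX1 hcN₀0) (mul_nonneg zero_le_one hC.le)) hcr0) (Real.exp_nonneg _)) (pow_nonneg zero_le_two _))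
        (mul_nonneg (pow_nonneg zero_le_two _) (mul_nonneg (mul_nonneg (mul_nonneg (mul_nonneg zero_le_one hC.le) (mul_nonneg hcN₀0 hX0)) hcr0) (Real.exp_nonneg _))) hLfS0
    calc ((2 ^ (d + 1) * Real.exp (δm / 2) * ((1 * C * (((|a| * (Real.exp δm * Real.exp δm) + C₁) * (π * (d + 1) / (((L ^ kk : ℕ) : ℝ) * W)) + rr * εk + 0 * (|a| * (Real.exp δm * Real.exp δm) + C₁)) * Real.exp (-((δm - 3 * δm / 4) * (((coverMargin L mv : ℕ) : ℝ) + 1)))) * cr + 1 * (Dp * εk) * ((|a| * (Real.exp δm * Real.exp δm) + C₁) * Real.exp (-((δm - 3 * δm / 4) * (((coverMargin L mv : ℕ) : ℝ) + 1)))) * cr) + (d + 1) * (1 * (|(((L ^ kk : ℕ) : ℝ))⁻¹| * C) * ((|a| * (Real.exp δm * Real.exp δm) + C₁) * Real.exp (-((δm - 3 * δm / 4) * (((coverMargin L mv : ℕ) : ℝ) + 1)))) * cr)) + (π * (d + 1) / (((L ^ kk : ℕ) : ℝ) * W)) * (2 ^ (d + 1) * ((1 : ℝ) * C * ((|a| *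 (Real.exp δm * Real.exp δm) + C₁) * Real.exp (-((δm - 3 * δm / 4) * (((coverMargin L mv : ℕ) : ℝ) + 1)))) * cr * Real.exp (δm / 2))))) ≤ ((2 ^ (d + 1) * Real.exp (δm / 2) * ((1 * C * (((|a| * (Real.exp δm * Real.exp δm) + C₁) * LfS + rr * Sx + 0 * (|a| * (Real.exp δm * Real.exp δm) + C₁)) * 1) * cr + 1 * (Dp * Sx) * ((|a| * (Real.exp δm * Real.exp δm) + C₁) * 1) * cr) + (d + 1) * (1 * (Sx * C) * ((|a| * (Real.exp δm * Real.exp δm) + C₁) * 1) * cr)) + LfS * (2 ^ (d + 1) * ((1 : ℝ) * C * ((|a| * (Real.exp δm * Real.exp δm) + C₁) * 1) * cr * Real.exp (δm / 2))))) := add_le_add (mul_le_mul_of_nonneg_left (add_le_add hA1 hB1) (mul_nonneg (pow_nonneg zero_le_two _) (Real.exp_nonneg _))) hT2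
      _ = κFl * Sx := by rw [hκFldef, hLfS]; ring
  -- n15-c∕177s `cvSmall177`: the monotone evaluation of 174b's kernel constant at these bounds
  have hsm := cvSmall177 (S := Sx) (Nov := Nov) (cJ := cJ) (R := Rsp) (cr := cr) (ct := π) (β := β) (βQ := βQ) (β₁ := β₁) (rA := R₀) (rC := R₀) (r₁ := R₀) (ε := (δm / 2)) (θA := θA) (c₀ := (π * W⁻¹)) (c₁ := (π * W⁻¹)) (c₂ := (32 * π ^ 2 * W⁻¹)) (cN := (cNn * W⁻¹)) (ℓ := (πD * W⁻¹)) (ω := (πD * W⁻¹)) (εFl := (κF * W⁻¹)) (mQ := ((mf + mb) * εk8)) (m₀ := (mc * εk)) (m₁ := (max me mh * εk)) (mN := (mc * εk)) (mT := ((1 * ((mf + mb) * εk8) + 0 * βQ))) (o := (π * (d + 1) / (((L ^ kk : ℕ) : ℝ) * W))) (oAt := (rS * θ)) (oC := (rS * θ)) (og := (rS * θ)) (oV := (rS * θ * cJJ)) (os := ((π * (d + 1) / (((L ^ kk : ℕ) : ℝ) * W)) + π / W / ((L ^ r * L ^ kk : ℕ) : ℝ) + π / W / ((L ^ kk : ℕ)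 : ℝ))) (oχ := (π * (d + 1) / (((L ^ kk : ℕ) : ℝ) * W))) (oχ₁ := (2 * (π * (d + 1) / (((L ^ kk : ℕ) : ℝ) * W)))) (oχ₂ := ((W)⁻¹ * (((L ^ kk : ℕ) : ℝ) * W)⁻¹ * (32 * π ^ 4 + π ^ 2 * (d + 1)))) (o₀ := (π / W / ((L ^ r * L ^ kk : ℕ) : ℝ) + π / W / ((L ^ kk : ℕ) : ℝ))) (o₁ := (|W⁻¹| * (((L ^ kk : ℕ) : ℝ) * W)⁻¹ * (64 * π ^ 2 + π ^ 2 * Fintype.card (Fin (d + 1))))) (o₂ := (W⁻¹ ^ 2 * (((L ^ kk : ℕ) : ℝ) * W)⁻¹ * (144 * π ^ 3 + 32 * π ^ 3 * Fintype.card (Fin (d + 1))))) (rN := ((π * (d + 1) / W * (Real.exp 1 * (δm / 2))⁻¹ + 2 * (π * (d + 1) / W)) * (rr * εk) + 2 * (π * (d + 1) / (((L ^ kk : ℕ) : ℝ) * W)) * cN₀)) (rFl := ((2 ^ (d + 1) * Real.exp (δm / 2) * ((1 * C * (((|a| * (Real.exp δm * Real.exp δm) + C₁) * (π * (d + 1)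 / (((L ^ kk : ℕ) : ℝ) * W)) + rr * εk + 0 * (|a| * (Real.exp δm * Real.exp δm) + C₁)) * Real.exp (-((δm - 3 * δm / 4) * (((coverMargin L mv : ℕ) : ℝ) + 1)))) * cr + 1 * (Dp * εk) * ((|a| * (Real.exp δm * Real.exp δm) + C₁) * Real.exp (-((δm - 3 * δm / 4) * (((coverMargin L mv : ℕ) : ℝ) + 1)))) * cr) + (d + 1) * (1 * (|(((L ^ kk : ℕ) : ℝ))⁻¹| * C) * ((|a| * (Real.exp δm * Real.exp δm) + C₁) * Real.exp (-((δm - 3 * δm / 4) * (((coverMargin L mv : ℕ) : ℝ) + 1)))) * cr)) + (π * (d + 1) / (((L ^ kk : ℕ) : ℝ) * W)) * (2 ^ (d + 1) * ((1 : ℝ) * C * ((|a| * (Real.exp δm * Real.exp δm) + C₁) * Real.exp (-((δm - 3 * δm / 4) * (((coverMargin L mv : ℕ) : ℝ) + 1)))) * cr * Real.exp (δm / 2)))))) (c₀b := π) (c₁b := π) (c₂b := (32 * π ^ 2)) (cNb := cNn) (ℓb := πD) (ωb := πD) (εFlb := κF) (kmQ := (mf + mb)) (km₀ := mc) (km₁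 := meh) (kmN := mc) (kmT := (mf + mb)) (ko := πD) (koAt := 1) (koC := 1) (kog := 1) (koV := cJJ) (kos := (πD + 2 * π)) (koχ := πD) (koχ₁ := (2 * πD)) (koχ₂ := (32 * π ^ 4 + π ^ 2 * (d + 1))) (ko₀ := (2 * π)) (ko₁ := (64 * π ^ 2 + π ^ 2 * cJ)) (ko₂ := (144 * π ^ 3 + 32 * π ^ 3 * cJ)) (krN := KRN) (krFl := κFl) (h0Nov := hNov0) (h0R := hRsp0) (h0cJ := hcJ0) (h0cr := hcr0) (h0ct := pi_pos.le) (h0rA := hR₀0.le) (h0rC := hR₀0.le) (h0r₁ := hR₀0.le) (h0β := hβ0) (h0βQ := hβQ0) (h0β₁ := hβ₁0) (h0cN := (mul_nonneg hcNn0 hWinv0)) (hbcN := (mul_le_of_le_one_right hcNn0 hWinv1)) (h0c₀ := (mul_nonneg pi_pos.le hWinv0)) (hbc₀ := (mul_le_of_le_one_right pi_pos.le hWinv1)) (h0c₁ := (mul_nonneg pi_pos.le hWinv0)) (hbc₁ := (mul_le_of_le_one_right pi_pos.le hWinv1)) (h0c₂ := (mul_nonneg (by positivity) hWinv0)) (hbc₂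 := (mul_le_of_le_one_right (by positivity) hWinv1)) (h0εFl := (mul_nonneg hκF0 hWinv0)) (hbεFl := (mul_le_of_le_one_right hκF0 hWinv1)) (h0ω := (mul_nonneg hπD0 hWinv0)) (hbω := (mul_le_of_le_one_right hπD0 hWinv1)) (h0ℓ := (mul_nonneg hπD0 hWinv0)) (hbℓ := (mul_le_of_le_one_right hπD0 hWinv1)) (h0E1 := hE'0) (h0IA := (cv_inv_le_two hqA₀).1) (hbIA := (cv_inv_le_two hqA₀).2) (h0Iq := (cv_inv_le_two hq₀).1) (hbIq := (cv_inv_le_two hq₀).2) (h0I1q := (cv_inv_le_two' hq₀).1) (hbI1q := (cv_inv_le_two' hq₀).2) (h0IE := hIQ0) (hbIE := hIQ2) (h0mN := (mul_nonneg hmc.le hεk0)) (hsmN := (mul_le_mul_of_nonneg_left hεS hmc.le)) (h0mQ := (mul_nonneg (add_nonneg hmf.le hmb.le) hεk80)) (hsmQ := (mul_le_mul_of_nonneg_left hε8S (add_nonneg hmf.le hmb.le))) (h0mT := hmT0) (hsmT := hsmT) (h0m₀ := (mul_nonneg hmc.le hεk0)) (hsm₀ := (mul_le_mul_of_nonneg_left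 hεS hmc.le)) (h0m₁ := (mul_nonneg hmax hεk0)) (hsm₁ := hsm₁) (h0o := hoχ0) (hso := hbfit) (h0oAt := hrSθ0) (hsoAt := hsoA) (h0oC := hrSθ0) (hsoC := hsoA) (h0oV := (mul_nonneg hrSθ0 hcJJ0.le)) (hsoV := hsoV) (h0og := hrSθ0) (hsog := hsoA) (h0os := hos0) (hsos := hsos) (h0oχ := hoχ0) (hsoχ := hbfit) (h0oχ₁ := (mul_nonneg zero_le_two hoχ0)) (hsoχ₁ := hsoχ₁) (h0oχ₂ := hoχ₂0) (hsoχ₂ := hsoχ₂) (h0o₀ := ho₀0) (hso₀ := hso₀) (h0o₁ := ho₁0) (hso₁ := hso₁) (h0o₂ := ho₂0) (hso₂ := hso₂) (h0rFl := hK1710) (hsrFl := hsrFl) (h0rN := hRNK0) (hsrN := hsrN)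
  have hDle : Dinst ≤ Dout := by rw [hDdef]; exact (le_max_left _ _).trans (le_add_of_nonneg_right zero_le_one)
  -- the torus letters at both spacings and the defect families, weakened to the common rate `δm`
  have Hk := (H (mv + 1) kk r hk).1; have Hk' := (H (mv + 1) kk r hk).2; have hG := hasMaj_gOp_of_ineq (L := L) (k := kk) (cvM d L mv kk hL) (L ^ kk) a hn Hk hC.le; have hG' := hasMaj_gOp_of_ineq (L := L) (k := kk) (cvM d L mv kk hL) (L ^ r * L ^ kk) a hn' Hk' hC.le; have hD := fun ν => hasMaj_grad_of_ineq (L := L) (k := kk) (cvM d L mv kk hL) (L ^ kk) a hn Hk hC.le ν; have hD' := fun ν => hasMaj_grad_of_ineq (L := L) (k := kk) (cvM d L mv kk hL) (L ^ r * L ^ kk) a hn' Hk' hC.le ν; have hNL := HL kk (L ^ kk) (cvM d L mv kk hL); have hNL' := HL kk (L ^ r * L ^ kk) (cvM d L mv kk hL); have hGg := fun μ => hasMaj_gGrad_of_ineq (L := L) (k := kk) (M := cvM d L mv kk hL) (n := L ^ kk) (a := a) hn Hk hC.le hδ₀.le μ; have hGg' := fun μ => hasMaj_gGrad_of_ineq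 (L := L) (k := kk) (M := cvM d L mv kk hL) (n := L ^ r * L ^ kk) (a := a) hn' Hk' hC.le hδ₀.le μ; have htri : Triangle254 (unitTorusGeo L kk (cvM d L mv kk hL)) := triangle254_unitTorusGeo L kk _; have hd : ∀ a b, 0 ≤ (unitTorusGeo L kk (cvM d L mv kk hL)).dist a b := unitTorusGeo_dist_nonneg L kk _; have hd0 : ∀ y, (unitTorusGeo L kk (cvM d L mv kk hL)).dist y y = 0 := unitTorusGeo_dist_self L kk _; have hsymm : ∀ y y', (unitTorusGeo L kk (cvM d L mv kk hL)).dist y y' = (unitTorusGeo L kk (cvM d L mv kk hL)).dist y' y := unitTorusGeo_dist_symm L kk _; have hrow : RowSum (unitTorusGeo L kk (cvM d L mv kk hL)) (δm / 32) cr := by rw [hcr_def]; exact rowSum_unitTorusGeo L kk _ (show (0 : ℝ) < δm / 32 from div_pos hδm0 (by norm_num))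
  have hGm : HasMaj (BlockNorm.ofBlocks (unitTorusGeo L kk (cvM d L mv kk hL)) (fun b : CvX d L mv kk hL => blockOf (L ^ kk) (cvM d L mv kk hL) b.1)) (BlockNorm.ofBlocks (unitTorusGeo L kk (cvM d L mv kk hL)) (fun b : CvX d L mv kk hL => blockOf (L ^ kk) (cvM d L mv kk hL) b.1)) (gOp (cvM d L mv kk hL) (L ^ kk) a) (fun y y' => C * Real.exp (-(δm * tdistT (cvM d L mv kk hL) y y'))) := hG.mono fun y y' => mul_le_mul_of_nonneg_left (Real.exp_le_exp.mpr (neg_le_neg (mul_le_mul_of_nonneg_right hδmδ₀ (tdistT_nonneg (cvM d L mv kk hL) y y')))) hC.le; have hGm' : HasMaj (BlockNorm.ofBlocks (unitTorusGeo L kk (cvM d L mv kk hL)) (fun b : CvX' d L mv kk r hL => blockOf (L ^ r * L ^ kk) (cvM d L mv kk hL) b.1)) (BlockNorm.ofBlocks (unitTorusGeo L kk (cvM d L mv kk hL)) (fun b : CvX' d L mv kk r hL => blockOf (L ^ r * L ^ kk) (cvM d L mv kk hL) b.1)) (gOp (cvM d L mv kk hL) (L ^ r * L ^ kk) a) (fun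 y y' => C * Real.exp (-(δm * tdistT (cvM d L mv kk hL) y y'))) := hG'.mono fun y y' => mul_le_mul_of_nonneg_left (Real.exp_le_exp.mpr (neg_le_neg (mul_le_mul_of_nonneg_right hδmδ₀ (tdistT_nonneg (cvM d L mv kk hL) y y')))) hC.le; have hDm : ∀ ν, HasMaj (BlockNorm.ofBlocks (unitTorusGeo L kk (cvM d L mv kk hL)) (fun b : CvX d L mv kk hL => blockOf (L ^ kk) (cvM d L mv kk hL) b.1)) (BlockNorm.ofBlocks (unitTorusGeo L kk (cvM d L mv kk hL)) (fun b : CvX d L mv kk hL => blockOf (L ^ kk) (cvM d L mv kk hL) b.1)) (symbOp (cvM d L mv kk hL) (L ^ kk) (sD (cvM d L mv kk hL) (L ^ kk) ν ((L ^ kk : ℕ) : ℝ)) ∘ₗ gOp (cvM d L mv kk hL) (L ^ kk) a) (fun y y' => C * Real.exp (-(δm * tdistT (cvM d L mv kk hL) y y'))) := fun ν => (hD ν).mono fun y y' => mul_le_mul_of_nonneg_left (Real.exp_le_exp.mpr (neg_le_neg (mul_le_mul_of_nonneg_right hδmδ₀ (tdistT_nonneg (cvM d L mv kk hL) y y'))))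 hC.le; have h0m : HasMaj (BlockNorm.ofBlocks (unitTorusGeo L kk (cvM d L mv kk hL)) (fun b : CvX d L mv kk hL => blockOf (L ^ kk) (cvM d L mv kk hL) b.1)) (BlockNorm.ofBlocks (unitTorusGeo L kk (cvM d L mv kk hL)) (fun i : CvX' d L mv kk r hL => blockOf (L ^ r * L ^ kk) (cvM d L mv kk hL) i.1)) (idef (pull (kingPrV L kk r (cvM d L mv kk hL))) (pull (kingPrV L kk r (cvM d L mv kk hL))) (gOp (cvM d L mv kk hL) (L ^ r * L ^ kk) a) (gOp (cvM d L mv kk hL) (L ^ kk) a)) (fun y y' => Dp * εk * Real.exp (-(δm * tdistT (cvM d L mv kk hL) y y'))) := (HP0 mv kk r hk hn4 hw₀p').mono fun y y' => mul_le_mul_of_nonneg_left (Real.exp_le_exp.mpr (neg_le_neg (mul_le_mul_of_nonneg_right hδmδp (tdistT_nonneg (cvM d L mv kk hL) y y')))) (mul_nonneg hDp.le hεk0); have hNLm : HasMaj (BlockNorm.ofBlocks (unitTorusGeo L kk (cvM d L mv kk hL)) (fun b : CvX d L mv kk hL => blockOf (L ^ kk) (cvM d L mv kk hL) b.1)) (BlockNorm.ofBlocks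 (unitTorusGeo L kk (cvM d L mv kk hL)) (fun b : CvX d L mv kk hL => blockOf (L ^ kk) (cvM d L mv kk hL) b.1)) (landauRe (cvM d L mv kk hL) (L ^ kk)) (fun y y' => C₁ * Real.exp (-(δ₁ * tdistT (cvM d L mv kk hL) y y'))) := hNL; have hblk : (fun i : CvX' d L mv kk r hL => blockOf (L ^ r * L ^ kk) (cvM d L mv kk hL) i.1) = (fun b : CvX d L mv kk hL => blockOf (L ^ kk) (cvM d L mv kk hL) b.1) ∘ (kingPrV L kk r (cvM d L mv kk hL)) := (VectorPiece.blkFine_comp_kingPrV (M := (cvM d L mv kk hL)) L kk r).symm; have hNsc := hasMaj_nonlocalPart (L := L) (kk := kk) (a := a) hC₁.le hδm0.le hδmδ₁ hNL; have hNsc' := hasMaj_src_tgt_congr hblk (hasMaj_nonlocalPart (L := L) (kk := kk) (a := a) hC₁.le hδm0.le hδmδ₁ hNL')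
  have hDNsc0 := hasMaj_idef_nonlocal_cover_of mv kk r hL a hrr.le hδmδv (HV (mv + 1) kk r hk hL); have hDNsc := hasMaj_tgt_congr hblk hDNsc0; have hind : ∀ (k : Fin (d + 1) → ZMod (2 * L)) (y y' : Tor (cvM d L mv kk hL)), 0 ≤ ind (g := (unitTorusGeo L kk (cvM d L mv kk hL))) (cvSk d L mv kk hL k) y * ind (g := (unitTorusGeo L kk (cvM d L mv kk hL))) (cvSk d L mv kk hL k) y' := fun k y y' => mul_nonneg (ind_nonneg _ _) (ind_nonneg _ _); have hKc : ∀ (k : Fin (d + 1) → ZMod (2 * L)) (y y' : Tor (cvM d L mv kk hL)), 0 ≤ ind (g := (unitTorusGeo L kk (cvM d L mv kk hL))) (cvSk d L mv kk hL k) y * ind (g := (unitTorusGeo L kk (cvM d L mv kk hL))) (cvSk d L mv kk hL k) y' * (mc * εk * Real.exp (-(δm * tdistT (cvM d L mv kk hL) y y'))) := fun k y y' => mul_nonneg (hind k y y') (mul_nonneg (mul_nonneg hmc.le hεk0) (Real.exp_nonneg _)); have hKe : ∀ (k : Fin (d + 1) → ZMod (2 * L)) (y y' : Tor (cvM d L mv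 kk hL)), 0 ≤ ind (g := (unitTorusGeo L kk (cvM d L mv kk hL))) (cvSk d L mv kk hL k) y * ind (g := (unitTorusGeo L kk (cvM d L mv kk hL))) (cvSk d L mv kk hL k) y' * (max me mh * εk * Real.exp (-(δm * tdistT (cvM d L mv kk hL) y y'))) := fun k y y' => mul_nonneg (hind k y y') (mul_nonneg (mul_nonneg hmax hεk0) (Real.exp_nonneg _)); have hIGc := fun k => hasMaj_idef_cut_knitG_of mv kk r hL a hmc.le hδmδc k (HC (mv + 1) kk r hk hL (coverCorner (cvM d L mv kk hL) (L ^ mv) L (coverMargin L mv) k)); have hIDc := fun k μ => hasMaj_idef_cutF_knitG_of (mh := mh) mv kk r hL a hme.le hδmδe k μ (HE (mv + 1) kk r hk hn4 hL (coverCorner (cvM d L mv kk hL) (L ^ mv) L (coverMargin L mv) k) μ); have hIDbc := fun k μ => hasMaj_idef_cutB_knitG_of (me := me) mv kk r hL a hmh.le hδmδh k μ (HH (mv + 1) kk r hk hn4 hL (coverCorner (cvM d L mv kk hL) (L ^ mv) L (coverMargin L mv) k) μ); have hITF := fun k μ => hasMaj_idef_rightEntryF_cover_of mv kk r hL a hmf.le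 hδmδf k μ (HRF (mv + 1) kk r hk hn4 hL (coverCorner (cvM d L mv kk hL) (L ^ mv) L (coverMargin L mv) k) μ); have hITB := fun k μ => hasMaj_idef_rightEntryB_cover_of mv kk r hL a hmb.le hδmδb k μ (HRB (mv + 1) kk r hk hn4 hL (coverCorner (cvM d L mv kk hL) (L ^ mv) L (coverMargin L mv) k) μ)
  -- the windows of the cut box about the partition cell (radius 2), both spacings
  have hwin2 := fun μ k => chiCube_cover_lift_eq_one_of_near_bbox (n := L ^ kk) 2 ι hM hw hlo hhi hS6 μ k; have hwin := fun μ k => hcubeWindow_of_bumpWindow (2 * L) (fun ν (p : CvX d L mv kk hL × ι) => coverXi (cvM d L mv kk hL) (L ^ kk) (L ^ mv) ν p.1) 2 (fun μ => liftEquiv ((bshiftEquiv (cvM d L mv kk hL) (L ^ kk)) μ) ι) μ (by norm_num) (hwin2 μ k); have hwin2' := fun μ k => chiCube_cover_lift_eq_one_of_near_bbox (n := L ^ r * L ^ kk) 2 ι hM hw hlo hhi hS6 μ k; have hχπ0 : ∀ (k : Fin (d + 1) → ZMod (2 * L)) (x' : CvX' d L mv kk r hL), cvChi' d L mv kk r hL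 k x' = cvChi d L mv kk hL k ((kingPrV L kk r (cvM d L mv kk hL)) x') := fun k x' => (chiCube_kingPrV L kk r _ _ x').symm; have hβQK : ∀ y y' : Tor (cvM d L mv kk hL), 2 ^ (d + 1) * (2 * (C * Real.exp δ₀) * Real.exp δ₀) * Real.exp (-(δm * (unitTorusGeo L kk (cvM d L mv kk hL)).dist y y')) = βQ * Real.exp (-(δm * (unitTorusGeo L kk (cvM d L mv kk hL)).dist y y')) := fun y y' => by rw [hβQdef]
  have hwin' := fun μ k => hcubeWindow_of_bumpWindow (2 * L) (fun ν (p : CvX' d L mv kk r hL × ι) => coverXi (cvM d L mv kk hL) (L ^ r * L ^ kk) (L ^ mv) ν p.1) 2 (fun μ => liftEquiv ((bshiftEquiv (cvM d L mv kk hL) (L ^ r * L ^ kk)) μ) ι) μ (by norm_num) (hwin2' μ k)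
  -- the species of `U, U′`: the fifteen letters; the global operators ARE the common models; right inverses (FILES 120 ∕ 124); species rows and their η-defect (dag-n15-w1)
  obtain ⟨hCg, hAg, hCg', hAg', hfc, hfA, hga, hga', hgb, hgb', hfaT, hfgT, -, hfbT, hfgb⟩ := hTS
  have hrSle' : rS * (1 + Fintype.card (Fin (d + 1) ⊕ Fin (d + 1))) + 0 ≤ R₀' := by
    rw [add_zero]
    have h1 : rS * cJJ ≤ R₀ * cJJ := mul_le_mul_of_nonneg_right hrSle hcJJ0.le
    have h2 : R₀ * cJJ ≤ R₀' := by have := mul_le_mul_of_nonneg_right hR₀le' hcJJ0.le; rwa [div_mul_cancel₀ _ hcJJ0.ne'] at this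
    exact h1.trans h2
  have hrSle'' : rS * (1 + Fintype.card (Fin (d + 1) ⊕ Fin (d + 1))) + 0 ≤ R₀'' := by
    rw [add_zero]
    have h1 : rS * cJJ ≤ R₀ * cJJ := mul_le_mul_of_nonneg_right hrSle hcJJ0.le
    have h2 : R₀ * cJJ ≤ R₀'' := by have := mul_le_mul_of_nonneg_right hR₀le'' hcJJ0.le; rwa [div_mul_cancel₀ _ hcJJ0.ne'] at this
    exact h1.trans h2
  have hY := (H120 mv kk hk hw₀' e he (fun _ _ => (1 : Matrix mm mm ℂ)) (fun _ _ => by rw [Matrix.conjTranspose_one, Matrix.mul_one]) U (cvNL d L mv kk hL a ι) (fun _ => 0) rS 0 0 hrS le_rfl le_rfl hrSle' hθ₀'.le (fun k => conj_one_eq_sub_zero e (cvNL d L mv kk hL a ι)) (fun k x _ i => hCg x i) (fun k j' x _ i => hAg j' x i) (fun k => hasMaj_sandwich_zero _ _ _ _ le_rfl _) (fun k => hasMaj_sandwich_zero _ _ _ _ le_rfl _)).2.2; have hY' := (H124 mv kk r hk hw₀'' e he (fun _ _ => (1 : Matrix mm mm ℂ)) (fun _ _ => by rw [Matrix.conjTranspose_one,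 Matrix.mul_one]) U' (cvNL' d L mv kk r hL a ι) (fun _ => 0) rS 0 0 hrS le_rfl le_rfl hrSle'' hθ₀''.le (fun k => conj_one_eq_sub_zero e (cvNL' d L mv kk r hL a ι)) (fun k x _ i => hCg' x i) (fun k j' x _ i => hAg' j' x i) (fun k => hasMaj_sandwich_zero _ _ _ _ le_rfl _) (fun k => hasMaj_sandwich_zero _ _ _ _ le_rfl _)).2.2; clear H HL H120 H124 HC HE HH HV HP0 HRF HRB
  have hcov₀ : ∀ k : Fin (d + 1) → ZMod (2 * L), (covLapM (bshiftEquiv (cvM d L mv kk hL) (L ^ kk)) ((((L ^ kk : ℕ) : ℝ))⁻¹) (gaugePair (bshiftEquiv (cvM d L mv kk hL) (L ^ kk)) (fun μ x => coordMat e (ContinuousLinearMap.mulLeftRight ℝ (Matrix mm mm ℂ) (U μ x) (U μ x)ᴴ))) + cvNL d L mv kk hL a ι) =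
      lapOp η⁻¹ (fun μ => liftEquiv ((bshiftEquiv (cvM d L mv kk hL) (L ^ kk)) μ) ι) 0 + cvNL d L mv kk hL a ι - (unstackM (tCoefC ((((L ^ kk : ℕ) : ℝ))⁻¹) (gaugePair (bshiftEquiv (cvM d L mv kk hL) (L ^ kk)) fun μ x => coordMat e (ContinuousLinearMap.mulLeftRight ℝ (Matrix mm mm ℂ) ((1 : Matrix mm mm ℂ) * U μ x * (1 : Matrix mm mm ℂ)ᴴ) ((1 : Matrix mm mm ℂ) * U μ x * (1 : Matrix mm mm ℂ)ᴴ)ᴴ))) (tCoefA ((((L ^ kk : ℕ) : ℝ))⁻¹) (gaugePair (bshiftEquiv (cvM d L mv kk hL) (L ^ kk)) fun μ x => coordMat e (ContinuousLinearMap.mulLeftRight ℝ (Matrix mm mm ℂ) ((1 : Matrix mm mm ℂ) * U μ x * (1 : Matrix mm mm ℂ)ᴴ) ((1 : Matrix mm mm ℂ) * U μ x * (1 : Matrix mm mm ℂ)ᴴ)ᴴ))) + (0 : (CvX d L mv kk hL × ι → ℝ) →ₗ[ℝ] (CvX d L mv kk hL × ι → ℝ)) ∘ₗ projO (none : Option (Fin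 (d + 1) ⊕ Fin (d + 1)))) ∘ₗ stack LinearMap.id (fun j => Sum.elim (fun μ => fgrad η⁻¹ (liftEquiv ((bshiftEquiv (cvM d L mv kk hL) (L ^ kk)) μ) ι)) (fun μ => bgrad η⁻¹ (liftEquiv ((bshiftEquiv (cvM d L mv kk hL) (L ^ kk)) μ) ι)) j) := fun k => by
    have h := uN_localOp_species_form (κ := ι) e (bshiftEquiv (cvM d L mv kk hL) (L ^ kk)) (fun _ => (1 : Matrix mm mm ℂ)) U η he (fun _ => by rw [Matrix.conjTranspose_one, Matrix.mul_one]) (cvNL d L mv kk hL a ι)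
    rw [mmulOp_coordMat_conj_one, mmulOp_coordMat_conj_one_transpose, LinearMap.id_comp, LinearMap.comp_id, LinearMap.comp_id] at h
    rw [LinearMap.zero_comp, add_zero]
    exact h
  have hcov₀' : ∀ k : Fin (d + 1) → ZMod (2 * L), (covLapM (bshiftEquiv (cvM d L mv kk hL) (L ^ r * L ^ kk)) ((((L ^ r * L ^ kk : ℕ) : ℝ))⁻¹) (gaugePair (bshiftEquiv (cvM d L mv kk hL) (L ^ r * L ^ kk)) (fun μ x => coordMat e (ContinuousLinearMap.mulLeftRight ℝ (Matrix mm mm ℂ) (U' μ x) (U' μ x)ᴴ))) + cvNL' d L mv kk r hL a ι) =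
      lapOp η'⁻¹ (fun μ => liftEquiv ((bshiftEquiv (cvM d L mv kk hL) (L ^ r * L ^ kk)) μ) ι) 0 + cvNL' d L mv kk r hL a ι - (unstackM (tCoefC ((((L ^ r * L ^ kk : ℕ) : ℝ))⁻¹) (gaugePair (bshiftEquiv (cvM d L mv kk hL) (L ^ r * L ^ kk)) fun μ x => coordMat e (ContinuousLinearMap.mulLeftRight ℝ (Matrix mm mm ℂ) ((1 : Matrix mm mm ℂ) * U' μ x * (1 : Matrix mm mm ℂ)ᴴ) ((1 : Matrix mm mm ℂ) * U' μ x * (1 : Matrix mm mm ℂ)ᴴ)ᴴ))) (tCoefA ((((L ^ r * L ^ kk : ℕ) : ℝ))⁻¹) (gaugePair (bshiftEquiv (cvM d L mv kk hL) (L ^ r * L ^ kk)) fun μ x => coordMat e (ContinuousLinearMap.mulLeftRight ℝ (Matrix mm mm ℂ) ((1 : Matrix mm mm ℂ) * U' μ x * (1 : Matrix mm mm ℂ)ᴴ) ((1 : Matrix mm mm ℂ) * U' μ x * (1 : Matrix mm mm ℂ)ᴴ)ᴴ))) + (0 : (CvX' d L mv kk r hL × ι → ℝ) →ₗ[ℝ]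 (CvX' d L mv kk r hL × ι → ℝ)) ∘ₗ projO (none : Option (Fin (d + 1) ⊕ Fin (d + 1)))) ∘ₗ stack LinearMap.id (fun j => Sum.elim (fun μ => fgrad η'⁻¹ (liftEquiv ((bshiftEquiv (cvM d L mv kk hL) (L ^ r * L ^ kk)) μ) ι)) (fun μ => bgrad η'⁻¹ (liftEquiv ((bshiftEquiv (cvM d L mv kk hL) (L ^ r * L ^ kk)) μ) ι)) j) := fun k => by
    have h := uN_localOp_species_form (κ := ι) e (bshiftEquiv (cvM d L mv kk hL) (L ^ r * L ^ kk)) (fun _ => (1 : Matrix mm mm ℂ)) U' η' he (fun _ => by rw [Matrix.conjTranspose_one, Matrix.mul_one]) (cvNL' d L mv kk r hL a ι)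
    rw [mmulOp_coordMat_conj_one, mmulOp_coordMat_conj_one_transpose, LinearMap.id_comp, LinearMap.comp_id, LinearMap.comp_id] at h
    rw [LinearMap.zero_comp, add_zero]
    exact h
  have hRle1 : rS * (1 + (Fintype.card (Fin (d + 1) ⊕ Fin (d + 1)) : ℝ)) + 0 ≤ Rsp := by rw [add_zero, hRspdef, hcJJdef]; exact mul_le_mul_of_nonneg_right hrSle (by positivity)
  have hN0 : HasMaj (CvNorm d L mv kk hL ι) (CvNorm d L mv kk hL ι) (0 : (CvX d L mv kk hL × ι → ℝ) →ₗ[ℝ] (CvX d L mv kk hL × ι → ℝ)) (fun y y' => 0 * Real.exp (-(δm * (unitTorusGeo L kk (cvM d L mv kk hL)).dist y y'))) := (hasMaj_zero _ _).mono fun y y' => le_of_eq (zero_mul _).symm; have hN0' : HasMaj (BlockNorm.ofBlocks (unitTorusGeo L kk (cvM d L mv kk hL)) (liftBlk (cvBlk d L mv kk hL ∘ (kingPrV L kk r (cvM d L mv kk hL))) ι)) (BlockNorm.ofBlocks (unitTorusGeo L kk (cvM d L mv kk hL)) (liftBlk (cvBlk d L mv kk hL ∘ (kingPrV L kk r (cvM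 d L mv kk hL))) ι)) (0 : (CvX' d L mv kk r hL × ι → ℝ) →ₗ[ℝ] (CvX' d L mv kk r hL × ι → ℝ)) (fun y y' => 0 * Real.exp (-(δm * (unitTorusGeo L kk (cvM d L mv kk hL)).dist y y'))) := (hasMaj_zero _ _).mono fun y y' => le_of_eq (zero_mul _).symm
  have hDN0 : HasMaj (CvNorm d L mv kk hL ι) (BlockNorm.ofBlocks (unitTorusGeo L kk (cvM d L mv kk hL)) (liftBlk (cvBlk d L mv kk hL ∘ (kingPrV L kk r (cvM d L mv kk hL))) ι)) (idef (pull (liftMap (kingPrV L kk r (cvM d L mv kk hL)) ι)) (pull (liftMap (kingPrV L kk r (cvM d L mv kk hL)) ι)) (0 : (CvX' d L mv kk r hL × ι → ℝ) →ₗ[ℝ] (CvX' d L mv kk r hL × ι → ℝ)) (0 : (CvX d L mv kk hL × ι → ℝ) →ₗ[ℝ] (CvX d L mv kk hL × ι → ℝ))) (fun y y' => 0 * Real.exp (-(δm * (unitTorusGeo L kk (cvM d L mv kk hL)).dist y y'))) := by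
    rw [idef_zero]; exact (hasMaj_zero _ _).mono fun y y' => le_of_eq (zero_mul _).symm
  have hV := fun k : Fin (d + 1) → ZMod (2 * L) => (CurvedSpecies.hasMaj_unstackM_add_base (cvBlk d L mv kk hL) hd0 hrS le_rfl hCg (fun j => hAg j) hN0).mono fun y y' => mul_le_mul_of_nonneg_right hRle1 (Real.exp_nonneg _); have hV' := fun k : Fin (d + 1) → ZMod (2 * L) => (CurvedSpecies.hasMaj_unstackM_add_base (cvBlk d L mv kk hL ∘ (kingPrV L kk r (cvM d L mv kk hL))) hd0 hrS le_rfl hCg' (fun j => hAg' j) hN0').mono fun y y' => mul_le_mul_of_nonneg_right hRle1 (Real.exp_nonneg _); have hDV := fun k : Fin (d + 1) → ZMod (2 * L) => (CurvedSpecies.hasMaj_idef_unstackM_add_base (cvBlk d L mv kk hL) (kingPrV L kk r (cvM d L mv kk hL)) hd0 hrSθ0 le_rfl hfc (fun j => hfA j) hDN0).mono fun y y' => mul_le_mul_of_nonneg_right (le_of_eq (add_zero _)) (Real.exp_nonneg _)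
  have hh2 : ∀ (k : Fin (d + 1) → ZMod (2 * L)) (μ : Fin (d + 1)) (p : CvX d L mv kk hL × ι),
      |fgradAdj η⁻¹ (liftEquiv ((bshiftEquiv (cvM d L mv kk hL) (L ^ kk)) μ) ι) (fgrad η⁻¹ (liftEquiv ((bshiftEquiv (cvM d L mv kk hL) (L ^ kk)) μ) ι) (fun p : CvX d L mv kk hL × ι => (knitH d L mv kk (L ^ kk) hL k) p.1)) p| ≤ 32 * π ^ 2 * W⁻¹ := by
    rw [hηinv]; exact fun k μ p => (abs_fgradAdj_fgrad_coverH_lift_le ι hM hw k μ p).trans hc₂w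
  have hh2' : ∀ (k : Fin (d + 1) → ZMod (2 * L)) (μ : Fin (d + 1)) (p : CvX' d L mv kk r hL × ι),
      |fgradAdj η'⁻¹ (liftEquiv ((bshiftEquiv (cvM d L mv kk hL) (L ^ r * L ^ kk)) μ) ι) (fgrad η'⁻¹ (liftEquiv ((bshiftEquiv (cvM d L mv kk hL) (L ^ r * L ^ kk)) μ) ι) (fun p : CvX' d L mv kk r hL × ι => (knitH d L mv kk (L ^ r * L ^ kk) hL k) p.1)) p| ≤ 32 * π ^ 2 * W⁻¹ := by
    rw [hη'inv]; exact fun k μ p => (abs_fgradAdj_fgrad_coverH_lift_le ι hM hw k μ p).trans hc₂w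
  -- the rows of 174b whose proofs carry `.mono`∕`by`: stated with their instantiated types (g15 lesson (d))
  have T_hσ : 0 ≤ (δm / 32) := (div_nonneg hδm0.le (by norm_num)); have T_hc₂ : 0 ≤ (32 * π ^ 2 * W⁻¹) := (mul_nonneg (by positivity) hWinv0); have T_hσρ : (δm / 32) ≤ (δm / 2) := (by linarith only [hδm0]); have T_hρ₁V : (δm / 2) ≤ δm := (by linarith only [hδm0]); have T_hρ₁G : (δm / 2) + (δm / 32) ≤ δm := (by linarith only [hδm0]); have T_hρ₂ : 0 ≤ (δm / 4) := (div_nonneg hδm0.le (by norm_num)); have T_hρ₂₁ : (δm / 4) + (δm / 32) ≤ (δm / 2) := (by linarith only [hδm0]); have T_hρ₃ : 0 ≤ (δm / 8) := (div_nonneg hδm0.le (by norm_num)); have T_hρ₃N : (δm / 8) ≤ (δm - δm / 2) := (by linarith only [hδm0]); have T_hρ₃V : (δm / 8) ≤ δm - (δm / 2) := (by linarith only [hδm0]); have T_hρ₃₂ : (δm / 8) + (δm / 32) ≤ (δm / 4) := (by linarith only [hδm0]); have T_hρ₂W : (δm / 4) + 2 * (δm / 32) ≤ (δm / 2) := (by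 linarith only [hδm0]); have T_hρ₁N : (δm / 2) ≤ δm := (by linarith only [hδm0]); have T_hσρ₃ : 2 * (δm / 32) ≤ (δm / 8) := (by linarith only [hδm0]); have T_hSψ₂ : ∀ q : (Fin (d + 1) → ZMod (2 * L)), ∀ x, (cvPsi d L mv kk hL q) x ≠ 0 → ((cvBlk d L mv kk hL)) x ∈ (cvSk d L mv kk hL q) := (fun k x hx => Finset.mem_coe.mpr (by by_contra h; exact hx (chiCube_of_not_mem h))); have T_hdχt : ∀ q : (Fin (d + 1) → ZMod (2 * L)), ∀ μ p, |fgrad η⁻¹ (liftEquiv (((bshiftEquiv (cvM d L mv kk hL) (L ^ kk))) μ) ι) (fun p : (CvX d L mv kk hL) × ι => (cvBump d L mv kk hL q) p.1) p| ≤ π := (fun k μ p => by rw [hηinv]; exact (abs_fgrad_bcube_cover_lift_le 2 ι hM hw k μ p).trans (div_le_self pi_pos.le hW1)); have T_hdχtb : ∀ q : (Fin (d + 1) → ZMod (2 * L)), ∀ μ p, |bgrad η⁻¹ (liftEquiv (((bshiftEquiv (cvM d L mv kk hL) (L ^ kk))) μ) ι) (fun p : (CvX d L mv kk hL) × ι =>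 (cvBump d L mv kk hL q) p.1) p| ≤ π := (fun k μ p => by rw [hηinv]; exact (abs_bgrad_bcube_cover_lift_le 2 ι hM hw k μ p).trans (div_le_self pi_pos.le hW1)); have T_hdχt' : ∀ q : (Fin (d + 1) → ZMod (2 * L)), ∀ μ p', |fgrad η'⁻¹ (liftEquiv (((bshiftEquiv (cvM d L mv kk hL) (L ^ r * L ^ kk))) μ) ι) (fun p : (CvX' d L mv kk r hL) × ι => (cvBump' d L mv kk r hL q) p.1) p'| ≤ π := (fun k μ p => by rw [hη'inv]; exact (abs_fgrad_bcube_cover_lift_le 2 ι hM hw k μ p).trans (div_le_self pi_pos.le hW1)); have T_hdχtb' : ∀ q : (Fin (d + 1) → ZMod (2 * L)), ∀ μ p', |bgrad η'⁻¹ (liftEquiv (((bshiftEquiv (cvM d L mv kk hL) (L ^ r * L ^ kk))) μ) ι) (fun p : (CvX' d L mv kk r hL) × ι => (cvBump' d L mv kk r hL q) p.1) p'| ≤ π := (fun k μ p => by rw [hη'inv]; exact (abs_bgrad_bcube_cover_lift_le 2 ι hM hw k μ p).trans (div_le_self pi_pos.le hW1)); have T_hcut : ∀ q : (Fin (d + 1)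 → ZMod (2 * L)), HasMaj (BlockNorm.ofBlocks ((unitTorusGeo L kk (cvM d L mv kk hL))) (liftBlk ((cvBlk d L mv kk hL)) ι)) (BlockNorm.ofBlocks ((unitTorusGeo L kk (cvM d L mv kk hL))) (liftBlk ((cvBlk d L mv kk hL)) ι)) (mulOp (fun p : (CvX d L mv kk hL) × ι => (cvChi d L mv kk hL q) p.1) ∘ₗ (mulOp (fun p : CvX d L mv kk hL × ι => cvPsi d L mv kk hL q p.1) ∘ₗ cvCube d L mv kk hL a ι q)) (fun y y' => ind (cvSk d L mv kk hL q) y * ind (cvSk d L mv kk hL q) y' * (β * Real.exp (-(δm * ((unitTorusGeo L kk (cvM d L mv kk hL))).dist y y')))) := (fun k => by rw [cut_comp_cutCube_cover_lift ι hM hm₁ hfitI hS0 k]; exact hasMaj_cut_cover_lift (m₀ := coverMargin L mv) ι hM hm₁ hfitI hS0 hC.le hδ₀.le hδmδ₀ hG k)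
  have T_hcutF : ∀ q : (Fin (d + 1) → ZMod (2 * L)), ∀ μ, HasMaj (BlockNorm.ofBlocks ((unitTorusGeo L kk (cvM d L mv kk hL))) (liftBlk ((cvBlk d L mv kk hL)) ι)) (BlockNorm.ofBlocks ((unitTorusGeo L kk (cvM d L mv kk hL))) (liftBlk ((cvBlk d L mv kk hL)) ι)) (mulOp (fun p : (CvX d L mv kk hL) × ι => (cvChi d L mv kk hL q) p.1) ∘ₗ (fgrad η⁻¹ (liftEquiv (((bshiftEquiv (cvM d L mv kk hL) (L ^ kk))) μ) ι) ∘ₗ (mulOp (fun p : CvX d L mv kk hL × ι => cvPsi d L mv kk hL q p.1) ∘ₗ cvCube d L mv kk hL a ι q))) (fun y y' => ind (cvSk d L mv kk hL q) y * ind (cvSk d L mv kk hL q) y' * (β₁ * Real.exp (-(δm * ((unitTorusGeo L kk (cvM d L mv kk hL))).dist y y')))) := (fun k μ => by rw [cut_fgrad_cutCube_cover_lift ι hM hm₂ hfit₂ hS0 η⁻¹ μ k]; exact hasMaj_cutF_cover_lift (m₀ := coverMargin L mv) ι hM hm₁ hfitI hS0 hC hδ₀ hδmδ₀ hηinv μ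 (hD μ) k); have T_hcutB : ∀ q : (Fin (d + 1) → ZMod (2 * L)), ∀ μ, HasMaj (BlockNorm.ofBlocks ((unitTorusGeo L kk (cvM d L mv kk hL))) (liftBlk ((cvBlk d L mv kk hL)) ι)) (BlockNorm.ofBlocks ((unitTorusGeo L kk (cvM d L mv kk hL))) (liftBlk ((cvBlk d L mv kk hL)) ι)) (mulOp (fun p : (CvX d L mv kk hL) × ι => (cvChi d L mv kk hL q) p.1) ∘ₗ (bgrad η⁻¹ (liftEquiv (((bshiftEquiv (cvM d L mv kk hL) (L ^ kk))) μ) ι) ∘ₗ (mulOp (fun p : CvX d L mv kk hL × ι => cvPsi d L mv kk hL q p.1) ∘ₗ cvCube d L mv kk hL a ι q))) (fun y y' => ind (cvSk d L mv kk hL q) y * ind (cvSk d L mv kk hL q) y' * (β₁ * Real.exp (-(δm * ((unitTorusGeo L kk (cvM d L mv kk hL))).dist y y')))) := (fun k μ => by rw [cut_bgrad_cutCube_cover_lift ι hM hm₂ hfit₂ hS0 η⁻¹ μ k]; exact hasMaj_cutB_cover_lift (m₀ := coverMargin L mv) ι hM hm₁ hfitI hS0 hC hδ₀ hδmδ₀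 hηinv μ (hD μ) k); have T_hcut' : ∀ q : (Fin (d + 1) → ZMod (2 * L)), HasMaj (BlockNorm.ofBlocks ((unitTorusGeo L kk (cvM d L mv kk hL))) (liftBlk (((cvBlk d L mv kk hL)) ∘ ((kingPrV L kk r (cvM d L mv kk hL)))) ι)) (BlockNorm.ofBlocks ((unitTorusGeo L kk (cvM d L mv kk hL))) (liftBlk (((cvBlk d L mv kk hL)) ∘ ((kingPrV L kk r (cvM d L mv kk hL)))) ι)) (mulOp (fun p : (CvX' d L mv kk r hL) × ι => (cvChi' d L mv kk r hL q) p.1) ∘ₗ (mulOp (fun p : CvX' d L mv kk r hL × ι => cvPsi' d L mv kk r hL q p.1) ∘ₗ cvCube' d L mv kk r hL a ι q)) (fun y y' => ind (cvSk d L mv kk hL q) y * ind (cvSk d L mv kk hL q) y' * (β * Real.exp (-(δm * ((unitTorusGeo L kk (cvM d L mv kk hL))).dist y y')))) := (fun k => by rw [cut_comp_cutCube_cover_lift ι hM hm₁ hfitI hS0 k]; exact hasMaj_src_tgt_congr (liftBlk_blkCover_comp_kingPrV ι).symm (hasMaj_cut_cover_lift (m₀ := coverMargin L mv) ι hM hm₁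 hfitI hS0 hC.le hδ₀.le hδmδ₀ hG' k))
  have T_hcutF' : ∀ q : (Fin (d + 1) → ZMod (2 * L)), ∀ μ, HasMaj (BlockNorm.ofBlocks ((unitTorusGeo L kk (cvM d L mv kk hL))) (liftBlk (((cvBlk d L mv kk hL)) ∘ ((kingPrV L kk r (cvM d L mv kk hL)))) ι)) (BlockNorm.ofBlocks ((unitTorusGeo L kk (cvM d L mv kk hL))) (liftBlk (((cvBlk d L mv kk hL)) ∘ ((kingPrV L kk r (cvM d L mv kk hL)))) ι)) (mulOp (fun p : (CvX' d L mv kk r hL) × ι => (cvChi' d L mv kk r hL q) p.1) ∘ₗ (fgrad η'⁻¹ (liftEquiv (((bshiftEquiv (cvM d L mv kk hL) (L ^ r * L ^ kk))) μ) ι) ∘ₗ (mulOp (fun p : CvX' d L mv kk r hL × ι => cvPsi' d L mv kk r hL q p.1) ∘ₗ cvCube' d L mv kk r hL a ι q))) (fun y y' => ind (cvSk d L mv kk hL q) y * ind (cvSk d L mv kk hL q) y' * (β₁ * Real.exp (-(δm * ((unitTorusGeo L kk (cvM d L mv kk hL))).dist y y')))) := (fun k μ => by rw [cut_fgrad_cutCube_cover_lift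 ι hM hm₂ hfit₂ hS0 η'⁻¹ μ k]; exact hasMaj_src_tgt_congr (liftBlk_blkCover_comp_kingPrV ι).symm (hasMaj_cutF_cover_lift (m₀ := coverMargin L mv) ι hM hm₁ hfitI hS0 hC hδ₀ hδmδ₀ hη'inv μ (hD' μ) k)); have T_hcutB' : ∀ q : (Fin (d + 1) → ZMod (2 * L)), ∀ μ, HasMaj (BlockNorm.ofBlocks ((unitTorusGeo L kk (cvM d L mv kk hL))) (liftBlk (((cvBlk d L mv kk hL)) ∘ ((kingPrV L kk r (cvM d L mv kk hL)))) ι)) (BlockNorm.ofBlocks ((unitTorusGeo L kk (cvM d L mv kk hL))) (liftBlk (((cvBlk d L mv kk hL)) ∘ ((kingPrV L kk r (cvM d L mv kk hL)))) ι)) (mulOp (fun p : (CvX' d L mv kk r hL) × ι => (cvChi' d L mv kk r hL q) p.1) ∘ₗ (bgrad η'⁻¹ (liftEquiv (((bshiftEquiv (cvM d L mv kk hL) (L ^ r * L ^ kk))) μ) ι) ∘ₗ (mulOp (fun p : CvX' d L mv kk r hL × ι => cvPsi' d L mv kk r hL q p.1) ∘ₗ cvCube' d L mv kk r hL a ι q)))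 (fun y y' => ind (cvSk d L mv kk hL q) y * ind (cvSk d L mv kk hL q) y' * (β₁ * Real.exp (-(δm * ((unitTorusGeo L kk (cvM d L mv kk hL))).dist y y')))) := (fun k μ => by rw [cut_bgrad_cutCube_cover_lift ι hM hm₂ hfit₂ hS0 η'⁻¹ μ k]; exact hasMaj_src_tgt_congr (liftBlk_blkCover_comp_kingPrV ι).symm (hasMaj_cutB_cover_lift (m₀ := coverMargin L mv) ι hM hm₁ hfitI hS0 hC hδ₀ hδmδ₀ hη'inv μ (hD' μ) k))
  have T_hTfr : ∀ q : (Fin (d + 1) → ZMod (2 * L)), ∀ μ, HasMaj (BlockNorm.ofBlocks ((unitTorusGeo L kk (cvM d L mv kk hL))) (liftBlk ((cvBlk d L mv kk hL)) ι)) (BlockNorm.ofBlocks ((unitTorusGeo L kk (cvM d L mv kk hL))) (liftBlk ((cvBlk d L mv kk hL)) ι)) (tensorId ι (mulOp (chiCube (cvM d L mv kk hL) (L ^ kk) (coverCorner (cvM d L mv kk hL) (L ^ mv) L (coverMargin L mv) q) (L * L ^ mv)) ∘ₗ symOp (cvM d L mv kk hL) (L ^ kk) (coverCorner (cvM d L mv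 kk hL) (L ^ mv) L (coverMargin L mv) q) ∘ₗ (gOp (cvM d L mv kk hL) (L ^ kk) a ∘ₗ symbOp (cvM d L mv kk hL) (L ^ kk) (sD (cvM d L mv kk hL) (L ^ kk) μ (((L ^ kk) : ℕ) : ℝ))) ∘ₗ mulOp (chiCube (cvM d L mv kk hL) (L ^ kk) (coverCorner (cvM d L mv kk hL) (L ^ mv) L (coverMargin L mv) q) (L * L ^ mv)))) (fun y y' => ind (cvSk d L mv kk hL q) y * ind (cvSk d L mv kk hL q) y' * (βQ * Real.exp (-(δm * ((unitTorusGeo L kk (cvM d L mv kk hL))).dist y y')))) := (fun k μ => ((hasMaj_tensorId ι (fun y y' => mul_nonneg (mul_nonneg (ind_nonneg _ _) (ind_nonneg _ _)) (mul_nonneg (mul_nonneg (pow_nonneg zero_le_two _) (mul_nonneg (mul_nonneg zero_le_two (mul_nonneg hC.le (Real.exp_nonneg _))) (Real.exp_nonneg _))) (Real.exp_nonneg _))) (hasMaj_chiCube_symOp_gGrad_of (L := L) (k := kk) (c := (coverCorner (cvM d L mv kk hL) (L ^ mv) L (coverMargin L mv) k)) (S := L * L ^ mv) hM' (mul_nonneg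 zero_le_two (mul_nonneg hC.le (Real.exp_nonneg _))) hδ₀.le μ (hGg μ))).mono fun y y' => mul_le_mul_of_nonneg_left ((exp_rate_mono hd (mul_nonneg (pow_nonneg zero_le_two _) (mul_nonneg (mul_nonneg zero_le_two (mul_nonneg hC.le (Real.exp_nonneg _))) (Real.exp_nonneg _))) hδmδ₀ y y').trans (le_of_eq (hβQK y y'))) (mul_nonneg (ind_nonneg _ _) (ind_nonneg _ _)))); have T_hTbr : ∀ q : (Fin (d + 1) → ZMod (2 * L)), ∀ μ, HasMaj (BlockNorm.ofBlocks ((unitTorusGeo L kk (cvM d L mv kk hL))) (liftBlk ((cvBlk d L mv kk hL)) ι)) (BlockNorm.ofBlocks ((unitTorusGeo L kk (cvM d L mv kk hL))) (liftBlk ((cvBlk d L mv kk hL)) ι)) (tensorId ι (-(mulOp (chiCube (cvM d L mv kk hL) (L ^ kk) (coverCorner (cvM d L mv kk hL) (L ^ mv) L (coverMargin L mv) q) (L * L ^ mv)) ∘ₗ symOp (cvM d L mv kk hL) (L ^ kk) (coverCorner (cvM d L mv kk hL) (L ^ mv) L (coverMargin L mv) q) ∘ₗ (gOp (cvM d L mv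 kk hL) (L ^ kk) a ∘ₗ symbOp (cvM d L mv kk hL) (L ^ kk) ((((L ^ kk) : ℕ) : ℝ) • (sTinv (cvM d L mv kk hL) (L ^ kk) μ - 1))) ∘ₗ mulOp (chiCube (cvM d L mv kk hL) (L ^ kk) (coverCorner (cvM d L mv kk hL) (L ^ mv) L (coverMargin L mv) q) (L * L ^ mv))))) (fun y y' => ind (cvSk d L mv kk hL q) y * ind (cvSk d L mv kk hL q) y' * (βQ * Real.exp (-(δm * ((unitTorusGeo L kk (cvM d L mv kk hL))).dist y y')))) := (fun k μ => (((hasMaj_tensorId ι (fun y y' => mul_nonneg (mul_nonneg (ind_nonneg _ _) (ind_nonneg _ _)) (mul_nonneg (mul_nonneg (pow_nonneg zero_le_two _) (mul_nonneg hC.le (Real.exp_nonneg _))) (Real.exp_nonneg _))) (hasMaj_chiCube_symOp_gDivAdj_of_ineq (L := L) (k := kk) hn hM' Hk hC.le hδ₀.le (coverCorner (cvM d L mv kk hL) (L ^ mv) L (coverMargin L mv) k) μ)).mono fun y y' => mul_le_mul_of_nonneg_left ((exp_rate_mono hd (mul_nonneg (pow_nonneg zero_le_two _) (mul_nonneg hC.le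 (Real.exp_nonneg _))) hδmδ₀ y y').trans (mul_le_mul_of_nonneg_right hββQ (Real.exp_nonneg _))) (mul_nonneg (ind_nonneg _ _) (ind_nonneg _ _))).neg))
  have T_hTfr' : ∀ q : (Fin (d + 1) → ZMod (2 * L)), ∀ μ, HasMaj (BlockNorm.ofBlocks ((unitTorusGeo L kk (cvM d L mv kk hL))) (liftBlk (((cvBlk d L mv kk hL)) ∘ ((kingPrV L kk r (cvM d L mv kk hL)))) ι)) (BlockNorm.ofBlocks ((unitTorusGeo L kk (cvM d L mv kk hL))) (liftBlk (((cvBlk d L mv kk hL)) ∘ ((kingPrV L kk r (cvM d L mv kk hL)))) ι)) (tensorId ι (mulOp (chiCube (cvM d L mv kk hL) (L ^ r * L ^ kk) (coverCorner (cvM d L mv kk hL) (L ^ mv) L (coverMargin L mv) q) (L * L ^ mv)) ∘ₗ symOp (cvM d L mv kk hL) (L ^ r * L ^ kk) (coverCorner (cvM d L mv kk hL) (L ^ mv) L (coverMargin L mv) q) ∘ₗ (gOp (cvM d L mv kk hL) (L ^ r * L ^ kk) a ∘ₗ symbOp (cvM d L mv kk hL) (L ^ r * L ^ kk) (sD (cvM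 d L mv kk hL) (L ^ r * L ^ kk) μ (((L ^ r * L ^ kk) : ℕ) : ℝ))) ∘ₗ mulOp (chiCube (cvM d L mv kk hL) (L ^ r * L ^ kk) (coverCorner (cvM d L mv kk hL) (L ^ mv) L (coverMargin L mv) q) (L * L ^ mv)))) (fun y y' => ind (cvSk d L mv kk hL q) y * ind (cvSk d L mv kk hL q) y' * (βQ * Real.exp (-(δm * ((unitTorusGeo L kk (cvM d L mv kk hL))).dist y y')))) := (fun k μ => hasMaj_src_tgt_congr (liftBlk_blkCover_comp_kingPrV ι).symm ((hasMaj_tensorId ι (fun y y' => mul_nonneg (mul_nonneg (ind_nonneg _ _) (ind_nonneg _ _)) (mul_nonneg (mul_nonneg (pow_nonneg zero_le_two _) (mul_nonneg (mul_nonneg zero_le_two (mul_nonneg hC.le (Real.exp_nonneg _))) (Real.exp_nonneg _))) (Real.exp_nonneg _))) (hasMaj_chiCube_symOp_gGrad_of (L := L) (k := kk) (c := (coverCorner (cvM d L mv kk hL) (L ^ mv) L (coverMargin L mv) k)) (S := L * L ^ mv) hM' (mul_nonneg zero_le_two (mul_nonneg hC.le (Real.exp_nonneg _))) hδ₀.le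 μ (hGg' μ))).mono fun y y' => mul_le_mul_of_nonneg_left ((exp_rate_mono hd (mul_nonneg (pow_nonneg zero_le_two _) (mul_nonneg (mul_nonneg zero_le_two (mul_nonneg hC.le (Real.exp_nonneg _))) (Real.exp_nonneg _))) hδmδ₀ y y').trans (le_of_eq (hβQK y y'))) (mul_nonneg (ind_nonneg _ _) (ind_nonneg _ _))))
  have T_hTbr' : ∀ q : (Fin (d + 1) → ZMod (2 * L)), ∀ μ, HasMaj (BlockNorm.ofBlocks ((unitTorusGeo L kk (cvM d L mv kk hL))) (liftBlk (((cvBlk d L mv kk hL)) ∘ ((kingPrV L kk r (cvM d L mv kk hL)))) ι)) (BlockNorm.ofBlocks ((unitTorusGeo L kk (cvM d L mv kk hL))) (liftBlk (((cvBlk d L mv kk hL)) ∘ ((kingPrV L kk r (cvM d L mv kk hL)))) ι)) (tensorId ι (-(mulOp (chiCube (cvM d L mv kk hL) (L ^ r * L ^ kk) (coverCorner (cvM d L mv kk hL) (L ^ mv) L (coverMargin L mv) q) (L * L ^ mv)) ∘ₗ symOp (cvM d L mv kk hL) (L ^ r * L ^ kk) (coverCorner (cvM d L mv kk hL) (L ^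 mv) L (coverMargin L mv) q) ∘ₗ (gOp (cvM d L mv kk hL) (L ^ r * L ^ kk) a ∘ₗ symbOp (cvM d L mv kk hL) (L ^ r * L ^ kk) ((((L ^ r * L ^ kk) : ℕ) : ℝ) • (sTinv (cvM d L mv kk hL) (L ^ r * L ^ kk) μ - 1))) ∘ₗ mulOp (chiCube (cvM d L mv kk hL) (L ^ r * L ^ kk) (coverCorner (cvM d L mv kk hL) (L ^ mv) L (coverMargin L mv) q) (L * L ^ mv))))) (fun y y' => ind (cvSk d L mv kk hL q) y * ind (cvSk d L mv kk hL q) y' * (βQ * Real.exp (-(δm * ((unitTorusGeo L kk (cvM d L mv kk hL))).dist y y')))) := (fun k μ => hasMaj_src_tgt_congr (liftBlk_blkCover_comp_kingPrV ι).symm (((hasMaj_tensorId ι (fun y y' => mul_nonneg (mul_nonneg (ind_nonneg _ _) (ind_nonneg _ _)) (mul_nonneg (mul_nonneg (pow_nonneg zero_le_two _) (mul_nonneg hC.le (Real.exp_nonneg _))) (Real.exp_nonneg _))) (hasMaj_chiCube_symOp_gDivAdj_of_ineq (L := L) (k := kk) hn' hM' Hk' hC.le hδ₀.le (coverCorner (cvM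 d L mv kk hL) (L ^ mv) L (coverMargin L mv) k) μ)).mono fun y y' => mul_le_mul_of_nonneg_left ((exp_rate_mono hd (mul_nonneg (pow_nonneg zero_le_two _) (mul_nonneg hC.le (Real.exp_nonneg _))) hδmδ₀ y y').trans (mul_le_mul_of_nonneg_right hββQ (Real.exp_nonneg _))) (mul_nonneg (ind_nonneg _ _) (ind_nonneg _ _))).neg))
  have T_hDTfL : ∀ q : (Fin (d + 1) → ZMod (2 * L)), ∀ μ, HasMaj (BlockNorm.ofBlocks ((unitTorusGeo L kk (cvM d L mv kk hL))) (liftBlk ((cvBlk d L mv kk hL)) ι)) (BlockNorm.ofBlocks ((unitTorusGeo L kk (cvM d L mv kk hL))) (liftBlk (((cvBlk d L mv kk hL)) ∘ ((kingPrV L kk r (cvM d L mv kk hL)))) ι)) (idef (pull (liftMap ((kingPrV L kk r (cvM d L mv kk hL))) ι)) (pull (liftMap ((kingPrV L kk r (cvM d L mv kk hL))) ι)) (tensorId ι (mulOp (chiCube (cvM d L mv kk hL) (L ^ r * L ^ kk) (coverCorner (cvM d L mv kk hL) (L ^ mv) L (coverMargin L mv) q) (L * L ^ mv)) ∘ₗ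 symOp (cvM d L mv kk hL) (L ^ r * L ^ kk) (coverCorner (cvM d L mv kk hL) (L ^ mv) L (coverMargin L mv) q) ∘ₗ (gOp (cvM d L mv kk hL) (L ^ r * L ^ kk) a ∘ₗ symbOp (cvM d L mv kk hL) (L ^ r * L ^ kk) (sD (cvM d L mv kk hL) (L ^ r * L ^ kk) μ (((L ^ r * L ^ kk) : ℕ) : ℝ))) ∘ₗ mulOp (chiCube (cvM d L mv kk hL) (L ^ r * L ^ kk) (coverCorner (cvM d L mv kk hL) (L ^ mv) L (coverMargin L mv) q) (L * L ^ mv)))) (tensorId ι (mulOp (chiCube (cvM d L mv kk hL) (L ^ kk) (coverCorner (cvM d L mv kk hL) (L ^ mv) L (coverMargin L mv) q) (L * L ^ mv)) ∘ₗ symOp (cvM d L mv kk hL) (L ^ kk) (coverCorner (cvM d L mv kk hL) (L ^ mv) L (coverMargin L mv) q) ∘ₗ (gOp (cvM d L mv kk hL) (L ^ kk) a ∘ₗ symbOp (cvM d L mv kk hL) (L ^ kk) (sD (cvM d L mv kk hL) (L ^ kk) μ (((L ^ kk) : ℕ) : ℝ))) ∘ₗ mulOp (chiCube (cvM d L mv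 kk hL) (L ^ kk) (coverCorner (cvM d L mv kk hL) (L ^ mv) L (coverMargin L mv) q) (L * L ^ mv))))) (fun y y' => ind (cvSk d L mv kk hL q) y * ind (cvSk d L mv kk hL q) y' * (((mf + mb) * εk8) * Real.exp (-(δm * (unitTorusGeo L kk (cvM d L mv kk hL)).dist y y')))) := (fun k μ => hasMaj_tgt_congr (liftBlk_blkCover_comp_kingPrV ι).symm ((hasMaj_idef_tensorId ι (kingPrV L kk r (cvM d L mv kk hL)) (fun y y' => mul_nonneg (mul_nonneg (ind_nonneg _ _) (ind_nonneg _ _)) (mul_nonneg (mul_nonneg hmf.le hεk80) (Real.exp_nonneg _))) (hITF k μ)).mono (fun y y' => mul_le_mul_of_nonneg_left (mul_le_mul_of_nonneg_right (mul_le_mul_of_nonneg_right (le_add_of_nonneg_right hmb.le) hεk80) (Real.exp_nonneg _)) (mul_nonneg (ind_nonneg _ _) (ind_nonneg _ _)))))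
  have T_hDTf : ∀ q : (Fin (d + 1) → ZMod (2 * L)), ∀ μ, HasMaj (BlockNorm.ofBlocks ((unitTorusGeo L kk (cvM d L mv kk hL))) (liftBlk ((cvBlk d L mv kk hL)) ι)) (BlockNorm.ofBlocks ((unitTorusGeo L kk (cvM d L mv kk hL))) (liftBlk (((cvBlk d L mv kk hL)) ∘ ((kingPrV L kk r (cvM d L mv kk hL)))) ι)) (idef (pull (liftMap ((kingPrV L kk r (cvM d L mv kk hL))) ι)) (pull (liftMap ((kingPrV L kk r (cvM d L mv kk hL))) ι)) (tensorId ι (mulOp (chiCube (cvM d L mv kk hL) (L ^ r * L ^ kk) (coverCorner (cvM d L mv kk hL) (L ^ mv) L (coverMargin L mv) q) (L * L ^ mv)) ∘ₗ symOp (cvM d L mv kk hL) (L ^ r * L ^ kk) (coverCorner (cvM d L mv kk hL) (L ^ mv) L (coverMargin L mv) q) ∘ₗ (gOp (cvM d L mv kk hL) (L ^ r * L ^ kk) a ∘ₗ symbOp (cvM d L mv kk hL) (L ^ r * L ^ kk) (sD (cvM d L mv kk hL) (L ^ r * L ^ kk) μ (((L ^ r * L ^ kk) : ℕ) : ℝ)))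 ∘ₗ mulOp (chiCube (cvM d L mv kk hL) (L ^ r * L ^ kk) (coverCorner (cvM d L mv kk hL) (L ^ mv) L (coverMargin L mv) q) (L * L ^ mv)))) (tensorId ι (mulOp (chiCube (cvM d L mv kk hL) (L ^ kk) (coverCorner (cvM d L mv kk hL) (L ^ mv) L (coverMargin L mv) q) (L * L ^ mv)) ∘ₗ symOp (cvM d L mv kk hL) (L ^ kk) (coverCorner (cvM d L mv kk hL) (L ^ mv) L (coverMargin L mv) q) ∘ₗ (gOp (cvM d L mv kk hL) (L ^ kk) a ∘ₗ symbOp (cvM d L mv kk hL) (L ^ kk) (sD (cvM d L mv kk hL) (L ^ kk) μ (((L ^ kk) : ℕ) : ℝ))) ∘ₗ mulOp (chiCube (cvM d L mv kk hL) (L ^ kk) (coverCorner (cvM d L mv kk hL) (L ^ mv) L (coverMargin L mv) q) (L * L ^ mv))))) (fun y y' => ((mf + mb) * εk8) * Real.exp (-(δm * ((unitTorusGeo L kk (cvM d L mv kk hL))).dist y y'))) := (fun k μ => (T_hDTfL k μ).mono (loc₂_le_plain (mul_nonneg (add_nonneg hmf.le hmb.le) hεk80)))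
  have T_hDTbL : ∀ q : (Fin (d + 1) → ZMod (2 * L)), ∀ μ, HasMaj (BlockNorm.ofBlocks ((unitTorusGeo L kk (cvM d L mv kk hL))) (liftBlk ((cvBlk d L mv kk hL)) ι)) (BlockNorm.ofBlocks ((unitTorusGeo L kk (cvM d L mv kk hL))) (liftBlk (((cvBlk d L mv kk hL)) ∘ ((kingPrV L kk r (cvM d L mv kk hL)))) ι)) (idef (pull (liftMap ((kingPrV L kk r (cvM d L mv kk hL))) ι)) (pull (liftMap ((kingPrV L kk r (cvM d L mv kk hL))) ι)) (tensorId ι (-(mulOp (chiCube (cvM d L mv kk hL) (L ^ r * L ^ kk) (coverCorner (cvM d L mv kk hL) (L ^ mv) L (coverMargin L mv) q) (L * L ^ mv)) ∘ₗ symOp (cvM d L mv kk hL) (L ^ r * L ^ kk) (coverCorner (cvM d L mv kk hL) (L ^ mv) L (coverMargin L mv) q) ∘ₗ (gOp (cvM d L mv kk hL) (L ^ r * L ^ kk) a ∘ₗ symbOp (cvM d L mv kk hL) (L ^ r * L ^ kk) ((((L ^ r * L ^ kk) : ℕ) : ℝ) • (sTinv (cvM d L mv kk hL) (L ^ r * L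 ^ kk) μ - 1))) ∘ₗ mulOp (chiCube (cvM d L mv kk hL) (L ^ r * L ^ kk) (coverCorner (cvM d L mv kk hL) (L ^ mv) L (coverMargin L mv) q) (L * L ^ mv))))) (tensorId ι (-(mulOp (chiCube (cvM d L mv kk hL) (L ^ kk) (coverCorner (cvM d L mv kk hL) (L ^ mv) L (coverMargin L mv) q) (L * L ^ mv)) ∘ₗ symOp (cvM d L mv kk hL) (L ^ kk) (coverCorner (cvM d L mv kk hL) (L ^ mv) L (coverMargin L mv) q) ∘ₗ (gOp (cvM d L mv kk hL) (L ^ kk) a ∘ₗ symbOp (cvM d L mv kk hL) (L ^ kk) ((((L ^ kk) : ℕ) : ℝ) • (sTinv (cvM d L mv kk hL) (L ^ kk) μ - 1))) ∘ₗ mulOp (chiCube (cvM d L mv kk hL) (L ^ kk) (coverCorner (cvM d L mv kk hL) (L ^ mv) L (coverMargin L mv) q) (L * L ^ mv)))))) (fun y y' => ind (cvSk d L mv kk hL q) y * ind (cvSk d L mv kk hL q) y' * (((mf + mb) * εk8) * Real.exp (-(δm * (unitTorusGeo L kk (cvM d L mv kk hL)).dist y y')))) := (fun k μ => hasMaj_tgt_congr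 (liftBlk_blkCover_comp_kingPrV ι).symm ((hasMaj_idef_tensorId ι (kingPrV L kk r (cvM d L mv kk hL)) (fun y y' => mul_nonneg (mul_nonneg (ind_nonneg _ _) (ind_nonneg _ _)) (mul_nonneg (mul_nonneg hmb.le hεk80) (Real.exp_nonneg _))) (hITB k μ)).mono (fun y y' => mul_le_mul_of_nonneg_left (mul_le_mul_of_nonneg_right (mul_le_mul_of_nonneg_right (le_add_of_nonneg_left hmf.le) hεk80) (Real.exp_nonneg _)) (mul_nonneg (ind_nonneg _ _) (ind_nonneg _ _)))))
  have T_hDTb : ∀ q : (Fin (d + 1) → ZMod (2 * L)), ∀ μ, HasMaj (BlockNorm.ofBlocks ((unitTorusGeo L kk (cvM d L mv kk hL))) (liftBlk ((cvBlk d L mv kk hL)) ι)) (BlockNorm.ofBlocks ((unitTorusGeo L kk (cvM d L mv kk hL))) (liftBlk (((cvBlk d L mv kk hL)) ∘ ((kingPrV L kk r (cvM d L mv kk hL)))) ι)) (idef (pull (liftMap ((kingPrV L kk r (cvM d L mv kk hL))) ι)) (pull (liftMap ((kingPrV L kk r (cvM d L mv kk hL))) ι)) (tensorId ι (-(mulOp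 (chiCube (cvM d L mv kk hL) (L ^ r * L ^ kk) (coverCorner (cvM d L mv kk hL) (L ^ mv) L (coverMargin L mv) q) (L * L ^ mv)) ∘ₗ symOp (cvM d L mv kk hL) (L ^ r * L ^ kk) (coverCorner (cvM d L mv kk hL) (L ^ mv) L (coverMargin L mv) q) ∘ₗ (gOp (cvM d L mv kk hL) (L ^ r * L ^ kk) a ∘ₗ symbOp (cvM d L mv kk hL) (L ^ r * L ^ kk) ((((L ^ r * L ^ kk) : ℕ) : ℝ) • (sTinv (cvM d L mv kk hL) (L ^ r * L ^ kk) μ - 1))) ∘ₗ mulOp (chiCube (cvM d L mv kk hL) (L ^ r * L ^ kk) (coverCorner (cvM d L mv kk hL) (L ^ mv) L (coverMargin L mv) q) (L * L ^ mv))))) (tensorId ι (-(mulOp (chiCube (cvM d L mv kk hL) (L ^ kk) (coverCorner (cvM d L mv kk hL) (L ^ mv) L (coverMargin L mv) q) (L * L ^ mv)) ∘ₗ symOp (cvM d L mv kk hL) (L ^ kk) (coverCorner (cvM d L mv kk hL) (L ^ mv) L (coverMargin L mv) q) ∘ₗ (gOp (cvM d L mv kk hL) (L ^ kk) a ∘ₗ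 symbOp (cvM d L mv kk hL) (L ^ kk) ((((L ^ kk) : ℕ) : ℝ) • (sTinv (cvM d L mv kk hL) (L ^ kk) μ - 1))) ∘ₗ mulOp (chiCube (cvM d L mv kk hL) (L ^ kk) (coverCorner (cvM d L mv kk hL) (L ^ mv) L (coverMargin L mv) q) (L * L ^ mv)))))) (fun y y' => ((mf + mb) * εk8) * Real.exp (-(δm * ((unitTorusGeo L kk (cvM d L mv kk hL))).dist y y'))) := (fun k μ => (T_hDTbL k μ).mono (loc₂_le_plain (mul_nonneg (add_nonneg hmf.le hmb.le) hεk80))); have T_hθAle : β * R₀ + Fintype.card (Fin (d + 1)) * (2 * (βQ * R₀ + β * R₀)) + β * 0 * cr ≤ θA := (le_of_eq (by rw [hθAdef, hθ₁def, hcJdef]; ring)); have T_hfit₁ : ∀ q : (Fin (d + 1) → ZMod (2 * L)), ∀ μ p', |((fun p' : (CvX' d L mv kk r hL) × ι => (cvBump' d L mv kk r hL q) p'.1) ∘ (liftEquiv (((bshiftEquiv (cvM d L mv kk hL) (L ^ r * L ^ kk))) μ) ι)) p' - ((fun p : (CvX d L mv kk hL) × ι => (cvBump d L mv kk hL q) p.1)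 ∘ (liftEquiv (((bshiftEquiv (cvM d L mv kk hL) (L ^ kk))) μ) ι)) (liftMap ((kingPrV L kk r (cvM d L mv kk hL))) ι p')| ≤ (2 * (π * (d + 1) / (((L ^ kk : ℕ) : ℝ) * W))) := (fun k μ p' => (abs_bcube_cover_lift_shift_fine_sub_le 2 ι hM hw k μ p').trans (le_mul_of_one_le_left hoχ0 one_le_two)); have T_hfit₁b : ∀ q : (Fin (d + 1) → ZMod (2 * L)), ∀ μ p', |((fun p' : (CvX' d L mv kk r hL) × ι => (cvBump' d L mv kk r hL q) p'.1) ∘ (liftEquiv (((bshiftEquiv (cvM d L mv kk hL) (L ^ r * L ^ kk))) μ) ι).symm) p' - ((fun p : (CvX d L mv kk hL) × ι => (cvBump d L mv kk hL q) p.1) ∘ (liftEquiv (((bshiftEquiv (cvM d L mv kk hL) (L ^ kk))) μ) ι).symm) (liftMap ((kingPrV L kk r (cvM d L mv kk hL))) ι p')| ≤ (2 * (π * (d + 1) / (((L ^ kk : ℕ) : ℝ) * W))) := (fun k μ p' => abs_bcube_cover_lift_shift_symm_fine_sub_le 2 ι hM hw k μ p')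
  have T_hfit₂ : ∀ q : (Fin (d + 1) → ZMod (2 * L)), ∀ μ p', |fgrad η'⁻¹ (liftEquiv (((bshiftEquiv (cvM d L mv kk hL) (L ^ r * L ^ kk))) μ) ι) (fun p' : (CvX' d L mv kk r hL) × ι => (cvBump' d L mv kk r hL q) p'.1) p' - fgrad η⁻¹ (liftEquiv (((bshiftEquiv (cvM d L mv kk hL) (L ^ kk))) μ) ι) (fun p : (CvX d L mv kk hL) × ι => (cvBump d L mv kk hL q) p.1) (liftMap ((kingPrV L kk r (cvM d L mv kk hL))) ι p')| ≤ (((W)⁻¹ * (((L ^ kk : ℕ) : ℝ) * W)⁻¹ * (32 * π ^ 4 + π ^ 2 * (d + 1)))) := (fun k μ p' => by rw [hηinv, hη'inv]; exact abs_fgrad_bcube_cover_lift_two_grid_le 2 ι hM hw zero_le_two hRq k μ p'); have T_hfit₂b : ∀ q : (Fin (d + 1) → ZMod (2 * L)), ∀ μ p', |bgrad η'⁻¹ (liftEquiv (((bshiftEquiv (cvM d L mv kk hL) (L ^ r * L ^ kk))) μ) ι) (fun p' : (CvX' d L mv kk r hL) × ι => (cvBump' d L mv kk r hL q) p'.1)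 p' - bgrad η⁻¹ (liftEquiv (((bshiftEquiv (cvM d L mv kk hL) (L ^ kk))) μ) ι) (fun p : (CvX d L mv kk hL) × ι => (cvBump d L mv kk hL q) p.1) (liftMap ((kingPrV L kk r (cvM d L mv kk hL))) ι p')| ≤ (((W)⁻¹ * (((L ^ kk : ℕ) : ℝ) * W)⁻¹ * (32 * π ^ 4 + π ^ 2 * (d + 1)))) := (fun k μ p' => by rw [hηinv, hη'inv]; exact abs_bgrad_bcube_cover_lift_two_grid_le 2 ι hM hw zero_le_two hRq k μ p'); have T_hDcut : ∀ q : (Fin (d + 1) → ZMod (2 * L)), HasMaj (BlockNorm.ofBlocks ((unitTorusGeo L kk (cvM d L mv kk hL))) (liftBlk ((cvBlk d L mv kk hL)) ι)) (BlockNorm.ofBlocks ((unitTorusGeo L kk (cvM d L mv kk hL))) (liftBlk ((cvBlk d L mv kk hL)) ι ∘ liftMap ((kingPrV L kk r (cvM d L mv kk hL))) ι)) (idef (pull (liftMap ((kingPrV L kk r (cvM d L mv kk hL))) ι)) (pull (liftMap ((kingPrV L kk r (cvM d L mv kk hL))) ι)) (mulOp (fun p : (CvX' d L mv kk r hL) ×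 ι => (cvChi' d L mv kk r hL q) p.1) ∘ₗ (mulOp (fun p : CvX' d L mv kk r hL × ι => cvPsi' d L mv kk r hL q p.1) ∘ₗ cvCube' d L mv kk r hL a ι q)) (mulOp (fun p : (CvX d L mv kk hL) × ι => (cvChi d L mv kk hL q) p.1) ∘ₗ (mulOp (fun p : CvX d L mv kk hL × ι => cvPsi d L mv kk hL q p.1) ∘ₗ cvCube d L mv kk hL a ι q))) (fun y y' => ind (cvSk d L mv kk hL q) y * ind (cvSk d L mv kk hL q) y' * ((mc * εk) * Real.exp (-(δm * ((unitTorusGeo L kk (cvM d L mv kk hL))).dist y y')))) := (fun k => by rw [cut_comp_cutCube_cover_lift (n := L ^ kk) ι hM hm₁ hfitI hS0 k, cut_comp_cutCube_cover_lift (n := L ^ r * L ^ kk) ι hM hm₁ hfitI hS0 k]; exact hasMaj_idef_cut_cover_lift (m₀ := coverMargin L mv) ι hM hm₁ hfitI hS0 k (hKc k) (hIGc k))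
  have T_hDcutF : ∀ q : (Fin (d + 1) → ZMod (2 * L)), ∀ μ, HasMaj (BlockNorm.ofBlocks ((unitTorusGeo L kk (cvM d L mv kk hL))) (liftBlk ((cvBlk d L mv kk hL)) ι)) (BlockNorm.ofBlocks ((unitTorusGeo L kk (cvM d L mv kk hL))) (liftBlk ((cvBlk d L mv kk hL)) ι ∘ liftMap ((kingPrV L kk r (cvM d L mv kk hL))) ι)) (idef (pull (liftMap ((kingPrV L kk r (cvM d L mv kk hL))) ι)) (pull (liftMap ((kingPrV L kk r (cvM d L mv kk hL))) ι)) (mulOp (fun p : (CvX' d L mv kk r hL) × ι => (cvChi' d L mv kk r hL q) p.1) ∘ₗ (fgrad η'⁻¹ (liftEquiv (((bshiftEquiv (cvM d L mv kk hL) (L ^ r * L ^ kk))) μ) ι) ∘ₗ (mulOp (fun p : CvX' d L mv kk r hL × ι => cvPsi' d L mv kk r hL q p.1) ∘ₗ cvCube' d L mv kk r hL a ι q))) (mulOp (fun p : (CvX d L mv kk hL) × ι => (cvChi d L mv kk hL q) p.1) ∘ₗ (fgrad η⁻¹ (liftEquiv (((bshiftEquiv (cvM d L mv kk hL) (L ^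 kk))) μ) ι) ∘ₗ (mulOp (fun p : CvX d L mv kk hL × ι => cvPsi d L mv kk hL q p.1) ∘ₗ cvCube d L mv kk hL a ι q)))) (fun y y' => ind (cvSk d L mv kk hL q) y * ind (cvSk d L mv kk hL q) y' * ((max me mh * εk) * Real.exp (-(δm * ((unitTorusGeo L kk (cvM d L mv kk hL))).dist y y')))) := (fun k μ => by rw [hηinv, hη'inv, cut_fgrad_cutCube_cover_lift (n := L ^ kk) ι hM hm₂ hfit₂ hS0 _ μ k, cut_fgrad_cutCube_cover_lift (n := L ^ r * L ^ kk) ι hM hm₂ hfit₂ hS0 _ μ k]; exact hasMaj_idef_cutF_cover_lift (m₀ := coverMargin L mv) ι hM hm₁ hfitI hS0 k _ _ μ (hKe k) (hIDc k μ)); have T_hDcutB : ∀ q : (Fin (d + 1) → ZMod (2 * L)), ∀ μ, HasMaj (BlockNorm.ofBlocks ((unitTorusGeo L kk (cvM d L mv kk hL))) (liftBlk ((cvBlk d L mv kk hL)) ι)) (BlockNorm.ofBlocks ((unitTorusGeo L kk (cvM d L mv kk hL))) (liftBlk ((cvBlk d L mv kk hL)) ι ∘ liftMap ((kingPrV L kk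 r (cvM d L mv kk hL))) ι)) (idef (pull (liftMap ((kingPrV L kk r (cvM d L mv kk hL))) ι)) (pull (liftMap ((kingPrV L kk r (cvM d L mv kk hL))) ι)) (mulOp (fun p : (CvX' d L mv kk r hL) × ι => (cvChi' d L mv kk r hL q) p.1) ∘ₗ (bgrad η'⁻¹ (liftEquiv (((bshiftEquiv (cvM d L mv kk hL) (L ^ r * L ^ kk))) μ) ι) ∘ₗ (mulOp (fun p : CvX' d L mv kk r hL × ι => cvPsi' d L mv kk r hL q p.1) ∘ₗ cvCube' d L mv kk r hL a ι q))) (mulOp (fun p : (CvX d L mv kk hL) × ι => (cvChi d L mv kk hL q) p.1) ∘ₗ (bgrad η⁻¹ (liftEquiv (((bshiftEquiv (cvM d L mv kk hL) (L ^ kk))) μ) ι) ∘ₗ (mulOp (fun p : CvX d L mv kk hL × ι => cvPsi d L mv kk hL q p.1) ∘ₗ cvCube d L mv kk hL a ι q)))) (fun y y' => ind (cvSk d L mv kk hL q) y * ind (cvSk d L mv kk hL q) y' * ((max me mh * εk) * Real.exp (-(δm * ((unitTorusGeo L kk (cvM d L mv kk hL))).dist y y')))) := (fun k μ => by rw [hηinv,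 hη'inv, cut_bgrad_cutCube_cover_lift (n := L ^ kk) ι hM hm₂ hfit₂ hS0 _ μ k, cut_bgrad_cutCube_cover_lift (n := L ^ r * L ^ kk) ι hM hm₂ hfit₂ hS0 _ μ k]; exact hasMaj_idef_cutB_cover_lift (m₀ := coverMargin L mv) ι hM hm₁ hfitI hS0 k _ _ μ (hKe k) (hIDbc k μ)); have T_hhD : ∀ q : (Fin (d + 1) → ZMod (2 * L)), ∀ μ p, |(fgrad η⁻¹ (liftEquiv (((bshiftEquiv (cvM d L mv kk hL) (L ^ kk))) μ) ι) (fun p : (CvX d L mv kk hL) × ι => ((knitH d L mv kk (L ^ kk) hL q)) p.1) ∘ ⇑(liftEquiv (((bshiftEquiv (cvM d L mv kk hL) (L ^ kk))) μ) ι).symm) p| ≤ (π * W⁻¹) := (fun k μ p => by rw [hηinv]; exact (abs_fgrad_coverH_lift_le ι hM hw k μ ((liftEquiv ((bshiftEquiv (cvM d L mv kk hL) (L ^ kk)) μ) ι).symm p)).trans_eq (div_eq_mul_inv _ _))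
  have T_hhB : ∀ q : (Fin (d + 1) → ZMod (2 * L)), ∀ μ p, |(bgrad η⁻¹ (liftEquiv (((bshiftEquiv (cvM d L mv kk hL) (L ^ kk))) μ) ι) (fun p : (CvX d L mv kk hL) × ι => ((knitH d L mv kk (L ^ kk) hL q)) p.1) ∘ ⇑(liftEquiv (((bshiftEquiv (cvM d L mv kk hL) (L ^ kk))) μ) ι)) p| ≤ (π * W⁻¹) := (fun k μ p => by rw [hηinv]; exact (abs_bgrad_coverH_lift_le ι hM hw k μ ((liftEquiv ((bshiftEquiv (cvM d L mv kk hL) (L ^ kk)) μ) ι) p)).trans_eq (div_eq_mul_inv _ _)); have T_hh2f : ∀ q : (Fin (d + 1) → ZMod (2 * L)), ∀ μ p, |(fgrad η⁻¹ (liftEquiv (((bshiftEquiv (cvM d L mv kk hL) (L ^ kk))) μ) ι) (fgrad η⁻¹ (liftEquiv (((bshiftEquiv (cvM d L mv kk hL) (L ^ kk))) μ) ι) (fun p : (CvX d L mv kk hL) × ι => ((knitH d L mv kk (L ^ kk) hL q)) p.1)) ∘ ⇑(liftEquiv (((bshiftEquiv (cvM d L mv kk hL) (L ^ kk))) μ)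 ι).symm) p| ≤ (32 * π ^ 2 * W⁻¹) := (fun k μ p => abs_fgrad_fgrad_le_of _ _ (hh2 k μ) ((liftEquiv ((bshiftEquiv (cvM d L mv kk hL) (L ^ kk)) μ) ι).symm p)); have T_hh2b : ∀ q : (Fin (d + 1) → ZMod (2 * L)), ∀ μ p, |bgrad η⁻¹ (liftEquiv (((bshiftEquiv (cvM d L mv kk hL) (L ^ kk))) μ) ι) (bgrad η⁻¹ (liftEquiv (((bshiftEquiv (cvM d L mv kk hL) (L ^ kk))) μ) ι) (fun p : (CvX d L mv kk hL) × ι => ((knitH d L mv kk (L ^ kk) hL q)) p.1) ∘ ⇑(liftEquiv (((bshiftEquiv (cvM d L mv kk hL) (L ^ kk))) μ) ι)) p| ≤ (32 * π ^ 2 * W⁻¹) := (fun k μ p => abs_bgrad_bgrad_shift_le_of _ _ (hh2 k μ) p); have T_hf2 : ∀ q : (Fin (d + 1) → ZMod (2 * L)), ∀ μ p', |fgradAdj η'⁻¹ (liftEquiv (((bshiftEquiv (cvM d L mv kk hL) (L ^ r * L ^ kk))) μ) ι) (fgrad η'⁻¹ (liftEquiv (((bshiftEquiv (cvM d L mv kk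 hL) (L ^ r * L ^ kk))) μ) ι) (fun p : (CvX' d L mv kk r hL) × ι => ((knitH d L mv kk (L ^ r * L ^ kk) hL q)) p.1)) p' - fgradAdj η⁻¹ (liftEquiv (((bshiftEquiv (cvM d L mv kk hL) (L ^ kk))) μ) ι) (fgrad η⁻¹ (liftEquiv (((bshiftEquiv (cvM d L mv kk hL) (L ^ kk))) μ) ι) (fun p : (CvX d L mv kk hL) × ι => ((knitH d L mv kk (L ^ kk) hL q)) p.1)) (liftMap ((kingPrV L kk r (cvM d L mv kk hL))) ι p')| ≤ ((W⁻¹ ^ 2 * (((L ^ kk : ℕ) : ℝ) * W)⁻¹ * (144 * π ^ 3 + 32 * π ^ 3 * Fintype.card (Fin (d + 1))))) := (fun k μ p' => by rw [hηinv, hη'inv]; exact abs_fgradAdj_fgrad_coverH_lift_two_grid_le ι hM hw h3 k μ p'); have T_hh1 : ∀ q : (Fin (d + 1) → ZMod (2 * L)), ∀ μ x, |fgrad η⁻¹ (((bshiftEquiv (cvM d L mv kk hL) (L ^ kk))) μ) ((knitH d L mv kk (L ^ kk) hL q)) x| ≤ (π * W⁻¹) := (fun k μ x => by rw [hηinv];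 exact (abs_fgrad_coverH_le hM hw k μ x).trans_eq (div_eq_mul_inv _ _)); have T_hh1b : ∀ q : (Fin (d + 1) → ZMod (2 * L)), ∀ μ x, |bgrad η⁻¹ (((bshiftEquiv (cvM d L mv kk hL) (L ^ kk))) μ) ((knitH d L mv kk (L ^ kk) hL q)) x| ≤ (π * W⁻¹) := (fun k μ x => by rw [hηinv]; exact (abs_bgrad_coverH_le hM hw k μ x).trans_eq (div_eq_mul_inv _ _)); have T_hh0 : ∀ q : (Fin (d + 1) → ZMod (2 * L)), ∀ μ x, |((knitH d L mv kk (L ^ kk) hL q)) (((bshiftEquiv (cvM d L mv kk hL) (L ^ kk))) μ x) - ((knitH d L mv kk (L ^ kk) hL q)) x| ≤ (π * W⁻¹) := (fun k μ x => abs_shift_sub_le_of_fgrad η⁻¹ ((bshiftEquiv (cvM d L mv kk hL) (L ^ kk)) μ) hη1 (fun x => by rw [hηinv]; exact (abs_fgrad_coverH_le hM hw k μ x).trans_eq (div_eq_mul_inv _ _)) x); have T_hh1' : ∀ q : (Fin (d + 1) → ZMod (2 * L)), ∀ μ x', |fgrad η'⁻¹ (((bshiftEquiv (cvM d L mv kk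 hL) (L ^ r * L ^ kk))) μ) ((knitH d L mv kk (L ^ r * L ^ kk) hL q)) x'| ≤ (π * W⁻¹) := (fun k μ x => by rw [hη'inv]; exact (abs_fgrad_coverH_le hM hw k μ x).trans_eq (div_eq_mul_inv _ _))
  have T_hh1b' : ∀ q : (Fin (d + 1) → ZMod (2 * L)), ∀ μ x', |bgrad η'⁻¹ (((bshiftEquiv (cvM d L mv kk hL) (L ^ r * L ^ kk))) μ) ((knitH d L mv kk (L ^ r * L ^ kk) hL q)) x'| ≤ (π * W⁻¹) := (fun k μ x => by rw [hη'inv]; exact (abs_bgrad_coverH_le hM hw k μ x).trans_eq (div_eq_mul_inv _ _)); have T_hh0' : ∀ q : (Fin (d + 1) → ZMod (2 * L)), ∀ μ x', |((knitH d L mv kk (L ^ r * L ^ kk) hL q)) (((bshiftEquiv (cvM d L mv kk hL) (L ^ r * L ^ kk))) μ x') - ((knitH d L mv kk (L ^ r * L ^ kk) hL q)) x'| ≤ (π * W⁻¹) := (fun k μ x => abs_shift_sub_le_of_fgrad η'⁻¹ ((bshiftEquiv (cvM d L mv kk hL) (L ^ r * L ^ kk)) μ) hη'1 (fun x => by rw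 [hη'inv]; exact (abs_fgrad_coverH_le hM hw k μ x).trans_eq (div_eq_mul_inv _ _)) x); have T_hf1 : ∀ q : (Fin (d + 1) → ZMod (2 * L)), ∀ μ x', |fgrad η'⁻¹ (((bshiftEquiv (cvM d L mv kk hL) (L ^ r * L ^ kk))) μ) ((knitH d L mv kk (L ^ r * L ^ kk) hL q)) x' - fgrad η⁻¹ (((bshiftEquiv (cvM d L mv kk hL) (L ^ kk))) μ) ((knitH d L mv kk (L ^ kk) hL q)) (((kingPrV L kk r (cvM d L mv kk hL))) x')| ≤ ((|W⁻¹| * (((L ^ kk : ℕ) : ℝ) * W)⁻¹ * (64 * π ^ 2 + π ^ 2 * Fintype.card (Fin (d + 1))))) := (fun k μ x' => by have h := abs_fgrad_coverH_lift_two_grid_le Unit hM hw h3 k μ (x', ()); rw [abs_fgrad_lift_pair_eq] at h; rw [hηinv, hη'inv]; exact h); have T_hf1b : ∀ q : (Fin (d + 1) → ZMod (2 * L)), ∀ μ x', |bgrad η'⁻¹ (((bshiftEquiv (cvM d L mv kk hL) (L ^ r * L ^ kk))) μ) ((knitH d L mv kk (L ^ r * L ^ kk) hL q)) x' - bgrad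 η⁻¹ (((bshiftEquiv (cvM d L mv kk hL) (L ^ kk))) μ) ((knitH d L mv kk (L ^ kk) hL q)) (((kingPrV L kk r (cvM d L mv kk hL))) x')| ≤ ((|W⁻¹| * (((L ^ kk : ℕ) : ℝ) * W)⁻¹ * (64 * π ^ 2 + π ^ 2 * Fintype.card (Fin (d + 1))))) := (fun k μ x' => by have h := abs_bgrad_coverH_lift_two_grid_le Unit hM hw h3 k μ (x', ()); rw [abs_bgrad_lift_pair_eq] at h; rw [hηinv, hη'inv]; exact h); have T_hf0 : ∀ q : (Fin (d + 1) → ZMod (2 * L)), ∀ μ x', |(((knitH d L mv kk (L ^ r * L ^ kk) hL q)) (((bshiftEquiv (cvM d L mv kk hL) (L ^ r * L ^ kk))) μ x') - ((knitH d L mv kk (L ^ r * L ^ kk) hL q)) x') - (((knitH d L mv kk (L ^ kk) hL q)) (((bshiftEquiv (cvM d L mv kk hL) (L ^ kk))) μ (((kingPrV L kk r (cvM d L mv kk hL))) x')) - ((knitH d L mv kk (L ^ kk) hL q)) (((kingPrV L kk r (cvM d L mv kk hL))) x'))| ≤ ((π / W / ((L ^ r * L ^ kk : ℕ) : ℝ)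 + π / W / ((L ^ kk : ℕ) : ℝ))) := (fun k μ x' => abs_coverH_step_two_grid_le kk r hM hw k μ x'); have T_hf0b : ∀ q : (Fin (d + 1) → ZMod (2 * L)), ∀ μ x', |(((knitH d L mv kk (L ^ r * L ^ kk) hL q)) x' - ((knitH d L mv kk (L ^ r * L ^ kk) hL q)) ((((bshiftEquiv (cvM d L mv kk hL) (L ^ r * L ^ kk))) μ).symm x')) - (((knitH d L mv kk (L ^ kk) hL q)) (((kingPrV L kk r (cvM d L mv kk hL))) x') - ((knitH d L mv kk (L ^ kk) hL q)) ((((bshiftEquiv (cvM d L mv kk hL) (L ^ kk))) μ).symm (((kingPrV L kk r (cvM d L mv kk hL))) x')))| ≤ ((π / W / ((L ^ r * L ^ kk : ℕ) : ℝ) + π / W / ((L ^ kk : ℕ) : ℝ))) := (fun k μ x' => abs_coverH_step_symm_two_grid_le kk r hM hw k μ x'); have T_hfit : ∀ q : (Fin (d + 1) → ZMod (2 * L)), ∀ x', |((knitH d L mv kk (L ^ r * L ^ kk) hL q)) x' - ((knitH d L mv kk (L ^ kk) hL q)) (((kingPrV L kk r (cvM d L mv kk hL))) x')| ≤ ((π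 * (d + 1) / (((L ^ kk : ℕ) : ℝ) * W))) := (fun k x' => abs_coverH_fine_sub_le kk r hM hw k x')
  have T_hLip : ∀ q : (Fin (d + 1) → ZMod (2 * L)), ∀ y y', |(coverHb (cvM d L mv kk hL) (L ^ kk) (L ^ mv) L q) y - (coverHb (cvM d L mv kk hL) (L ^ kk) (L ^ mv) L q) y'| ≤ (πD * W⁻¹) * ((unitTorusGeo L kk (cvM d L mv kk hL))).dist y y' := (fun k y y' => (abs_coverHb_sub_le hM hw k y y').trans_eq (by rw [hπDdef, div_eq_mul_inv])); have T_hrh : ∀ q : (Fin (d + 1) → ZMod (2 * L)), ∀ x, |((knitH d L mv kk (L ^ kk) hL q)) x - (coverHb (cvM d L mv kk hL) (L ^ kk) (L ^ mv) L q) (((cvBlk d L mv kk hL)) x)| ≤ (πD * W⁻¹) := (fun k x => (abs_coverH_sub_coverHb_le hM hw k x).trans_eq (by rw [hπDdef, div_eq_mul_inv])); have T_hrh' : ∀ q : (Fin (d + 1) → ZMod (2 * L)), ∀ x', |((knitH d L mv kk (L ^ r * L ^ kk) hL q)) x' - (coverHb (cvM d L mv kk hL) (L ^ kk) (L ^ mv)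 L q) (((cvBlk d L mv kk hL)) (((kingPrV L kk r (cvM d L mv kk hL))) x'))| ≤ (πD * W⁻¹) := (fun k x' => by have h := abs_coverH_sub_coverHb_le (M := (cvM d L mv kk hL)) (n := L ^ r * L ^ kk) hM hw k x'; rw [coverHb_eq_of_spacing (L ^ kk) (L ^ r * L ^ kk) hw k, ← congrFun (VectorPiece.blkFine_comp_kingPrV (M := (cvM d L mv kk hL)) L kk r) x'] at h; exact h.trans_eq (by rw [hπDdef, div_eq_mul_inv])); have T_hKN : ∀ q : (Fin (d + 1) → ZMod (2 * L)), HasMaj (BlockNorm.ofBlocks ((unitTorusGeo L kk (cvM d L mv kk hL))) (liftBlk ((cvBlk d L mv kk hL)) ι)) (BlockNorm.ofBlocks ((unitTorusGeo L kk (cvM d L mv kk hL))) (liftBlk ((cvBlk d L mv kk hL)) ι)) (commOp (cvNL d L mv kk hL a ι) (fun p : (CvX d L mv kk hL) × ι => ((knitH d L mv kk (L ^ kk) hL q)) p.1)) (fun y y' => (cNn * W⁻¹) * Real.exp (-((δm - δm / 2) * ((unitTorusGeo L kk (cvM d L mv kk hL))).dist y y'))) := (fun k => (hasMaj_commOp_nonlocal_cover_lift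 (δN := δm) ι hM hw hC₁.le hδm0.le hδmδ₁ (half_pos hδm0) hNL k).mono fun y y' => le_of_eq (by simp only [hcNndef, hπDdef, hE'def, hWdef, hcN₀def]; ring)); have T_hDKN : ∀ q : (Fin (d + 1) → ZMod (2 * L)), HasMaj (BlockNorm.ofBlocks ((unitTorusGeo L kk (cvM d L mv kk hL))) (liftBlk ((cvBlk d L mv kk hL)) ι)) (BlockNorm.ofBlocks ((unitTorusGeo L kk (cvM d L mv kk hL))) (liftBlk (((cvBlk d L mv kk hL)) ∘ ((kingPrV L kk r (cvM d L mv kk hL)))) ι)) (idef (pull (liftMap ((kingPrV L kk r (cvM d L mv kk hL))) ι)) (pull (liftMap ((kingPrV L kk r (cvM d L mv kk hL))) ι)) (commOp (cvNL' d L mv kk r hL a ι) (fun p : (CvX' d L mv kk r hL) × ι => ((knitH d L mv kk (L ^ r * L ^ kk) hL q)) p.1)) (commOp (cvNL d L mv kk hL a ι) (fun p : (CvX d L mv kk hL) × ι => ((knitH d L mv kk (L ^ kk) hL q)) p.1))) (fun y y' => (((π * (d + 1) / W * (Real.exp 1 * (δm / 2))⁻¹ + 2 * (π * (d + 1) / W))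 * (rr * εk) + 2 * (π * (d + 1) / (((L ^ kk : ℕ) : ℝ) * W)) * cN₀)) * Real.exp (-((δm - δm / 2) * ((unitTorusGeo L kk (cvM d L mv kk hL))).dist y y'))) := (fun k => hasMaj_idef_commOp_nonlocal_cover_lift ι hM hw k hcN₀0 (mul_nonneg hrr.le hεk0) (half_pos hδm0) hNsc hNsc' hDNsc); have T_hNV : ∀ q : (Fin (d + 1) → ZMod (2 * L)), HasMaj (BlockNorm.ofBlocks ((unitTorusGeo L kk (cvM d L mv kk hL))) (liftBlk ((cvBlk d L mv kk hL)) ι)) (BlockNorm.ofBlocks ((unitTorusGeo L kk (cvM d L mv kk hL))) (liftBlk ((cvBlk d L mv kk hL)) ι)) ((0 : (CvX d L mv kk hL × ι → ℝ) →ₗ[ℝ] (CvX d L mv kk hL × ι → ℝ))) (fun y y' => 0 * Real.exp (-(δm * ((unitTorusGeo L kk (cvM d L mv kk hL))).dist y y'))) := (fun k => (hasMaj_zero _ _).mono fun y y' => le_of_eq (zero_mul _).symm)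
  have T_hNV' : ∀ q : (Fin (d + 1) → ZMod (2 * L)), HasMaj (BlockNorm.ofBlocks ((unitTorusGeo L kk (cvM d L mv kk hL))) (liftBlk (((cvBlk d L mv kk hL)) ∘ ((kingPrV L kk r (cvM d L mv kk hL)))) ι)) (BlockNorm.ofBlocks ((unitTorusGeo L kk (cvM d L mv kk hL))) (liftBlk (((cvBlk d L mv kk hL)) ∘ ((kingPrV L kk r (cvM d L mv kk hL)))) ι)) ((0 : (CvX' d L mv kk r hL × ι → ℝ) →ₗ[ℝ] (CvX' d L mv kk r hL × ι → ℝ))) (fun y y' => 0 * Real.exp (-(δm * ((unitTorusGeo L kk (cvM d L mv kk hL))).dist y y'))) := (fun k => (hasMaj_zero _ _).mono fun y y' => le_of_eq (zero_mul _).symm); have T_hDNV : ∀ q : (Fin (d + 1) → ZMod (2 * L)), HasMaj (BlockNorm.ofBlocks ((unitTorusGeo L kk (cvM d L mv kk hL))) (liftBlk ((cvBlk d L mv kk hL)) ι)) (BlockNorm.ofBlocks ((unitTorusGeo L kk (cvM d L mv kk hL))) (liftBlk (((cvBlk d L mv kk hL)) ∘ ((kingPrV L kk r (cvM d L mv kk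 hL)))) ι)) (idef (pull (liftMap ((kingPrV L kk r (cvM d L mv kk hL))) ι)) (pull (liftMap ((kingPrV L kk r (cvM d L mv kk hL))) ι)) ((0 : (CvX' d L mv kk r hL × ι → ℝ) →ₗ[ℝ] (CvX' d L mv kk r hL × ι → ℝ))) ((0 : (CvX d L mv kk hL × ι → ℝ) →ₗ[ℝ] (CvX d L mv kk hL × ι → ℝ)))) (fun y y' => 0 * Real.exp (-(δm * ((unitTorusGeo L kk (cvM d L mv kk hL))).dist y y'))) := (fun k => by rw [idef_zero]; exact (hasMaj_zero _ _).mono fun y y' => le_of_eq (zero_mul _).symm); have T_hIcut : ∀ q : (Fin (d + 1) → ZMod (2 * L)), HasMaj (BlockNorm.ofBlocks ((unitTorusGeo L kk (cvM d L mv kk hL))) (liftBlk ((cvBlk d L mv kk hL)) ι)) (BlockNorm.ofBlocks ((unitTorusGeo L kk (cvM d L mv kk hL))) (liftBlk (((cvBlk d L mv kk hL)) ∘ ((kingPrV L kk r (cvM d L mv kk hL)))) ι)) (idef (pull (liftMap ((kingPrV L kk r (cvM d L mv kk hL))) ι)) (pull (liftMap ((kingPrV L kk r (cvM d L mv kk hL)))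 ι)) (mulOp (fun p : (CvX' d L mv kk r hL) × ι => (cvChi' d L mv kk r hL q) p.1) ∘ₗ (mulOp (fun p : CvX' d L mv kk r hL × ι => cvPsi' d L mv kk r hL q p.1) ∘ₗ cvCube' d L mv kk r hL a ι q)) (mulOp (fun p : (CvX d L mv kk hL) × ι => (cvChi d L mv kk hL q) p.1) ∘ₗ (mulOp (fun p : CvX d L mv kk hL × ι => cvPsi d L mv kk hL q p.1) ∘ₗ cvCube d L mv kk hL a ι q))) (fun y y' => ind (cvSk d L mv kk hL q) y * ind (cvSk d L mv kk hL q) y' * ((mc * εk) * Real.exp (-(δm * ((unitTorusGeo L kk (cvM d L mv kk hL))).dist y y')))) := (fun k => by rw [cut_comp_cutCube_cover_lift (n := L ^ kk) ι hM hm₁ hfitI hS0 k, cut_comp_cutCube_cover_lift (n := L ^ r * L ^ kk) ι hM hm₁ hfitI hS0 k]; exact hasMaj_idef_cut_cover_lift (m₀ := coverMargin L mv) ι hM hm₁ hfitI hS0 k (hKc k) (hIGc k))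
  have T_hITf : ∀ q : (Fin (d + 1) → ZMod (2 * L)), ∀ μ, HasMaj (BlockNorm.ofBlocks ((unitTorusGeo L kk (cvM d L mv kk hL))) (liftBlk ((cvBlk d L mv kk hL)) ι)) (BlockNorm.ofBlocks ((unitTorusGeo L kk (cvM d L mv kk hL))) (liftBlk (((cvBlk d L mv kk hL)) ∘ ((kingPrV L kk r (cvM d L mv kk hL)))) ι)) (idef (pull (liftMap ((kingPrV L kk r (cvM d L mv kk hL))) ι)) (pull (liftMap ((kingPrV L kk r (cvM d L mv kk hL))) ι)) (mulOp (fun p : (CvX' d L mv kk r hL) × ι => (cvChi' d L mv kk r hL q) p.1) ∘ₗ (tensorId ι (mulOp (chiCube (cvM d L mv kk hL) (L ^ r * L ^ kk) (coverCorner (cvM d L mv kk hL) (L ^ mv) L (coverMargin L mv) q) (L * L ^ mv)) ∘ₗ symOp (cvM d L mv kk hL) (L ^ r * L ^ kk) (coverCorner (cvM d L mv kk hL) (L ^ mv) L (coverMargin L mv) q) ∘ₗ (gOp (cvM d L mv kk hL) (L ^ r * L ^ kk) a ∘ₗ symbOp (cvM d L mv kk hL) (L ^ r * L ^ kk) (sD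 (cvM d L mv kk hL) (L ^ r * L ^ kk) μ (((L ^ r * L ^ kk) : ℕ) : ℝ))) ∘ₗ mulOp (chiCube (cvM d L mv kk hL) (L ^ r * L ^ kk) (coverCorner (cvM d L mv kk hL) (L ^ mv) L (coverMargin L mv) q) (L * L ^ mv))))) (mulOp (fun p : (CvX d L mv kk hL) × ι => (cvChi d L mv kk hL q) p.1) ∘ₗ (tensorId ι (mulOp (chiCube (cvM d L mv kk hL) (L ^ kk) (coverCorner (cvM d L mv kk hL) (L ^ mv) L (coverMargin L mv) q) (L * L ^ mv)) ∘ₗ symOp (cvM d L mv kk hL) (L ^ kk) (coverCorner (cvM d L mv kk hL) (L ^ mv) L (coverMargin L mv) q) ∘ₗ (gOp (cvM d L mv kk hL) (L ^ kk) a ∘ₗ symbOp (cvM d L mv kk hL) (L ^ kk) (sD (cvM d L mv kk hL) (L ^ kk) μ (((L ^ kk) : ℕ) : ℝ))) ∘ₗ mulOp (chiCube (cvM d L mv kk hL) (L ^ kk) (coverCorner (cvM d L mv kk hL) (L ^ mv) L (coverMargin L mv) q) (L * L ^ mv)))))) (fun y y' => ind (cvSk d L mv kk hL q) y * ind (cvSk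 d L mv kk hL q) y' * ((((1 * ((mf + mb) * εk8) + 0 * βQ))) * Real.exp (-(δm * ((unitTorusGeo L kk (cvM d L mv kk hL))).dist y y')))) := (fun k μ => hasMaj_idef_cut_comp_loc₂ (g := (unitTorusGeo L kk (cvM d L mv kk hL))) (a' := cvChi' d L mv kk r hL k) (a := cvChi d L mv kk hL k) (S := cvSk d L mv kk hL k) (cvBlk d L mv kk hL) (kingPrV L kk r (cvM d L mv kk hL)) le_rfl (fun x => abs_chiCube_le_one _ x) (fun x' => (abs_eq_zero.mpr (sub_eq_zero.mpr (hχπ0 k x'))).le) (T_hTfr k μ) (T_hDTfL k μ))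
  have T_hITb : ∀ q : (Fin (d + 1) → ZMod (2 * L)), ∀ μ, HasMaj (BlockNorm.ofBlocks ((unitTorusGeo L kk (cvM d L mv kk hL))) (liftBlk ((cvBlk d L mv kk hL)) ι)) (BlockNorm.ofBlocks ((unitTorusGeo L kk (cvM d L mv kk hL))) (liftBlk (((cvBlk d L mv kk hL)) ∘ ((kingPrV L kk r (cvM d L mv kk hL)))) ι)) (idef (pull (liftMap ((kingPrV L kk r (cvM d L mv kk hL))) ι)) (pull (liftMap ((kingPrV L kk r (cvM d L mv kk hL))) ι)) (mulOp (fun p : (CvX' d L mv kk r hL) × ι => (cvChi' d L mv kk r hL q) p.1) ∘ₗ (tensorId ι (-(mulOp (chiCube (cvM d L mv kk hL) (L ^ r * L ^ kk) (coverCorner (cvM d L mv kk hL) (L ^ mv) L (coverMargin L mv) q) (L * L ^ mv)) ∘ₗ symOp (cvM d L mv kk hL) (L ^ r * L ^ kk) (coverCorner (cvM d L mv kk hL) (L ^ mv) L (coverMargin L mv) q) ∘ₗ (gOp (cvM d L mv kk hL) (L ^ r * L ^ kk) a ∘ₗ symbOp (cvM d L mv kk hL) (L ^ r * L ^ kk)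 ((((L ^ r * L ^ kk) : ℕ) : ℝ) • (sTinv (cvM d L mv kk hL) (L ^ r * L ^ kk) μ - 1))) ∘ₗ mulOp (chiCube (cvM d L mv kk hL) (L ^ r * L ^ kk) (coverCorner (cvM d L mv kk hL) (L ^ mv) L (coverMargin L mv) q) (L * L ^ mv)))))) (mulOp (fun p : (CvX d L mv kk hL) × ι => (cvChi d L mv kk hL q) p.1) ∘ₗ (tensorId ι (-(mulOp (chiCube (cvM d L mv kk hL) (L ^ kk) (coverCorner (cvM d L mv kk hL) (L ^ mv) L (coverMargin L mv) q) (L * L ^ mv)) ∘ₗ symOp (cvM d L mv kk hL) (L ^ kk) (coverCorner (cvM d L mv kk hL) (L ^ mv) L (coverMargin L mv) q) ∘ₗ (gOp (cvM d L mv kk hL) (L ^ kk) a ∘ₗ symbOp (cvM d L mv kk hL) (L ^ kk) ((((L ^ kk) : ℕ) : ℝ) • (sTinv (cvM d L mv kk hL) (L ^ kk) μ - 1))) ∘ₗ mulOp (chiCube (cvM d L mv kk hL) (L ^ kk) (coverCorner (cvM d L mv kk hL) (L ^ mv) L (coverMargin L mv) q) (L * L ^ mv))))))) (fun y y' => ind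 (cvSk d L mv kk hL q) y * ind (cvSk d L mv kk hL q) y' * ((((1 * ((mf + mb) * εk8) + 0 * βQ))) * Real.exp (-(δm * ((unitTorusGeo L kk (cvM d L mv kk hL))).dist y y')))) := (fun k μ => hasMaj_idef_cut_comp_loc₂ (g := (unitTorusGeo L kk (cvM d L mv kk hL))) (a' := cvChi' d L mv kk r hL k) (a := cvChi d L mv kk hL k) (S := cvSk d L mv kk hL k) (cvBlk d L mv kk hL) (kingPrV L kk r (cvM d L mv kk hL)) le_rfl (fun x => abs_chiCube_le_one _ x) (fun x' => (abs_eq_zero.mpr (sub_eq_zero.mpr (hχπ0 k x'))).le) (T_hTbr k μ) (T_hDTbL k μ)); have T_hSψ : ∀ q : (Fin (d + 1) → ZMod (2 * L)), ∀ x, (cvPsi d L mv kk hL q) x ≠ 0 → ((cvBlk d L mv kk hL)) x ∈ (cvSk d L mv kk hL q) := (fun k x hx => Finset.mem_coe.mpr (by by_contra h; exact hx (chiCube_of_not_mem h))); have T_hfitχc : ∀ (q : Fin (d + 1) → ZMod (2 * L)) x', |(cvChi' d L mv kk r hL q) x' - (cvChi d L mv kk hL q) (((kingPrV L kk r (cvM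 d L mv kk hL))) x')| ≤ 0 := (fun k x' => (abs_eq_zero.mpr (sub_eq_zero.mpr (hχπ0 k x'))).le); have T_hfits : ∀ (q : Fin (d + 1) → ZMod (2 * L)) x', |((knitH d L mv kk (L ^ r * L ^ kk) hL q)) (((bshiftEquiv (cvM d L mv kk hL) (L ^ r * L ^ kk))) ν x') - ((knitH d L mv kk (L ^ kk) hL q)) (((bshiftEquiv (cvM d L mv kk hL) (L ^ kk))) ν (((kingPrV L kk r (cvM d L mv kk hL))) x'))| ≤ (((π * (d + 1) / (((L ^ kk : ℕ) : ℝ) * W)) + π / W / ((L ^ r * L ^ kk : ℕ) : ℝ) + π / W / ((L ^ kk : ℕ) : ℝ))) := (fun k x' => abs_coverH_shift_fine_sub_le hM hw k ν x')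
  have T_hKN' : ∀ q : (Fin (d + 1) → ZMod (2 * L)), HasMaj (BlockNorm.ofBlocks ((unitTorusGeo L kk (cvM d L mv kk hL))) (liftBlk (((cvBlk d L mv kk hL)) ∘ ((kingPrV L kk r (cvM d L mv kk hL)))) ι)) (BlockNorm.ofBlocks ((unitTorusGeo L kk (cvM d L mv kk hL))) (liftBlk (((cvBlk d L mv kk hL)) ∘ ((kingPrV L kk r (cvM d L mv kk hL)))) ι)) (commOp (cvNL' d L mv kk r hL a ι) (fun p : (CvX' d L mv kk r hL) × ι => ((knitH d L mv kk (L ^ r * L ^ kk) hL q)) p.1)) (fun y y' => (cNn * W⁻¹) * Real.exp (-((δm - δm / 2) * ((unitTorusGeo L kk (cvM d L mv kk hL))).dist y y'))) := (fun k => (hasMaj_src_tgt_congr (liftBlk_blkCover_comp_kingPrV ι).symm (hasMaj_commOp_nonlocal_cover_lift (δN := δm) ι hM hw hC₁.le hδm0.le hδmδ₁ (half_pos hδm0) hNL' k)).mono fun y y' => le_of_eq (by simp only [hcNndef, hπDdef, hE'def, hWdef, hcN₀def]; ring)); have T_hflat : ∀ q : (Fin (d + 1) → ZMod (2 * L)),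 (mulOp (fun p : (CvX d L mv kk hL) × ι => (cvBump d L mv kk hL q) p.1) ∘ₗ (mulOp (fun p : CvX d L mv kk hL × ι => cvPsi d L mv kk hL q p.1) ∘ₗ cvCube d L mv kk hL a ι q)) ∘ₗ (lapOp η⁻¹ (fun μ => liftEquiv (((bshiftEquiv (cvM d L mv kk hL) (L ^ kk))) μ) ι) 0 + (cvNL d L mv kk hL a ι)) ∘ₗ mulOp (fun p : (CvX d L mv kk hL) × ι => ((knitH d L mv kk (L ^ kk) hL q)) p.1) = mulOp (fun p : (CvX d L mv kk hL) × ι => ((knitH d L mv kk (L ^ kk) hL q)) p.1) + ((-tensorId ι (mulOp (bcube (2 * L) (coverXi (cvM d L mv kk hL) (L ^ kk) (L ^ mv)) 2 q) ∘ₗ (mulOp (chiCube (cvM d L mv kk hL) (L ^ kk) (coverCorner (cvM d L mv kk hL) (L ^ mv) L (coverMargin L mv) q) (L * L ^ mv)) ∘ₗ symOp (cvM d L mv kk hL) (L ^ kk) (coverCorner (cvM d L mv kk hL) (L ^ mv) L (coverMargin L mv) q) ∘ₗ (gOp (cvM d L mv kk hL) (L ^ kk) a ∘ₗ (mulOp (1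 - (chiCube (cvM d L mv kk hL) (L ^ kk) (coverCorner (cvM d L mv kk hL) (L ^ mv) L (coverMargin L mv) q) (L * L ^ mv))) ∘ₗ (a • (qvAdjRe (cvM d L mv kk hL) (L ^ kk) ∘ₗ qvRe (cvM d L mv kk hL) (L ^ kk)) + (-landauRe (cvM d L mv kk hL) (L ^ kk))) ∘ₗ mulOp (hcube (2 * L) (coverXi (cvM d L mv kk hL) (L ^ kk) (L ^ mv)) q))) ∘ₗ mulOp (chiCube (cvM d L mv kk hL) (L ^ kk) (coverCorner (cvM d L mv kk hL) (L ^ mv) L (coverMargin L mv) q) (L * L ^ mv)))))) := (fun k => by rw [bump_comp_cutCube_cover_lift ι hM hw hm₁ hhi4 k]; exact adjTail_cover_lift_eq ι hM hw hm₁ hhi4 ha hηinv k)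
  have T_hflat' : ∀ q : (Fin (d + 1) → ZMod (2 * L)), (mulOp (fun p : (CvX' d L mv kk r hL) × ι => (cvBump' d L mv kk r hL q) p.1) ∘ₗ (mulOp (fun p : CvX' d L mv kk r hL × ι => cvPsi' d L mv kk r hL q p.1) ∘ₗ cvCube' d L mv kk r hL a ι q)) ∘ₗ (lapOp η'⁻¹ (fun μ => liftEquiv (((bshiftEquiv (cvM d L mv kk hL) (L ^ r * L ^ kk))) μ) ι) 0 + (cvNL' d L mv kk r hL a ι)) ∘ₗ mulOp (fun p : (CvX' d L mv kk r hL) × ι => ((knitH d L mv kk (L ^ r * L ^ kk) hL q)) p.1) = mulOp (fun p : (CvX' d L mv kk r hL) × ι => ((knitH d L mv kk (L ^ r * L ^ kk) hL q)) p.1) + ((-tensorId ι (mulOp (bcube (2 * L) (coverXi (cvM d L mv kk hL) (L ^ r * L ^ kk) (L ^ mv)) 2 q) ∘ₗ (mulOp (chiCube (cvM d L mv kk hL) (L ^ r * L ^ kk) (coverCorner (cvM d L mv kk hL) (L ^ mv) L (coverMargin L mv) q) (L * L ^ mv)) ∘ₗ symOp (cvM d L mv kk hL) (L ^ r * L ^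 kk) (coverCorner (cvM d L mv kk hL) (L ^ mv) L (coverMargin L mv) q) ∘ₗ (gOp (cvM d L mv kk hL) (L ^ r * L ^ kk) a ∘ₗ (mulOp (1 - (chiCube (cvM d L mv kk hL) (L ^ r * L ^ kk) (coverCorner (cvM d L mv kk hL) (L ^ mv) L (coverMargin L mv) q) (L * L ^ mv))) ∘ₗ (a • (qvAdjRe (cvM d L mv kk hL) (L ^ r * L ^ kk) ∘ₗ qvRe (cvM d L mv kk hL) (L ^ r * L ^ kk)) + (-landauRe (cvM d L mv kk hL) (L ^ r * L ^ kk))) ∘ₗ mulOp (hcube (2 * L) (coverXi (cvM d L mv kk hL) (L ^ r * L ^ kk) (L ^ mv)) q))) ∘ₗ mulOp (chiCube (cvM d L mv kk hL) (L ^ r * L ^ kk) (coverCorner (cvM d L mv kk hL) (L ^ mv) L (coverMargin L mv) q) (L * L ^ mv)))))) := (fun k => by rw [bump_comp_cutCube_cover_lift ι hM hw hm₁ hhi4 k]; exact adjTail_cover_lift_eq ι hM hw hm₁ hhi4 ha hη'inv k); have T_hFlχ : ∀ q : (Fin (d + 1) → ZMod (2 * L)), mulOp (fun p : (CvX d L mv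 kk hL) × ι => (cvChi d L mv kk hL q) p.1) ∘ₗ ((-tensorId ι (mulOp (bcube (2 * L) (coverXi (cvM d L mv kk hL) (L ^ kk) (L ^ mv)) 2 q) ∘ₗ (mulOp (chiCube (cvM d L mv kk hL) (L ^ kk) (coverCorner (cvM d L mv kk hL) (L ^ mv) L (coverMargin L mv) q) (L * L ^ mv)) ∘ₗ symOp (cvM d L mv kk hL) (L ^ kk) (coverCorner (cvM d L mv kk hL) (L ^ mv) L (coverMargin L mv) q) ∘ₗ (gOp (cvM d L mv kk hL) (L ^ kk) a ∘ₗ (mulOp (1 - (chiCube (cvM d L mv kk hL) (L ^ kk) (coverCorner (cvM d L mv kk hL) (L ^ mv) L (coverMargin L mv) q) (L * L ^ mv))) ∘ₗ (a • (qvAdjRe (cvM d L mv kk hL) (L ^ kk) ∘ₗ qvRe (cvM d L mv kk hL) (L ^ kk)) + (-landauRe (cvM d L mv kk hL) (L ^ kk))) ∘ₗ mulOp (hcube (2 * L) (coverXi (cvM d L mv kk hL) (L ^ kk) (L ^ mv)) q))) ∘ₗ mulOp (chiCube (cvM d L mv kk hL) (L ^ kk) (coverCorner (cvM d L mv kk hL)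 (L ^ mv) L (coverMargin L mv) q) (L * L ^ mv)))))) = ((-tensorId ι (mulOp (bcube (2 * L) (coverXi (cvM d L mv kk hL) (L ^ kk) (L ^ mv)) 2 q) ∘ₗ (mulOp (chiCube (cvM d L mv kk hL) (L ^ kk) (coverCorner (cvM d L mv kk hL) (L ^ mv) L (coverMargin L mv) q) (L * L ^ mv)) ∘ₗ symOp (cvM d L mv kk hL) (L ^ kk) (coverCorner (cvM d L mv kk hL) (L ^ mv) L (coverMargin L mv) q) ∘ₗ (gOp (cvM d L mv kk hL) (L ^ kk) a ∘ₗ (mulOp (1 - (chiCube (cvM d L mv kk hL) (L ^ kk) (coverCorner (cvM d L mv kk hL) (L ^ mv) L (coverMargin L mv) q) (L * L ^ mv))) ∘ₗ (a • (qvAdjRe (cvM d L mv kk hL) (L ^ kk) ∘ₗ qvRe (cvM d L mv kk hL) (L ^ kk)) + (-landauRe (cvM d L mv kk hL) (L ^ kk))) ∘ₗ mulOp (hcube (2 * L) (coverXi (cvM d L mv kk hL) (L ^ kk) (L ^ mv)) q))) ∘ₗ mulOp (chiCube (cvM d L mv kk hL) (L ^ kk) (coverCorner (cvM d L mv kk hL)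 (L ^ mv) L (coverMargin L mv) q) (L * L ^ mv)))))) := (fun k => by rw [LinearMap.comp_neg, mulOp_fst_comp_tensorId, ← LinearMap.comp_assoc, cut_bcube_cover 2 hM hw hlo hhi hS6 k])
  have T_hFlψ : ∀ q : (Fin (d + 1) → ZMod (2 * L)), ((-tensorId ι (mulOp (bcube (2 * L) (coverXi (cvM d L mv kk hL) (L ^ kk) (L ^ mv)) 2 q) ∘ₗ (mulOp (chiCube (cvM d L mv kk hL) (L ^ kk) (coverCorner (cvM d L mv kk hL) (L ^ mv) L (coverMargin L mv) q) (L * L ^ mv)) ∘ₗ symOp (cvM d L mv kk hL) (L ^ kk) (coverCorner (cvM d L mv kk hL) (L ^ mv) L (coverMargin L mv) q) ∘ₗ (gOp (cvM d L mv kk hL) (L ^ kk) a ∘ₗ (mulOp (1 - (chiCube (cvM d L mv kk hL) (L ^ kk) (coverCorner (cvM d L mv kk hL) (L ^ mv) L (coverMargin L mv) q) (L * L ^ mv))) ∘ₗ (a • (qvAdjRe (cvM d L mv kk hL) (L ^ kk) ∘ₗ qvRe (cvM d L mv kk hL) (L ^ kk)) + (-landauRe (cvM d L mv kk hL) (L ^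 kk))) ∘ₗ mulOp (hcube (2 * L) (coverXi (cvM d L mv kk hL) (L ^ kk) (L ^ mv)) q))) ∘ₗ mulOp (chiCube (cvM d L mv kk hL) (L ^ kk) (coverCorner (cvM d L mv kk hL) (L ^ mv) L (coverMargin L mv) q) (L * L ^ mv)))))) ∘ₗ mulOp (fun p : (CvX d L mv kk hL) × ι => (cvPsi d L mv kk hL q) p.1) = ((-tensorId ι (mulOp (bcube (2 * L) (coverXi (cvM d L mv kk hL) (L ^ kk) (L ^ mv)) 2 q) ∘ₗ (mulOp (chiCube (cvM d L mv kk hL) (L ^ kk) (coverCorner (cvM d L mv kk hL) (L ^ mv) L (coverMargin L mv) q) (L * L ^ mv)) ∘ₗ symOp (cvM d L mv kk hL) (L ^ kk) (coverCorner (cvM d L mv kk hL) (L ^ mv) L (coverMargin L mv) q) ∘ₗ (gOp (cvM d L mv kk hL) (L ^ kk) a ∘ₗ (mulOp (1 - (chiCube (cvM d L mv kk hL) (L ^ kk) (coverCorner (cvM d L mv kk hL) (L ^ mv) L (coverMargin L mv) q) (L * L ^ mv))) ∘ₗ (a • (qvAdjRe (cvM d L mv kk hL) (L ^ kk) ∘ₗ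 qvRe (cvM d L mv kk hL) (L ^ kk)) + (-landauRe (cvM d L mv kk hL) (L ^ kk))) ∘ₗ mulOp (hcube (2 * L) (coverXi (cvM d L mv kk hL) (L ^ kk) (L ^ mv)) q))) ∘ₗ mulOp (chiCube (cvM d L mv kk hL) (L ^ kk) (coverCorner (cvM d L mv kk hL) (L ^ mv) L (coverMargin L mv) q) (L * L ^ mv)))))) := (fun k => by rw [LinearMap.neg_comp, tensorId_comp_mulOp_fst_of ι (by rw [LinearMap.comp_assoc, LinearMap.comp_assoc, LinearMap.comp_assoc, LinearMap.comp_assoc, mulOp_chiCube_idem])])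
  have T_hFlχ' : ∀ q : (Fin (d + 1) → ZMod (2 * L)), mulOp (fun p : (CvX' d L mv kk r hL) × ι => (cvChi' d L mv kk r hL q) p.1) ∘ₗ ((-tensorId ι (mulOp (bcube (2 * L) (coverXi (cvM d L mv kk hL) (L ^ r * L ^ kk) (L ^ mv)) 2 q) ∘ₗ (mulOp (chiCube (cvM d L mv kk hL) (L ^ r * L ^ kk) (coverCorner (cvM d L mv kk hL) (L ^ mv) L (coverMargin L mv) q) (L * L ^ mv)) ∘ₗ symOp (cvM d L mv kk hL) (L ^ r * L ^ kk) (coverCorner (cvM d L mv kk hL) (L ^ mv) L (coverMargin L mv) q) ∘ₗ (gOp (cvM d L mv kk hL) (L ^ r * L ^ kk) a ∘ₗ (mulOp (1 - (chiCube (cvM d L mv kk hL) (L ^ r * L ^ kk) (coverCorner (cvM d L mv kk hL) (L ^ mv) L (coverMargin L mv) q) (L * L ^ mv))) ∘ₗ (a • (qvAdjRe (cvM d L mv kk hL) (L ^ r * L ^ kk) ∘ₗ qvRe (cvM d L mv kk hL) (L ^ r * L ^ kk)) + (-landauRe (cvM d L mv kk hL) (L ^ r * L ^ kk))) ∘ₗ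 mulOp (hcube (2 * L) (coverXi (cvM d L mv kk hL) (L ^ r * L ^ kk) (L ^ mv)) q))) ∘ₗ mulOp (chiCube (cvM d L mv kk hL) (L ^ r * L ^ kk) (coverCorner (cvM d L mv kk hL) (L ^ mv) L (coverMargin L mv) q) (L * L ^ mv)))))) = ((-tensorId ι (mulOp (bcube (2 * L) (coverXi (cvM d L mv kk hL) (L ^ r * L ^ kk) (L ^ mv)) 2 q) ∘ₗ (mulOp (chiCube (cvM d L mv kk hL) (L ^ r * L ^ kk) (coverCorner (cvM d L mv kk hL) (L ^ mv) L (coverMargin L mv) q) (L * L ^ mv)) ∘ₗ symOp (cvM d L mv kk hL) (L ^ r * L ^ kk) (coverCorner (cvM d L mv kk hL) (L ^ mv) L (coverMargin L mv) q) ∘ₗ (gOp (cvM d L mv kk hL) (L ^ r * L ^ kk) a ∘ₗ (mulOp (1 - (chiCube (cvM d L mv kk hL) (L ^ r * L ^ kk) (coverCorner (cvM d L mv kk hL) (L ^ mv) L (coverMargin L mv) q) (L * L ^ mv))) ∘ₗ (a • (qvAdjRe (cvM d L mv kk hL) (L ^ r * L ^ kk) ∘ₗ qvRe (cvM d L mv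 kk hL) (L ^ r * L ^ kk)) + (-landauRe (cvM d L mv kk hL) (L ^ r * L ^ kk))) ∘ₗ mulOp (hcube (2 * L) (coverXi (cvM d L mv kk hL) (L ^ r * L ^ kk) (L ^ mv)) q))) ∘ₗ mulOp (chiCube (cvM d L mv kk hL) (L ^ r * L ^ kk) (coverCorner (cvM d L mv kk hL) (L ^ mv) L (coverMargin L mv) q) (L * L ^ mv)))))) := (fun k => by rw [LinearMap.comp_neg, mulOp_fst_comp_tensorId, ← LinearMap.comp_assoc, cut_bcube_cover 2 hM hw hlo hhi hS6 k])
  have T_hFlψ' : ∀ q : (Fin (d + 1) → ZMod (2 * L)), ((-tensorId ι (mulOp (bcube (2 * L) (coverXi (cvM d L mv kk hL) (L ^ r * L ^ kk) (L ^ mv)) 2 q) ∘ₗ (mulOp (chiCube (cvM d L mv kk hL) (L ^ r * L ^ kk) (coverCorner (cvM d L mv kk hL) (L ^ mv) L (coverMargin L mv) q) (L * L ^ mv)) ∘ₗ symOp (cvM d L mv kk hL) (L ^ r * L ^ kk) (coverCorner (cvM d L mv kk hL) (L ^ mv) L (coverMargin L mv) q) ∘ₗ (gOp (cvM d L mv kk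 hL) (L ^ r * L ^ kk) a ∘ₗ (mulOp (1 - (chiCube (cvM d L mv kk hL) (L ^ r * L ^ kk) (coverCorner (cvM d L mv kk hL) (L ^ mv) L (coverMargin L mv) q) (L * L ^ mv))) ∘ₗ (a • (qvAdjRe (cvM d L mv kk hL) (L ^ r * L ^ kk) ∘ₗ qvRe (cvM d L mv kk hL) (L ^ r * L ^ kk)) + (-landauRe (cvM d L mv kk hL) (L ^ r * L ^ kk))) ∘ₗ mulOp (hcube (2 * L) (coverXi (cvM d L mv kk hL) (L ^ r * L ^ kk) (L ^ mv)) q))) ∘ₗ mulOp (chiCube (cvM d L mv kk hL) (L ^ r * L ^ kk) (coverCorner (cvM d L mv kk hL) (L ^ mv) L (coverMargin L mv) q) (L * L ^ mv)))))) ∘ₗ mulOp (fun p : (CvX' d L mv kk r hL) × ι => (cvPsi' d L mv kk r hL q) p.1) = ((-tensorId ι (mulOp (bcube (2 * L) (coverXi (cvM d L mv kk hL) (L ^ r * L ^ kk) (L ^ mv)) 2 q) ∘ₗ (mulOp (chiCube (cvM d L mv kk hL) (L ^ r * L ^ kk) (coverCorner (cvM d L mv kk hL) (L ^ mv) L (coverMargin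 L mv) q) (L * L ^ mv)) ∘ₗ symOp (cvM d L mv kk hL) (L ^ r * L ^ kk) (coverCorner (cvM d L mv kk hL) (L ^ mv) L (coverMargin L mv) q) ∘ₗ (gOp (cvM d L mv kk hL) (L ^ r * L ^ kk) a ∘ₗ (mulOp (1 - (chiCube (cvM d L mv kk hL) (L ^ r * L ^ kk) (coverCorner (cvM d L mv kk hL) (L ^ mv) L (coverMargin L mv) q) (L * L ^ mv))) ∘ₗ (a • (qvAdjRe (cvM d L mv kk hL) (L ^ r * L ^ kk) ∘ₗ qvRe (cvM d L mv kk hL) (L ^ r * L ^ kk)) + (-landauRe (cvM d L mv kk hL) (L ^ r * L ^ kk))) ∘ₗ mulOp (hcube (2 * L) (coverXi (cvM d L mv kk hL) (L ^ r * L ^ kk) (L ^ mv)) q))) ∘ₗ mulOp (chiCube (cvM d L mv kk hL) (L ^ r * L ^ kk) (coverCorner (cvM d L mv kk hL) (L ^ mv) L (coverMargin L mv) q) (L * L ^ mv)))))) := (fun k => by rw [LinearMap.neg_comp, tensorId_comp_mulOp_fst_of ι (by rw [LinearMap.comp_assoc, LinearMap.comp_assoc, LinearMap.comp_assoc, LinearMap.comp_assoc,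 mulOp_chiCube_idem])])
  have T_hFl : ∀ q : (Fin (d + 1) → ZMod (2 * L)), HasMaj (BlockNorm.ofBlocks ((unitTorusGeo L kk (cvM d L mv kk hL))) (liftBlk ((cvBlk d L mv kk hL)) ι)) (BlockNorm.ofBlocks ((unitTorusGeo L kk (cvM d L mv kk hL))) (liftBlk ((cvBlk d L mv kk hL)) ι)) ((-tensorId ι (mulOp (bcube (2 * L) (coverXi (cvM d L mv kk hL) (L ^ kk) (L ^ mv)) 2 q) ∘ₗ (mulOp (chiCube (cvM d L mv kk hL) (L ^ kk) (coverCorner (cvM d L mv kk hL) (L ^ mv) L (coverMargin L mv) q) (L * L ^ mv)) ∘ₗ symOp (cvM d L mv kk hL) (L ^ kk) (coverCorner (cvM d L mv kk hL) (L ^ mv) L (coverMargin L mv) q) ∘ₗ (gOp (cvM d L mv kk hL) (L ^ kk) a ∘ₗ (mulOp (1 - (chiCube (cvM d L mv kk hL) (L ^ kk) (coverCorner (cvM d L mv kk hL) (L ^ mv) L (coverMargin L mv) q) (L * L ^ mv))) ∘ₗ (a • (qvAdjRe (cvM d L mv kk hL) (L ^ kk) ∘ₗ qvRe (cvM d L mv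 kk hL) (L ^ kk)) + (-landauRe (cvM d L mv kk hL) (L ^ kk))) ∘ₗ mulOp (hcube (2 * L) (coverXi (cvM d L mv kk hL) (L ^ kk) (L ^ mv)) q))) ∘ₗ mulOp (chiCube (cvM d L mv kk hL) (L ^ kk) (coverCorner (cvM d L mv kk hL) (L ^ mv) L (coverMargin L mv) q) (L * L ^ mv)))))) (fun y y' => (κF * W⁻¹) * Real.exp (-((δm / 2) * ((unitTorusGeo L kk (cvM d L mv kk hL))).dist y y'))) := (fun k => (((hasMaj_adjTail_cover_lift (L := L) (kk := kk) ι hM hw hfit0 (δN := δm) (ρ₁ := 3 * δm / 4) (ρ := δm / 2) htri hrow hC.le hC₁.le hδm0.le hδmδ₁ (by linarith only [hδm0]) (div_nonneg hδm0.le zero_le_two) (by linarith only [hδm0]) (by linarith only [hδmδ₀, hδm0]) hG hNL k).mono fun y y' => (loc₂_le_plain hF0 y y').trans (mul_le_mul_of_nonneg_right hεF (Real.exp_nonneg _)))).neg); have T_hFl' : ∀ q : (Fin (d + 1) → ZMod (2 * L)), HasMaj (BlockNorm.ofBlocks ((unitTorusGeo L kk (cvM d L mv kk hL))) (liftBlk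 (((cvBlk d L mv kk hL)) ∘ ((kingPrV L kk r (cvM d L mv kk hL)))) ι)) (BlockNorm.ofBlocks ((unitTorusGeo L kk (cvM d L mv kk hL))) (liftBlk (((cvBlk d L mv kk hL)) ∘ ((kingPrV L kk r (cvM d L mv kk hL)))) ι)) ((-tensorId ι (mulOp (bcube (2 * L) (coverXi (cvM d L mv kk hL) (L ^ r * L ^ kk) (L ^ mv)) 2 q) ∘ₗ (mulOp (chiCube (cvM d L mv kk hL) (L ^ r * L ^ kk) (coverCorner (cvM d L mv kk hL) (L ^ mv) L (coverMargin L mv) q) (L * L ^ mv)) ∘ₗ symOp (cvM d L mv kk hL) (L ^ r * L ^ kk) (coverCorner (cvM d L mv kk hL) (L ^ mv) L (coverMargin L mv) q) ∘ₗ (gOp (cvM d L mv kk hL) (L ^ r * L ^ kk) a ∘ₗ (mulOp (1 - (chiCube (cvM d L mv kk hL) (L ^ r * L ^ kk) (coverCorner (cvM d L mv kk hL) (L ^ mv) L (coverMargin L mv) q) (L * L ^ mv))) ∘ₗ (a • (qvAdjRe (cvM d L mv kk hL) (L ^ r * L ^ kk) ∘ₗ qvRe (cvM d L mv kk hL) (L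 ^ r * L ^ kk)) + (-landauRe (cvM d L mv kk hL) (L ^ r * L ^ kk))) ∘ₗ mulOp (hcube (2 * L) (coverXi (cvM d L mv kk hL) (L ^ r * L ^ kk) (L ^ mv)) q))) ∘ₗ mulOp (chiCube (cvM d L mv kk hL) (L ^ r * L ^ kk) (coverCorner (cvM d L mv kk hL) (L ^ mv) L (coverMargin L mv) q) (L * L ^ mv)))))) (fun y y' => (κF * W⁻¹) * Real.exp (-((δm / 2) * ((unitTorusGeo L kk (cvM d L mv kk hL))).dist y y'))) := (fun k => (hasMaj_src_tgt_congr (liftBlk_blkCover_comp_kingPrV ι).symm ((hasMaj_adjTail_cover_lift (L := L) (kk := kk) ι hM hw hfit0 (δN := δm) (ρ₁ := 3 * δm / 4) (ρ := δm / 2) htri hrow hC.le hC₁.le hδm0.le hδmδ₁ (by linarith only [hδm0]) (div_nonneg hδm0.le zero_le_two) (by linarith only [hδm0]) (by linarith only [hδmδ₀, hδm0]) hG' hNL' k).mono fun y y' => (loc₂_le_plain hF0 y y').trans (mul_le_mul_of_nonneg_right hεF (Real.exp_nonneg _)))).neg)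
  have T_hDFl : ∀ q : (Fin (d + 1) → ZMod (2 * L)), HasMaj (BlockNorm.ofBlocks ((unitTorusGeo L kk (cvM d L mv kk hL))) (liftBlk ((cvBlk d L mv kk hL)) ι)) (BlockNorm.ofBlocks ((unitTorusGeo L kk (cvM d L mv kk hL))) (liftBlk (((cvBlk d L mv kk hL)) ∘ ((kingPrV L kk r (cvM d L mv kk hL)))) ι)) (idef (pull (liftMap ((kingPrV L kk r (cvM d L mv kk hL))) ι)) (pull (liftMap ((kingPrV L kk r (cvM d L mv kk hL))) ι)) ((-tensorId ι (mulOp (bcube (2 * L) (coverXi (cvM d L mv kk hL) (L ^ r * L ^ kk) (L ^ mv)) 2 q) ∘ₗ (mulOp (chiCube (cvM d L mv kk hL) (L ^ r * L ^ kk) (coverCorner (cvM d L mv kk hL) (L ^ mv) L (coverMargin L mv) q) (L * L ^ mv)) ∘ₗ symOp (cvM d L mv kk hL) (L ^ r * L ^ kk) (coverCorner (cvM d L mv kk hL) (L ^ mv) L (coverMargin L mv) q) ∘ₗ (gOp (cvM d L mv kk hL) (L ^ r * L ^ kk) a ∘ₗ (mulOp (1 - (chiCube (cvM d L mv kk hL)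 (L ^ r * L ^ kk) (coverCorner (cvM d L mv kk hL) (L ^ mv) L (coverMargin L mv) q) (L * L ^ mv))) ∘ₗ (a • (qvAdjRe (cvM d L mv kk hL) (L ^ r * L ^ kk) ∘ₗ qvRe (cvM d L mv kk hL) (L ^ r * L ^ kk)) + (-landauRe (cvM d L mv kk hL) (L ^ r * L ^ kk))) ∘ₗ mulOp (hcube (2 * L) (coverXi (cvM d L mv kk hL) (L ^ r * L ^ kk) (L ^ mv)) q))) ∘ₗ mulOp (chiCube (cvM d L mv kk hL) (L ^ r * L ^ kk) (coverCorner (cvM d L mv kk hL) (L ^ mv) L (coverMargin L mv) q) (L * L ^ mv)))))) ((-tensorId ι (mulOp (bcube (2 * L) (coverXi (cvM d L mv kk hL) (L ^ kk) (L ^ mv)) 2 q) ∘ₗ (mulOp (chiCube (cvM d L mv kk hL) (L ^ kk) (coverCorner (cvM d L mv kk hL) (L ^ mv) L (coverMargin L mv) q) (L * L ^ mv)) ∘ₗ symOp (cvM d L mv kk hL) (L ^ kk) (coverCorner (cvM d L mv kk hL) (L ^ mv) L (coverMargin L mv) q) ∘ₗ (gOp (cvM d L mv kk hL) (L ^ kk)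 a ∘ₗ (mulOp (1 - (chiCube (cvM d L mv kk hL) (L ^ kk) (coverCorner (cvM d L mv kk hL) (L ^ mv) L (coverMargin L mv) q) (L * L ^ mv))) ∘ₗ (a • (qvAdjRe (cvM d L mv kk hL) (L ^ kk) ∘ₗ qvRe (cvM d L mv kk hL) (L ^ kk)) + (-landauRe (cvM d L mv kk hL) (L ^ kk))) ∘ₗ mulOp (hcube (2 * L) (coverXi (cvM d L mv kk hL) (L ^ kk) (L ^ mv)) q))) ∘ₗ mulOp (chiCube (cvM d L mv kk hL) (L ^ kk) (coverCorner (cvM d L mv kk hL) (L ^ mv) L (coverMargin L mv) q) (L * L ^ mv))))))) (fun y y' => (((2 ^ (d + 1) * Real.exp (δm / 2) * ((1 * C * (((|a| * (Real.exp δm * Real.exp δm) + C₁) * (π * (d + 1) / (((L ^ kk : ℕ) : ℝ) * W)) + rr * εk + 0 * (|a| * (Real.exp δm * Real.exp δm) + C₁)) * Real.exp (-((δm - 3 * δm / 4) * (((coverMargin L mv : ℕ) : ℝ) + 1)))) * cr + 1 * (Dp * εk) * ((|a| * (Real.exp δm * Real.exp δm) + C₁) * Real.exp (-((δm - 3 *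 δm / 4) * (((coverMargin L mv : ℕ) : ℝ) + 1)))) * cr) + (d + 1) * (1 * (|(((L ^ kk : ℕ) : ℝ))⁻¹| * C) * ((|a| * (Real.exp δm * Real.exp δm) + C₁) * Real.exp (-((δm - 3 * δm / 4) * (((coverMargin L mv : ℕ) : ℝ) + 1)))) * cr)) + (π * (d + 1) / (((L ^ kk : ℕ) : ℝ) * W)) * (2 ^ (d + 1) * ((1 : ℝ) * C * ((|a| * (Real.exp δm * Real.exp δm) + C₁) * Real.exp (-((δm - 3 * δm / 4) * (((coverMargin L mv : ℕ) : ℝ) + 1)))) * cr * Real.exp (δm / 2)))))) * Real.exp (-((δm / 2) * ((unitTorusGeo L kk (cvM d L mv kk hL))).dist y y'))) := (fun k => by rw [idef_neg]; exact ((hasMaj_tgt_congr (liftBlk_blkCover_comp_kingPrV ι).symm (hasMaj_idef_adjTail_cover_lift (L := L) (kk := kk) (r := r) ι hM hw hfit0 (δN := δm) (ρ₁ := 3 * δm / 4) (ρ := δm / 2) htri hrow hC.le (mul_nonneg hDp.le hεk0) hC.le hC₁.le hδm0.le hδmδ₁ (mul_nonneg hrr.le hεk0) (by linarith only [hδm0])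 (div_nonneg hδm0.le zero_le_two) (by linarith only [hδm0]) (by linarith only [hδmδ₀, hδm0]) hGm hGm' h0m hDm hNL hNL' hDNsc0 k)).mono (loc₂_le_plain hK1710)).neg)
  -- THE INSTANTIATION of n15-c∕174b
  have key := hasMaj_idef_rightInverse_bgrad_smoothCutDressed_of_flat_cut (X := CvX d L mv kk hL) (X' := CvX' d L mv kk r hL) (ι := ι) (J := Fin (d + 1)) (K := Fin (d + 1) → ZMod (2 * L)) (g := (unitTorusGeo L kk (cvM d L mv kk hL))) (cvBlk d L mv kk hL) (kingPrV L kk r (cvM d L mv kk hL)) (bshiftEquiv (cvM d L mv kk hL) (L ^ kk)) (bshiftEquiv (cvM d L mv kk hL) (L ^ r * L ^ kk)) η⁻¹ η'⁻¹ ν (σ := δm / 32) (cr := cr)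
    (N := fun k => mulOp (fun p : CvX d L mv kk hL × ι => cvPsi d L mv kk hL k p.1) ∘ₗ cvCube d L mv kk hL a ι k) (N' := fun k => mulOp (fun p : CvX' d L mv kk r hL × ι => cvPsi' d L mv kk r hL k p.1) ∘ₗ cvCube' d L mv kk r hL a ι k) (C := fun _ => (tCoefC ((((L ^ kk : ℕ) : ℝ))⁻¹) (gaugePair (bshiftEquiv (cvM d L mv kk hL) (L ^ kk)) fun μ x => coordMat e (ContinuousLinearMap.mulLeftRight ℝ (Matrix mm mm ℂ) ((1 : Matrix mm mm ℂ) * U μ x * (1 : Matrix mm mm ℂ)ᴴ) ((1 : Matrix mm mm ℂ) * U μ x * (1 : Matrix mm mm ℂ)ᴴ)ᴴ)))) (C' := fun _ => (tCoefC ((((L ^ r * L ^ kk : ℕ) : ℝ))⁻¹) (gaugePair (bshiftEquiv (cvM d L mv kk hL) (L ^ r * L ^ kk)) fun μ x => coordMat e (ContinuousLinearMap.mulLeftRight ℝ (Matrix mm mm ℂ) ((1 : Matrix mm mm ℂ) * U' μ x * (1 : Matrix mm mm ℂ)ᴴ) ((1 : Matrix mm mm ℂ) * U' μ x * (1 : Matrix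 mm mm ℂ)ᴴ)ᴴ)))) (A := fun _ => (tCoefA ((((L ^ kk : ℕ) : ℝ))⁻¹) (gaugePair (bshiftEquiv (cvM d L mv kk hL) (L ^ kk)) fun μ x => coordMat e (ContinuousLinearMap.mulLeftRight ℝ (Matrix mm mm ℂ) ((1 : Matrix mm mm ℂ) * U μ x * (1 : Matrix mm mm ℂ)ᴴ) ((1 : Matrix mm mm ℂ) * U μ x * (1 : Matrix mm mm ℂ)ᴴ)ᴴ)))) (A' := fun _ => (tCoefA ((((L ^ r * L ^ kk : ℕ) : ℝ))⁻¹) (gaugePair (bshiftEquiv (cvM d L mv kk hL) (L ^ r * L ^ kk)) fun μ x => coordMat e (ContinuousLinearMap.mulLeftRight ℝ (Matrix mm mm ℂ) ((1 : Matrix mm mm ℂ) * U' μ x * (1 : Matrix mm mm ℂ)ᴴ) ((1 : Matrix mm mm ℂ) * U' μ x * (1 : Matrix mm mm ℂ)ᴴ)ᴴ)))) (NV := fun _ => (0 : (CvX d L mv kk hL × ι → ℝ) →ₗ[ℝ] (CvX d L mv kk hL × ι → ℝ))) (NV' := fun _ => (0 : (CvX' d L mv kk r hL × ι → ℝ) →ₗ[ℝ]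 (CvX' d L mv kk r hL × ι → ℝ))) (Δ := (covLapM (bshiftEquiv (cvM d L mv kk hL) (L ^ kk)) ((((L ^ kk : ℕ) : ℝ))⁻¹) (gaugePair (bshiftEquiv (cvM d L mv kk hL) (L ^ kk)) (fun μ x => coordMat e (ContinuousLinearMap.mulLeftRight ℝ (Matrix mm mm ℂ) (U μ x) (U μ x)ᴴ))) + cvNL d L mv kk hL a ι)) (NL := cvNL d L mv kk hL a ι) (Yop := (cvGlued d L mv kk hL a ((((L ^ kk : ℕ) : ℝ))⁻¹) ι e (fun _ _ => (1 : Matrix mm mm ℂ)) U (cvNL d L mv kk hL a ι) (fun _ => 0))) (Δ' := (covLapM (bshiftEquiv (cvM d L mv kk hL) (L ^ r * L ^ kk)) ((((L ^ r * L ^ kk : ℕ) : ℝ))⁻¹) (gaugePair (bshiftEquiv (cvM d L mv kk hL) (L ^ r * L ^ kk)) (fun μ x => coordMat e (ContinuousLinearMap.mulLeftRight ℝ (Matrix mm mm ℂ) (U' μ x) (U' μ x)ᴴ))) + cvNL' d L mv kk r hL a ι)) (NL' := cvNL' d L mv kk r hL a ι) (Yop' := (cvGlued' d L mv kk r hL a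 ((((L ^ r * L ^ kk : ℕ) : ℝ))⁻¹) ι e (fun _ _ => (1 : Matrix mm mm ℂ)) U' (cvNL' d L mv kk r hL a ι) (fun _ => 0)))
    (Fl := fun k => (-tensorId ι (mulOp (bcube (2 * L) (coverXi (cvM d L mv kk hL) (L ^ kk) (L ^ mv)) 2 k) ∘ₗ (mulOp (chiCube (cvM d L mv kk hL) (L ^ kk) (coverCorner (cvM d L mv kk hL) (L ^ mv) L (coverMargin L mv) k) (L * L ^ mv)) ∘ₗ symOp (cvM d L mv kk hL) (L ^ kk) (coverCorner (cvM d L mv kk hL) (L ^ mv) L (coverMargin L mv) k) ∘ₗ (gOp (cvM d L mv kk hL) (L ^ kk) a ∘ₗ (mulOp (1 - (chiCube (cvM d L mv kk hL) (L ^ kk) (coverCorner (cvM d L mv kk hL) (L ^ mv) L (coverMargin L mv) k) (L * L ^ mv))) ∘ₗ (a • (qvAdjRe (cvM d L mv kk hL) (L ^ kk) ∘ₗ qvRe (cvM d L mv kk hL) (L ^ kk)) + (-landauRe (cvM d L mv kk hL) (L ^ kk))) ∘ₗ mulOp (hcube (2 * L) (coverXi (cvM d L mv kk hL) (L ^ kk)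 (L ^ mv)) k))) ∘ₗ mulOp (chiCube (cvM d L mv kk hL) (L ^ kk) (coverCorner (cvM d L mv kk hL) (L ^ mv) L (coverMargin L mv) k) (L * L ^ mv)))))) (Fl' := fun k => (-tensorId ι (mulOp (bcube (2 * L) (coverXi (cvM d L mv kk hL) (L ^ r * L ^ kk) (L ^ mv)) 2 k) ∘ₗ (mulOp (chiCube (cvM d L mv kk hL) (L ^ r * L ^ kk) (coverCorner (cvM d L mv kk hL) (L ^ mv) L (coverMargin L mv) k) (L * L ^ mv)) ∘ₗ symOp (cvM d L mv kk hL) (L ^ r * L ^ kk) (coverCorner (cvM d L mv kk hL) (L ^ mv) L (coverMargin L mv) k) ∘ₗ (gOp (cvM d L mv kk hL) (L ^ r * L ^ kk) a ∘ₗ (mulOp (1 - (chiCube (cvM d L mv kk hL) (L ^ r * L ^ kk) (coverCorner (cvM d L mv kk hL) (L ^ mv) L (coverMargin L mv) k) (L * L ^ mv))) ∘ₗ (a • (qvAdjRe (cvM d L mv kk hL) (L ^ r * L ^ kk) ∘ₗ qvRe (cvM d L mv kk hL) (L ^ r * L ^ kk)) + (-landauRe (cvM d L mv kk hL) (L ^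 r * L ^ kk))) ∘ₗ mulOp (hcube (2 * L) (coverXi (cvM d L mv kk hL) (L ^ r * L ^ kk) (L ^ mv)) k))) ∘ₗ mulOp (chiCube (cvM d L mv kk hL) (L ^ r * L ^ kk) (coverCorner (cvM d L mv kk hL) (L ^ mv) L (coverMargin L mv) k) (L * L ^ mv)))))) (χX := fun k => cvChi d L mv kk hL k) (χtX := fun k => cvBump d L mv kk hL k) (ψX := fun k => cvPsi d L mv kk hL k) (ψ₂X := fun k => cvPsi d L mv kk hL k) (hX := fun k => (knitH d L mv kk (L ^ kk) hL k)) (χX' := fun k => cvChi' d L mv kk r hL k) (χtX' := fun k => cvBump' d L mv kk r hL k) (ψX' := fun k => cvPsi' d L mv kk r hL k) (ψ₂X' := fun k => cvPsi' d L mv kk r hL k) (hX' := fun k => (knitH d L mv kk (L ^ r * L ^ kk) hL k)) (Sk := fun k => cvSk d L mv kk hL k) (hb := fun k => coverHb (cvM d L mv kk hL) (L ^ kk) (L ^ mv) L k)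
    (Tf := fun k μ => tensorId ι (mulOp (chiCube (cvM d L mv kk hL) (L ^ kk) (coverCorner (cvM d L mv kk hL) (L ^ mv) L (coverMargin L mv) k) (L * L ^ mv)) ∘ₗ symOp (cvM d L mv kk hL) (L ^ kk) (coverCorner (cvM d L mv kk hL) (L ^ mv) L (coverMargin L mv) k) ∘ₗ (gOp (cvM d L mv kk hL) (L ^ kk) a ∘ₗ symbOp (cvM d L mv kk hL) (L ^ kk) (sD (cvM d L mv kk hL) (L ^ kk) μ (((L ^ kk) : ℕ) : ℝ))) ∘ₗ mulOp (chiCube (cvM d L mv kk hL) (L ^ kk) (coverCorner (cvM d L mv kk hL) (L ^ mv) L (coverMargin L mv) k) (L * L ^ mv)))) (Tb := fun k μ => tensorId ι (-(mulOp (chiCube (cvM d L mv kk hL) (L ^ kk) (coverCorner (cvM d L mv kk hL) (L ^ mv) L (coverMargin L mv) k) (L * L ^ mv)) ∘ₗ symOp (cvM d L mv kk hL) (L ^ kk) (coverCorner (cvM d L mv kk hL) (L ^ mv) L (coverMargin L mv) k) ∘ₗ (gOp (cvM d L mv kk hL) (L ^ kk) a ∘ₗ symbOp (cvM d L mv kk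 hL) (L ^ kk) ((((L ^ kk) : ℕ) : ℝ) • (sTinv (cvM d L mv kk hL) (L ^ kk) μ - 1))) ∘ₗ mulOp (chiCube (cvM d L mv kk hL) (L ^ kk) (coverCorner (cvM d L mv kk hL) (L ^ mv) L (coverMargin L mv) k) (L * L ^ mv))))) (Tf' := fun k μ => tensorId ι (mulOp (chiCube (cvM d L mv kk hL) (L ^ r * L ^ kk) (coverCorner (cvM d L mv kk hL) (L ^ mv) L (coverMargin L mv) k) (L * L ^ mv)) ∘ₗ symOp (cvM d L mv kk hL) (L ^ r * L ^ kk) (coverCorner (cvM d L mv kk hL) (L ^ mv) L (coverMargin L mv) k) ∘ₗ (gOp (cvM d L mv kk hL) (L ^ r * L ^ kk) a ∘ₗ symbOp (cvM d L mv kk hL) (L ^ r * L ^ kk) (sD (cvM d L mv kk hL) (L ^ r * L ^ kk) μ (((L ^ r * L ^ kk) : ℕ) : ℝ))) ∘ₗ mulOp (chiCube (cvM d L mv kk hL) (L ^ r * L ^ kk) (coverCorner (cvM d L mv kk hL) (L ^ mv) L (coverMargin L mv) k) (L * L ^ mv)))) (Tb' := fun k μ => tensorId ι (-(mulOp (chiCube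 (cvM d L mv kk hL) (L ^ r * L ^ kk) (coverCorner (cvM d L mv kk hL) (L ^ mv) L (coverMargin L mv) k) (L * L ^ mv)) ∘ₗ symOp (cvM d L mv kk hL) (L ^ r * L ^ kk) (coverCorner (cvM d L mv kk hL) (L ^ mv) L (coverMargin L mv) k) ∘ₗ (gOp (cvM d L mv kk hL) (L ^ r * L ^ kk) a ∘ₗ symbOp (cvM d L mv kk hL) (L ^ r * L ^ kk) ((((L ^ r * L ^ kk) : ℕ) : ℝ) • (sTinv (cvM d L mv kk hL) (L ^ r * L ^ kk) μ - 1))) ∘ₗ mulOp (chiCube (cvM d L mv kk hL) (L ^ r * L ^ kk) (coverCorner (cvM d L mv kk hL) (L ^ mv) L (coverMargin L mv) k) (L * L ^ mv))))) (ρ₁ := δm / 2) (ρ₂ := δm / 4) (ρ₃ := δm / 8) (ρN := δm - δm / 2) (δV := δm) (δN := δm) (ε := δm / 2) (R := Rsp) (c₀ := π * W⁻¹) (c₁ := π * W⁻¹) (c₂ := 32 * π ^ 2 * W⁻¹) (cN := cNn * W⁻¹) (rA := R₀) (RN := 0) (rV := 0) (ℓ := πD * W⁻¹) (ω := πD * W⁻¹)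 (β := β) (β₁ := β₁) (ct := π) (δ := δm) (βQ := βQ) (θA := θA) (θF := 0) (rFK := 0) (oχc := 0) (εF := (1 - θA * cr)⁻¹ * (κF * W⁻¹) * cr) (εFl := κF * W⁻¹) (rC := R₀) (r₁ := R₀) (Nov := Nov) (oAt := rS * θ) (oC := rS * θ) (og := rS * θ) (oV := rS * θ * cJJ) (o := (π * (d + 1) / (((L ^ kk : ℕ) : ℝ) * W))) (oχ := (π * (d + 1) / (((L ^ kk : ℕ) : ℝ) * W))) (os := ((π * (d + 1) / (((L ^ kk : ℕ) : ℝ) * W)) + π / W / ((L ^ r * L ^ kk : ℕ) : ℝ) + π / W / ((L ^ kk : ℕ) : ℝ))) (o₀ := (π / W / ((L ^ r * L ^ kk : ℕ) : ℝ) + π / W / ((L ^ kk : ℕ) : ℝ))) (mQ := (mf + mb) * εk8) (mT := ((1 * ((mf + mb) * εk8) + 0 * βQ))) (m₀ := mc * εk) (mN := mc * εk) (m₁ := max me mh * εk)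
    (o₁ := (|W⁻¹| * (((L ^ kk : ℕ) : ℝ) * W)⁻¹ * (64 * π ^ 2 + π ^ 2 * Fintype.card (Fin (d + 1))))) (o₂ := (W⁻¹ ^ 2 * (((L ^ kk : ℕ) : ℝ) * W)⁻¹ * (144 * π ^ 3 + 32 * π ^ 3 * Fintype.card (Fin (d + 1))))) (oχ₁ := 2 * (π * (d + 1) / (((L ^ kk : ℕ) : ℝ) * W))) (oχ₂ := ((W)⁻¹ * (((L ^ kk : ℕ) : ℝ) * W)⁻¹ * (32 * π ^ 4 + π ^ 2 * (d + 1)))) (rN := ((π * (d + 1) / W * (Real.exp 1 * (δm / 2))⁻¹ + 2 * (π * (d + 1) / W)) * (rr * εk) + 2 * (π * (d + 1) / (((L ^ kk : ℕ) : ℝ) * W)) * cN₀)) (rFl := ((2 ^ (d + 1) * Real.exp (δm / 2) * ((1 * C * (((|a| * (Real.exp δm * Real.exp δm) + C₁) * (π * (d + 1) / (((L ^ kk : ℕ) : ℝ) * W)) + rr * εk + 0 * (|a| * (Real.exp δm * Real.exp δm) + C₁)) * Real.exp (-((δm - 3 * δm / 4) * (((coverMargin L mv : ℕ) : ℝ)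 + 1)))) * cr + 1 * (Dp * εk) * ((|a| * (Real.exp δm * Real.exp δm) + C₁) * Real.exp (-((δm - 3 * δm / 4) * (((coverMargin L mv : ℕ) : ℝ) + 1)))) * cr) + (d + 1) * (1 * (|(((L ^ kk : ℕ) : ℝ))⁻¹| * C) * ((|a| * (Real.exp δm * Real.exp δm) + C₁) * Real.exp (-((δm - 3 * δm / 4) * (((coverMargin L mv : ℕ) : ℝ) + 1)))) * cr)) + (π * (d + 1) / (((L ^ kk : ℕ) : ℝ) * W)) * (2 ^ (d + 1) * ((1 : ℝ) * C * ((|a| * (Real.exp δm * Real.exp δm) + C₁) * Real.exp (-((δm - 3 * δm / 4) * (((coverMargin L mv : ℕ) : ℝ) + 1)))) * cr * Real.exp (δm / 2)))))) (r𝒲 := (((β * (rS * θ) + (mc * εk) * R₀) + cJ * (2 * ((βQ * (rS * θ) + ((1 * ((mf + mb) * εk8) + 0 * βQ)) * R₀) + (β * (rS * θ) + (mc * εk) * R₀))) + (β * 0 + (mc * εk) * 0) * cr) + (π * (d + 1) / (((L ^ kk : ℕ) : ℝ) * W)) * (β * R₀ + cJ * (2 * (βQ * R₀ + β * R₀)) +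 β * 0 * cr))) (rFE := ((1 - θA * cr)⁻¹ * ((2 ^ (d + 1) * Real.exp (δm / 2) * ((1 * C * (((|a| * (Real.exp δm * Real.exp δm) + C₁) * (π * (d + 1) / (((L ^ kk : ℕ) : ℝ) * W)) + rr * εk + 0 * (|a| * (Real.exp δm * Real.exp δm) + C₁)) * Real.exp (-((δm - 3 * δm / 4) * (((coverMargin L mv : ℕ) : ℝ) + 1)))) * cr + 1 * (Dp * εk) * ((|a| * (Real.exp δm * Real.exp δm) + C₁) * Real.exp (-((δm - 3 * δm / 4) * (((coverMargin L mv : ℕ) : ℝ) + 1)))) * cr) + (d + 1) * (1 * (|(((L ^ kk : ℕ) : ℝ))⁻¹| * C) * ((|a| * (Real.exp δm * Real.exp δm) + C₁) * Real.exp (-((δm - 3 * δm / 4) * (((coverMargin L mv : ℕ) : ℝ) + 1)))) * cr)) + (π * (d + 1) / (((L ^ kk : ℕ) : ℝ) * W)) * (2 ^ (d + 1) * ((1 : ℝ) * C * ((|a| * (Real.exp δm * Real.exp δm) + C₁) * Real.exp (-((δm - 3 * δm / 4) * (((coverMargin L mv : ℕ) : ℝ) + 1)))) * cr * Real.exp (δm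 / 2))))) * cr + (1 - θA * cr)⁻¹ * ((((β * (rS * θ) + (mc * εk) * R₀) + cJ * (2 * ((βQ * (rS * θ) + ((1 * ((mf + mb) * εk8) + 0 * βQ)) * R₀) + (β * (rS * θ) + (mc * εk) * R₀))) + (β * 0 + (mc * εk) * 0) * cr) + (π * (d + 1) / (((L ^ kk : ℕ) : ℝ) * W)) * (β * R₀ + cJ * (2 * (βQ * R₀ + β * R₀)) + β * 0 * cr)) * ((1 - θA * cr)⁻¹ * (κF * W⁻¹) * cr) * cr) * cr)) htri hd hsymm hd0 hrow T_hσ hβ0 hβ₁0 hβQ0 pi_pos.le hRsp0 hcr0 (mul_nonneg pi_pos.le hWinv0) (mul_nonneg pi_pos.le hWinv0) T_hc₂ ho₀0 ho₁0 ho₂0 hoχ0 (mul_nonneg hcNn0 hWinv0) hRNK0 hR₀0.le hrSθ0 le_rfl le_rfl (mul_nonneg hπD0 hWinv0) (mul_nonneg hπD0 hWinv0) hθA0 (mul_nonneg hmc.le hεk0) (mul_nonneg hmax hεk0) (mul_nonneg zero_le_two hoχ0) hoχ₂0 (mul_nonneg hrSθ0 hcJJ0.le) (mul_nonneg (add_nonneg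 hmf.le hmb.le) hεk80) hK1510 hoχ0 (half_pos hδm0) le_rfl (mul_nonneg (mul_nonneg hIA0 (mul_nonneg hκF0 hWinv0)) hcr0) le_rfl hRFE0 hos0 le_rfl hNov0 hR₀0.le hR₀0.le (mul_nonneg hκF0 hWinv0) hK1710 (mul_nonneg hmc.le hεk0) hmT0 hrSθ0 hrSθ0 T_hσρ T_hρ₁V T_hρ₁G T_hρ₂ T_hρ₂₁ T_hρ₃ T_hρ₃N T_hρ₃V T_hρ₃₂ T_hρ₂W T_hρ₁N T_hσρ₃
    (fun k x hx => Finset.mem_coe.mpr (blockOf_mem_cubeBlocks_of_inner_ne_zero hM hm₁ hfitI hS0 hx)) T_hSψ₂ (fun k x => abs_bcube_cover_le_one 2 k x) T_hdχt T_hdχtb (fun k => bcube_cover_lift_cut 2 ι hM hw hlo hhi hS6 k) (fun k => cut_bcube_cover_lift 2 ι hM hw hlo hhi hS6 k) (fun k μ => bcube_cover_lift_comp_shift_cut 2 ι hM hw hlo hhi hS6 k μ) (fun k μ => bcube_cover_lift_comp_shift_symm_cut 2 ι hM hw hlo hhi hS6 k μ) (fun k μ => fgrad_bcube_cover_lift_cut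 2 ι hM hw hlo hhi hS6 η⁻¹ k μ) (fun k μ => bgrad_bcube_cover_lift_cut 2 ι hM hw hlo hhi hS6 η⁻¹ k μ) (fun k x hx => Finset.mem_coe.mpr (blockOf_kingPrV_mem_cubeBlocks_of_inner_ne_zero hM hm₁ hfitI hS0 hx)) (fun k x hx => Finset.mem_coe.mpr (blockOf_kingPrV_mem_cubeBlocks_of_chiCube_ne_zero hx)) (fun k x hx => Finset.mem_coe.mpr (blockOf_kingPrV_mem_cubeBlocks_of_chiCube_ne_zero hx)) (fun k x => abs_bcube_cover_le_one 2 k x) T_hdχt' T_hdχtb' (fun k => bcube_cover_lift_cut 2 ι hM hw hlo hhi hS6 k) (fun k => cut_bcube_cover_lift 2 ι hM hw hlo hhi hS6 k) (fun k μ => bcube_cover_lift_comp_shift_cut 2 ι hM hw hlo hhi hS6 k μ) (fun k μ => bcube_cover_lift_comp_shift_symm_cut 2 ι hM hw hlo hhi hS6 k μ) (fun k μ => fgrad_bcube_cover_lift_cut 2 ι hM hw hlo hhi hS6 η'⁻¹ k μ) (fun k μ => bgrad_bcube_cover_lift_cut 2 ι hM hw hlo hhi hS6 η'⁻¹ k μ)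 (fun k => cutCube_comp_psi_cover_lift ι hM ha k) (fun k x' => abs_bcube_cover_fine_sub_le (L := L) (kk := kk) (r := r) 2 hM hw k x') T_hcut T_hcutF T_hcutB T_hcut' T_hcutF' T_hcutB' (fun k μ => cutCube_fgrad_cover_lift_sandwich ι hM hm₂ hfit₂ hS0 ha hηinv μ k) (fun k μ => cutCube_bgrad_cover_lift_sandwich ι hM hm₂ hfit₂ hS0 ha hηinv μ k) (fun k μ => cutCube_fgrad_cover_lift_sandwich ι hM hm₂ hfit₂ hS0 ha hη'inv μ k) (fun k μ => cutCube_bgrad_cover_lift_sandwich ι hM hm₂ hfit₂ hS0 ha hη'inv μ k) T_hTfr T_hTbr T_hTfr' T_hTbr' (fun k μ => rightEntryF_comp_psi_cover_lift ι μ k) (fun k μ => rightEntryB_comp_psi_cover_lift ι μ k) (fun k μ => rightEntryF_comp_psi_cover_lift ι μ k) (fun k μ => rightEntryB_comp_psi_cover_lift ι μ k) T_hDTf T_hDTb hV hV' hq hqA T_hθAle le_rfl le_rfl le_rfl T_hfit₁ T_hfit₁b T_hfit₂ T_hfit₂b T_hDcut T_hDcutF T_hDcutB hDV T_hhD T_hhB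 hh2 T_hh2f T_hh2b hfDπ hfBπ T_hf2 hf2fπ hf2bπ T_hh1 T_hh1b T_hh0 T_hh1' T_hh1b' T_hh0' T_hf1 T_hf1b T_hf0 T_hf0b T_hfit T_hLip T_hrh T_hrh' (fun k μ x h => coverH_layer_bwd hM hw hS6 k μ x h) (fun k μ x h => coverH_layer_fwd hM hw hS6 k μ x h) (fun k μ x h => coverH_layer_bwd hM hw hS6 k μ x h) (fun k μ x h => coverH_layer_fwd hM hw hS6 k μ x h) (fun k j x i => (hAg j x i).trans hrSle) (fun k μ x i => hfaT μ x i) (fun k μ x i => hfbT μ x i) T_hKN T_hDKN T_hNV T_hNV' T_hDNV T_hIcut T_hITf T_hITb hχπ0 (fun k => mulOp_comp_mulOp_of_support_left fun p hp => chiCube_eq_one_of_ne_zero hp) (fun k => mulOp_comp_mulOp_of_support_left fun p hp => chiCube_eq_one_of_ne_zero hp) (fun k x i => (hCg x i).trans hrSle) (fun k x i => (hCg' x i).trans hrSle) (fun k μ x i => (hga μ x i).trans hrSle) (fun k μ x i => (hgb μ x i).trans hrSle) (fun k μ x i => (hga' μ x i).trans hrSle) (fun k μ x i => (hgb' μ x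 i).trans hrSle) (fun k x i => hfc x i) (fun k μ x i => hfgT μ x i) (fun k μ x i => hfgb μ x i) T_hSψ (fun k => cutCube_comp_psi_cover_lift ι hM ha k) (fun k x => abs_chiCube_le_one _ x) (fun k x => abs_chiCube_le_one _ x) T_hfitχc (fun k x => abs_coverH_le_one k x) (fun k x => abs_coverH_le_one k x)
    (fun k => hcube_cut (2 * L) (fun ν (p : CvX d L mv kk hL × ι) => coverXi (cvM d L mv kk hL) (L ^ kk) (L ^ mv) ν p.1) (fun μ => liftEquiv ((bshiftEquiv (cvM d L mv kk hL) (L ^ kk)) μ) ι) 0 (hwin 0 k)) (fun k => hcube_cut (2 * L) (fun ν (p : CvX' d L mv kk r hL × ι) => coverXi (cvM d L mv kk hL) (L ^ r * L ^ kk) (L ^ mv) ν p.1) (fun μ => liftEquiv ((bshiftEquiv (cvM d L mv kk hL) (L ^ r * L ^ kk)) μ) ι) 0 (hwin' 0 k)) (fun k x h => coverH_layer_shift hM hw hS6 k ν x h) (fun k x h => coverH_layer_shift hM hw hS6 k ν x h) T_hfits hh2' (fun k μ p => abs_fgrad_fgrad_le_of _ _ (hh2' k μ) p) (fun k μ p =>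 abs_bgrad_bgrad_shift_le_of _ _ (hh2' k μ) p) (fun k j x i => (hAg' j x i).trans hrSle) T_hKN' (fun y => sum_ind_cubeBlocks_le (M := (cvM d L mv kk hL)) (w := L ^ mv) (q := L) (m₀ := coverMargin L mv) L kk y) (fun p => sum_coverH_sq p.1) (fun p => sum_coverH_sq p.1) hY hY' hcov₀ hcov₀' T_hflat T_hflat' T_hFlχ T_hFlψ T_hFlχ' T_hFlψ' T_hFl T_hFl' T_hDFl hqL
  -- the constant: `(1 − q)⁻¹ ≤ 2`, `W⁻¹ ≤ 1`, every two-grid letter `≤ κ·S`, one `gcongr`, one `ring`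
  refine key.mono fun y y' => ?_
  exact mul_le_mul (hsm.2.trans (mul_le_mul_of_nonneg_right hDle hSx0)) (Real.exp_le_exp.mpr (le_of_eq (by ring))) (Real.exp_nonneg _) (mul_nonneg hD0.le hSx0)

end Knit

end Summit.QuantumFields.YangMills.BalabanUVNodes.N15.Gluing

end
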